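import Literature.AlgebraicGeometry.Shioda1982.KoblitzOgusRelationsThirtySixPrime
import Literature.AlgebraicGeometry.Shioda1982.HodgeQuadruplesThirtySix
import Literature.AlgebraicGeometry.Shioda1982.HodgeQuadruplesEighteenPrime
import Literature.AlgebraicGeometry.Shioda1982.HodgeQuadruplesTwelvePrime
import Literature.AlgebraicGeometry.Shioda1982.HodgeQuadruplesTenPrime
import Literature.AlgebraicGeometry.Shioda1982.StandardElementsHodge
import HarnessLib

/-!
# Shioda 1982 / Aoki–Shioda 1983: the indecomposable Hodge quadruples of level `36p` (`p ≥ 19` prime)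

Topic `Literature/AlgebraicGeometry/Shioda1982`, companion to `KoblitzOgusRelationsThirtySixPrime` (the Koblitz–Ogus relation families of
level `36p`), `HodgeQuadruplesThirtySix` (the `84` pair-free Hodge quadruples of level `36`), `HodgeQuadruplesEighteenPrime` /
`HodgeQuadruplesTwelvePrime` (the classifications at the levels `m′ = 18p`, `m″ = 12p`) and the series `PicardNumber*.lean`.
THEOREMS (no named fact, no `sorry`): T. Shioda, *On the Picard number of a Fermat surface*, J. Fac. Sci. Univ. Tokyo IA **28** (1982)
725–734, Prop. 4 (Q′) p. 729, and N. Aoki, T. Shioda, *Generators of the Néron–Severi group of a Fermat surface* (1983), §2 Theorem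
(𝔅²ₘ) (ii), in multiset form at the levels `m = 36p`, `p ≥ 19` prime — the levels `4·9·p`, carrying all three standard kinds a), b), c)
(`m` even and `3 ∣ m`) above the exceptional level `36` of Meyer–Neutsch's Tabelle 1:

* **`classify_hodgeMultiset_thirtySixPrime`**: a pair-free Hodge `4`-multiset over `ℤ/36p` (`FermatCharacter.IsHodgeMultiset`, no two
  members summing to `0`) is `{x, x + 18p, −2x, 18p}` (type `α`, Shioda's (3) with `m′ = m/2`), `{x, x + 18p, 2x + 18p, −4x}` (type `β`,
  Shioda's (4)), `{x, x + 12p, x + 24p, −3x}` (type `γ`, `m″ = m/3`) for some residue `x`, or `x·r` with `x = t·p`, `t` a unit of `ℤ/36`,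
  and `r` one of the seven non-standard shapes of level `36` (`(1, 19, 24, 28)`, `(2, 9, 28, 33)` = Tabelle 1 at `N = 36`; `(2, 12, 28, 30)`,
  `(2, 14, 24, 32)`, `(2, 18, 24, 28)` = twice the rows of `N = 18`; `(3, 12, 27, 30)`, `(3, 18, 24, 27)` = three times the rows of `N = 12`)
  — `44` multisets, all inside `pℤ/36p ≅ ℤ/36` (`classify_hodgeMultiset_thirtySix`).
* **`isHodgeMultiset_transfer_thirtySixPrime`**: the transfer `T(s) = (odd members mod 18p) + 2·((even members)/2 mod 18p)` of a Hodge
  multiset of level `36p` is a Hodge multiset of level `18p` (the level-`36p` instance of Aoki's level-changing relations; cf.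
  `FermatCharacter.isHodgeMultiset_transfer_two`).

PROOF (this formalisation's route; the printed proofs go through Shioda's inductive structure [Shioda1982PicardFermat, §3] and
[AokiShioda1983, §3]). In the Chinese-remainder coordinates `w ↔ (u, c) ∈ ℤ/36 × ℤ/p`:
(0) all members in the fibre `c = 0` (`s ⊂ pℤ/36p`): `s = p·M` with `M` a pair-free Hodge quadruple of level `36`, classified by the
kernel table of `HodgeQuadruplesThirtySix` (`fibre_zero`); (1) all members divisible by `3`: `s = 3σ` with `σ` a pair-free Hodge
quadruple of level `12p` (`isHodgeMultiset_map_liftBy_iff` + `classify_hodgeMultiset_twelvePrime`; `case_all_triple`); (2) all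
members even: `s = 2σ`, level `18p` (`classify_hodgeMultiset_eighteenPrime`; `case_all_even`); (3) two odd members `x, y`: the four
Koblitz–Ogus families of `KoblitzOgusRelationsThirtySixPrime` (`relUnitA/B`, `relTwelve`, `gammaM4` — their tables are supported on the
odd residues mod `36`, so the even members are invisible) force `y = x + 18p` (`two_odd_core`); then `{x̄, z/2, w/2, 9p}` is a Hodge
quadruple of level `18p` and the level-`18p` theorem gives `α_x` / `β_x` (`case_two_odd`); two odd members inside `pℤ/36p` with the
even ones outside contradict the norm equations at the units `pt(1, λ)` (`case_two_odd_fibre`, the only place where `p ≥ 19` rather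
than `p ≥ 17` is used); (4) four odd members: either `s mod 18p` has a pair — then `s = {v₁, 18p − v₁, v₃, 18p − v₃}`, excluded by the
relations (`halfpair_odd`) — or it is a level-`18p` quadruple of type `γ`, and of its lifts to `36p` only `γ_x` satisfies the norm
equations at the units `1 + 12p`, `1 + 24p` (`three_thirds`; `case_all_odd`). SECOND IMPLEMENTATION (cell `pub-hfermat`,
`code/lit/picard/scope36p.py`): brute-force enumeration from Shioda's definition at `m = 612, 684` gives `(18p − 2) + (18p − 4) + (12p − 2)
+ 44` pair-free Hodge quadruples, all of the stated forms (`852`, `948`; `0` others).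

HONEST FRAMING (cell `pub-hfermat`): explicit algebraic cycles for specific Hodge classes on Fermat/Delsarte varieties; residual open
instances listed; no claim on general Hodge. (Surface classes are algebraic by Lefschetz (1,1); this file reproduces a published
classification of Hodge classes at the levels `36p` as a theorem about multisets.)

## References
* [Shioda1982PicardFermat] T. Shioda, *On the Picard number of a Fermat surface*, J. Fac. Sci. Univ. Tokyo IA 28 (1982) 725–734: §2 p. 726
  (`𝔍²ₘ(d) ≅ 𝔍²_{m/d}(1)`), §3 p. 727 (the method), §4 Lemma 1 p. 728 ((3), (4) are Hodge), Prop. 4 (Q′) p. 729, table p. 727 (row `m = 36`).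
* [AokiShioda1983] N. Aoki, T. Shioda, *Generators of the Néron–Severi group of a Fermat surface*, Progr. Math. 35 (1983), §2
  Theorem (𝔅²ₘ) (ii) a)–c).
* [MeyerNeutsch1981Fermatquadrupel] W. Meyer, W. Neutsch, *Fermatquadrupel*, Math. Ann. 256 (1981) 51–62, (13)–(15) p. 53, Tabelle 1 p. 54
  (rows `N = 12, 18, 36`).
* [Aoki1983] N. Aoki, Math. Ann. 266 (1983) 23–54, Prop. 2.2.
* [Deligne1982HodgeCycles] P. Deligne, LNM 900 (1982), Rem. 7.16 (a) (Koblitz–Ogus), through `KoblitzOgusRelationsThirtySixPrime`.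
* [Shioda1979PJA] T. Shioda, Proc. Japan Acad. 55A (1979), §1 eq. (2) (the Hodge condition).
-/

namespace Literature.AlgebraicGeometry.Shioda1982

open Finset Multiset
open Literature.AlgebraicGeometry.HodgeTheory Literature.AlgebraicGeometry.HodgeTheory.FermatCharacter

section ThirtySixPrimeClassification

variable {p : ℕ}

set_option linter.unusedSimpArgs false -- uniform simp sets across the case analyses (as in `HodgeQuadruplesTwentyPrime`)

/-! ### `ℤ/36p ≅ ℤ/36 × ℤ/p`: Chinese-remainder coordinates (as in `KoblitzOgusRelationsThirtySixPrime`) -/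

-- BEGIN DUP (verbatim pattern from HodgeQuadruplesTwentyPrime.lean; private there)
/-- The Chinese-remainder isomorphism `ℤ/36p ≃+* ℤ/36 × ℤ/p`. [folklore] -/
private def crt (h : Nat.Coprime 36 p) : ZMod (36 * p) ≃+* ZMod 36 × ZMod p := ZMod.chineseRemainder h

/-- The residue with coordinates `(e, b)`. [folklore] -/
private def pt (h : Nat.Coprime 36 p) (e : ZMod 36) (b : ZMod p) : ZMod (36 * p) := (crt h).symm (e, b)

/-- First coordinate = residue mod `36`. [folklore] -/
private theorem crt_fst (h : Nat.Coprime 36 p) [NeZero (36 * p)] (w : ZMod (36 * p)) :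
    (crt h w).1 = (w.val : ZMod 36) := by
  conv_lhs => rw [← ZMod.natCast_zmod_val w]
  rw [map_natCast, Prod.fst_natCast]

/-- Second coordinate = residue mod `p`. [folklore] -/
private theorem crt_snd (h : Nat.Coprime 36 p) [NeZero (36 * p)] (w : ZMod (36 * p)) :
    (crt h w).2 = (w.val : ZMod p) := by
  conv_lhs => rw [← ZMod.natCast_zmod_val w]
  rw [map_natCast, Prod.snd_natCast]

/-- `crt (pt e b) = (e, b)`. [folklore] -/
private theorem crt_pt (h : Nat.Coprime 36 p) (e : ZMod 36) (b : ZMod p) : crt h (pt h e b) = (e, b) :=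
  (crt h).apply_symm_apply (e, b)

/-- `pt (crt w) = w`. [folklore] -/
private theorem pt_crt (h : Nat.Coprime 36 p) (w : ZMod (36 * p)) : pt h (crt h w).1 (crt h w).2 = w :=
  (crt h).symm_apply_apply w

/-- `pt` is injective. [folklore] -/
private theorem pt_inj (h : Nat.Coprime 36 p) {e e' : ZMod 36} {b b' : ZMod p} :
    pt h e b = pt h e' b' ↔ e = e' ∧ b = b' := by
  rw [pt, pt, (crt h).symm.injective.eq_iff, Prod.mk.injEq]

/-- `pt` and negation. [folklore] -/
private theorem neg_pt (h : Nat.Coprime 36 p) (e : ZMod 36) (b : ZMod p) : -pt h e b = pt h (-e) (-b) := by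
  rw [pt, pt, ← (crt h).symm.map_neg, Prod.neg_mk]

/-- `pt` and natural multiples. [folklore] -/
private theorem natCast_mul_pt (h : Nat.Coprime 36 p) (k : ℕ) (e : ZMod 36) (b : ZMod p) :
    (k : ZMod (36 * p)) * pt h e b = pt h (k * e) (k * b) := by
  rw [pt, pt, ← nsmul_eq_mul, ← _root_.map_nsmul, Prod.smul_mk, nsmul_eq_mul, nsmul_eq_mul]

/-- `(36, p) = 1` for a prime `p ≥ 5`. [folklore] -/
private theorem coprime_thirtysix (hp : p.Prime) (h5 : 5 ≤ p) : Nat.Coprime 36 p := by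
  have h2 : Nat.Coprime 2 p := (Nat.coprime_primes Nat.prime_two hp).2 (by omega)
  have h3 : Nat.Coprime 3 p := (Nat.coprime_primes Nat.prime_three hp).2 (by omega)
  have h4 : Nat.Coprime 4 p := Nat.Coprime.mul_left h2 h2
  have h9 : Nat.Coprime 9 p := Nat.Coprime.mul_left h3 h3
  exact Nat.Coprime.mul_left h4 h9

/-- `pt` is additive. [folklore] -/
private theorem pt_add (h : Nat.Coprime 36 p) (e e' : ZMod 36) (b b' : ZMod p) :
    pt h e b + pt h e' b' = pt h (e + e') (b + b') := by
  rw [pt, pt, pt, ← (crt h).symm.map_add, Prod.mk_add_mk]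

/-- `pt` is multiplicative. [folklore] -/
private theorem pt_mul (h : Nat.Coprime 36 p) (e e' : ZMod 36) (b b' : ZMod p) :
    pt h e b * pt h e' b' = pt h (e * e') (b * b') := by
  rw [pt, pt, pt, ← (crt h).symm.map_mul, Prod.mk_mul_mk]

/-- `⟨pt e b⟩ mod 36` is `⟨e⟩`. [folklore] -/
private theorem val_pt_mod_thirtysix (h : Nat.Coprime 36 p) [NeZero (36 * p)] (e : ZMod 36) (b : ZMod p) :
    (pt h e b).val % 36 = e.val := by
  have := crt_fst h (pt h e b)
  rw [crt_pt] at this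
  have h2 := congrArg ZMod.val this
  rw [ZMod.val_natCast] at h2
  exact h2.symm

/-- `⟨pt e b⟩ mod p` is `b`. [folklore] -/
private theorem natCast_val_pt (h : Nat.Coprime 36 p) [NeZero (36 * p)] (e : ZMod 36) (b : ZMod p) :
    (((pt h e b).val : ℕ) : ZMod p) = b := by
  have := crt_snd h (pt h e b)
  rw [crt_pt] at this
  exact this.symm

/-- `⟨pt e b⟩ mod 2` is `⟨e⟩ mod 2`. [folklore] -/
private theorem val_pt_mod_two (h : Nat.Coprime 36 p) [NeZero (36 * p)] (e : ZMod 36) (b : ZMod p) :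
    (pt h e b).val % 2 = e.val % 2 := by
  rw [← Nat.mod_mod_of_dvd _ (by norm_num : 2 ∣ 36), val_pt_mod_thirtysix]

/-- The prime `p` as a residue mod `36`. -/
local notation "π" => ((p : ℕ) : ZMod 36)

/-- `crt p = (p mod 36, 0)`. [folklore] -/
private theorem crt_P (h : Nat.Coprime 36 p) [NeZero (36 * p)] : crt h (p : ZMod (36 * p)) = (π, 0) := by
  rw [Prod.ext_iff, crt_fst, crt_snd, ZMod.val_natCast]
  have hp36 : p % (36 * p) = p := Nat.mod_eq_of_lt (by have := NeZero.ne (36 * p); omega)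
  rw [hp36]
  exact ⟨rfl, ZMod.natCast_self p⟩

/-- `p = pt (p mod 36) 0`. [folklore] -/
private theorem P_eq_pt (h : Nat.Coprime 36 p) [NeZero (36 * p)] : (p : ZMod (36 * p)) = pt h π 0 := by
  rw [← pt_crt h (p : ZMod (36 * p)), crt_P]

/-- `18π = 18` in `ℤ/36` (`p` odd). [folklore] -/
private theorem eighteen_mul_pi (hp : p.Prime) (h5 : 5 ≤ p) : (18 : ZMod 36) * π = 18 := by
  have hp2 : p % 2 = 1 := Nat.odd_iff.mp (hp.odd_of_ne_two (by omega))
  obtain ⟨k, hk⟩ : ∃ k, p = 2 * k + 1 := ⟨p / 2, by omega⟩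
  have h36 : (36 : ZMod 36) = 0 := by decide
  rw [hk]; push_cast
  linear_combination (↑k : ZMod 36) * h36

/-- `k·p = pt (kπ) 0`. [folklore] -/
private theorem natCast_mul_P (h : Nat.Coprime 36 p) [NeZero (36 * p)] (k : ℕ) :
    ((k * p : ℕ) : ZMod (36 * p)) = pt h (k * π) 0 := by
  rw [Nat.cast_mul, P_eq_pt h, natCast_mul_pt, mul_zero]

/-- `18p = pt 18 0`. [folklore] -/
private theorem eighteenP_eq_pt (h : Nat.Coprime 36 p) [NeZero (36 * p)] (hp : p.Prime) (h5 : 5 ≤ p) :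
    ((18 * p : ℕ) : ZMod (36 * p)) = pt h 18 0 := by
  rw [natCast_mul_P h, Nat.cast_ofNat, eighteen_mul_pi hp h5]

/-- `pt 1 1 = 1`. [folklore] -/
private theorem pt_one (h : Nat.Coprime 36 p) : pt h 1 1 = 1 := by
  show (crt h).symm (1, 1) = 1
  exact _root_.map_one (crt h).symm

/-- `pt 0 0 = 0`. [folklore] -/
private theorem pt_zero (h : Nat.Coprime 36 p) : pt h 0 0 = 0 := by
  show (crt h).symm (0, 0) = 0
  exact _root_.map_zero (crt h).symm

/-- `pt 1 b` is a unit for `b ≠ 0` (`p` prime). [folklore] -/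
private theorem isUnit_pt_one (h : Nat.Coprime 36 p) (hp : p.Prime) {b : ZMod p} (hb : b ≠ 0) : IsUnit (pt h 1 b) := by
  haveI := Fact.mk hp
  exact IsUnit.of_mul_eq_one (pt h 1 b⁻¹) (by rw [pt_mul, mul_one, mul_inv_cancel₀ hb, pt_one])

/-- The parity of the first coordinate is the parity of the residue. [folklore] -/
private theorem fst_val_mod_two (h : Nat.Coprime 36 p) [NeZero (36 * p)] (w : ZMod (36 * p)) :
    (crt h w).1.val % 2 = w.val % 2 := by
  rw [crt_fst, ZMod.val_natCast, Nat.mod_mod_of_dvd _ (by norm_num : 2 ∣ 36)]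
-- END DUP

/-! ### Small multiples in `ℤ/p` -/

/-- `n ≠ 0` in `ℤ/p` for `0 < n < p`. [folklore] -/
private theorem natCast_ne_zero_of_lt {n : ℕ} (h0 : 0 < n) (hn : n < p) : (n : ZMod p) ≠ 0 := by
  intro h
  rw [ZMod.natCast_eq_zero_iff] at h
  exact absurd (Nat.le_of_dvd h0 h) (by omega)

/-- **`{2, 3, 5, 7, 13}`-smooth multiples of a non-zero element are non-zero** (`p ≥ 17` prime): the non-coincidences of the fibres
`±λδ` used below. [folklore] -/
private theorem smooth_mul_ne_zero (hp : p.Prime) (h17 : 17 ≤ p) (a b c d e : ℕ) {δ : ZMod p} (hδ : δ ≠ 0) :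
    (2 : ZMod p) ^ a * 3 ^ b * 5 ^ c * 7 ^ d * 13 ^ e * δ ≠ 0 := by
  haveI := Fact.mk hp
  have h2 : (2 : ZMod p) ≠ 0 := by exact_mod_cast natCast_ne_zero_of_lt (p := p) (n := 2) (by norm_num) (by omega)
  have h3 : (3 : ZMod p) ≠ 0 := by exact_mod_cast natCast_ne_zero_of_lt (p := p) (n := 3) (by norm_num) (by omega)
  have h5 : (5 : ZMod p) ≠ 0 := by exact_mod_cast natCast_ne_zero_of_lt (p := p) (n := 5) (by norm_num) (by omega)
  have h7 : (7 : ZMod p) ≠ 0 := by exact_mod_cast natCast_ne_zero_of_lt (p := p) (n := 7) (by norm_num) (by omega)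
  have h13 : (13 : ZMod p) ≠ 0 := by exact_mod_cast natCast_ne_zero_of_lt (p := p) (n := 13) (by norm_num) (by omega)
  exact mul_ne_zero (mul_ne_zero (mul_ne_zero (mul_ne_zero (mul_ne_zero (pow_ne_zero _ h2) (pow_ne_zero _ h3))
    (pow_ne_zero _ h5)) (pow_ne_zero _ h7)) (pow_ne_zero _ h13)) hδ

/-- `36 ≠ 0` in `ℤ/p` when `(36, p) = 1`, `p` prime. [folklore] -/
private theorem thirtysix_ne_zero (h : Nat.Coprime 36 p) (hp : p.Prime) : ((36 : ℕ) : ZMod p) ≠ 0 := by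
  intro h0
  rw [ZMod.natCast_eq_zero_iff] at h0
  have h1 : p ∣ Nat.gcd 36 p := Nat.dvd_gcd h0 (dvd_refl p)
  rw [h] at h1
  exact hp.one_lt.ne' (Nat.dvd_one.mp h1)

/-! ### The odd part in coordinates; the functionals used and their tables mod `36` -/

/-- The odd part of the multiplicity function of `T : Multiset (ℤ/36 × ℤ/p)`: `o(q) = #_q T − #_{−q} T`. [folklore] -/
private def oc (T : Multiset (ZMod 36 × ZMod p)) (q : ZMod 36 × ZMod p) : ℤ := (count q T : ℤ) - count (-q) T

/-- `oddCt` at a coordinate point is the odd part of `s.map crt`. [folklore] -/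
private theorem oddCt_crtPt36 (h : Nat.Coprime 36 p) (s : Multiset (ZMod (36 * p))) (e : ZMod 36) (c : ZMod p) :
    oddCt s (crtPt36 h e c) = oc (s.map (crt h)) (e, c) := by
  classical
  have hc : ∀ q : ZMod 36 × ZMod p, count q (s.map (crt h)) = count ((crt h).symm q) s := fun q ↦ by
    rw [← Multiset.count_map_eq_count' _ _ (crt h).symm.injective, Multiset.map_map]
    simp only [Function.comp_def, RingEquiv.symm_apply_apply, Multiset.map_id']
  simp only [oddCt, oc, hc]
  show (count ((crt h).symm (e, c)) s : ℤ) - count (-(crt h).symm (e, c)) s =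
    count ((crt h).symm (e, c)) s - count ((crt h).symm (-(e, c))) s
  rw [map_neg]

/-- Table of `Z_A` (even under `e ↦ −e`; units only). [folklore] -/
private def tZA (e : ZMod 36) : ℤ :=
  if e.val = 5 ∨ e.val = 11 ∨ e.val = 25 ∨ e.val = 31 then 1 else if e.val = 7 ∨ e.val = 13 ∨ e.val = 23 ∨ e.val = 29 then -1 else 0

/-- Table of `Z_B` (even; units only). [folklore] -/
private def tZB (e : ZMod 36) : ℤ :=
  if e.val = 1 ∨ e.val = 7 ∨ e.val = 29 ∨ e.val = 35 then 1 else if e.val = 11 ∨ e.val = 17 ∨ e.val = 19 ∨ e.val = 25 then -1 else 0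

/-- The even character `χ₁₂ = χ₋₄χ₃` on the units of `ℤ/36` (`0` elsewhere): the unit table of `Z₁₂`. [folklore] -/
private def tU12 (e : ZMod 36) : ℤ :=
  if e.val = 1 ∨ e.val = 11 ∨ e.val = 13 ∨ e.val = 23 ∨ e.val = 25 ∨ e.val = 35 then 1
  else if e.val = 5 ∨ e.val = 7 ∨ e.val = 17 ∨ e.val = 19 ∨ e.val = 29 ∨ e.val = 31 then -1 else 0

/-- The table of `Z₁₂` on the odd multiples of `3`: `3χ₁₂(v/3)`. [folklore] -/
private def tT12 (e : ZMod 36) : ℤ := if e.val = 3 ∨ e.val = 33 then 3 else if e.val = 15 ∨ e.val = 21 then -3 else 0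

/-- `−χ₋₄` on the units of `ℤ/36` (`0` elsewhere): the unit table of `Γ₋₄` (odd under `e ↦ −e`). [folklore] -/
private def tU4 (e : ZMod 36) : ℤ :=
  if e.val = 1 ∨ e.val = 5 ∨ e.val = 13 ∨ e.val = 17 ∨ e.val = 25 ∨ e.val = 29 then -1
  else if e.val = 7 ∨ e.val = 11 ∨ e.val = 19 ∨ e.val = 23 ∨ e.val = 31 ∨ e.val = 35 then 1 else 0

/-- The table of `Γ₋₄` on the odd multiples of `3`: `−3χ₋₄(v/3)` (odd). [folklore] -/
private def tT4 (e : ZMod 36) : ℤ := if e.val = 3 ∨ e.val = 15 then -3 else if e.val = 21 ∨ e.val = 33 then 3 else 0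

/-- The table of `Γ₋₄` on `{9, 27}`: `−6χ₋₄(v/9)` (odd). [folklore] -/
private def tN4 (e : ZMod 36) : ℤ := if e.val = 9 then -6 else if e.val = 27 then 6 else 0

variable (T : Multiset (ZMod 36 × ZMod p))

/-- `Z_A(b) = ô(5,b) − ô(7,b) + ô(11,b) − ô(13,b) − ô(23,b) + ô(25,b) − ô(29,b) + ô(31,b)` in coordinates. [folklore] -/
private def cZA (b : ZMod p) : ℤ :=
  oc T (5, b) - oc T (7, b) + oc T (11, b) - oc T (13, b) - oc T (23, b) + oc T (25, b) - oc T (29, b) + oc T (31, b)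

/-- `Z_B(b) = ô(1,b) + ô(7,b) − ô(11,b) − ô(17,b) − ô(19,b) − ô(25,b) + ô(29,b) + ô(35,b)` in coordinates. [folklore] -/
private def cZB (b : ZMod p) : ℤ :=
  oc T (1, b) + oc T (7, b) - oc T (11, b) - oc T (17, b) - oc T (19, b) - oc T (25, b) + oc T (29, b) + oc T (35, b)

/-- The unit part `Σ_{u∈U} χ₁₂(u) ô(u, b)` of `Z₁₂`. [folklore] -/
private def cU12 (b : ZMod p) : ℤ :=
  oc T (1, b) - oc T (5, b) - oc T (7, b) + oc T (11, b) + oc T (13, b) - oc T (17, b) - oc T (19, b) + oc T (23, b) +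
    oc T (25, b) - oc T (29, b) - oc T (31, b) + oc T (35, b)

/-- The part `3 Σ_{v∈T} χ₁₂(v/3) ô(v, b)` of `Z₁₂` (placed at the fibre `3c`). [folklore] -/
private def cT12 (b : ZMod p) : ℤ := 3 * oc T (3, b) - 3 * oc T (15, b) - 3 * oc T (21, b) + 3 * oc T (33, b)

/-- `Z₁₂(b) = (unit part at b) + (3-part at 3b)`. [folklore] -/
private def cZ12 (b : ZMod p) : ℤ := cU12 T b + cT12 T (3 * b)

/-- The unit part `−Σ_{u∈U} χ₋₄(u) ô(u, b)` of `Γ₋₄` (placed at the fibres `c` and `3c`). [folklore] -/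
private def cU4 (b : ZMod p) : ℤ :=
  -oc T (1, b) - oc T (5, b) + oc T (7, b) + oc T (11, b) - oc T (13, b) - oc T (17, b) + oc T (19, b) + oc T (23, b) -
    oc T (25, b) - oc T (29, b) + oc T (31, b) + oc T (35, b)

/-- The part `−3 Σ_{v∈T} χ₋₄(v/3) ô(v, b)` of `Γ₋₄` (placed at the fibres `3c` and `9c`). [folklore] -/
private def cT4 (b : ZMod p) : ℤ := -(3 * oc T (3, b)) - 3 * oc T (15, b) + 3 * oc T (21, b) + 3 * oc T (33, b)

/-- The part `−6(ô(9, b) − ô(27, b))` of `Γ₋₄` (placed at the fibre `9c`). [folklore] -/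
private def cN4 (b : ZMod p) : ℤ := -(6 * oc T (9, b)) + 6 * oc T (27, b)

/-- `Γ₋₄(b)` in coordinates (the tree's `gammaM4Sum36`; fibres `b, 3b, 9b`). [folklore] -/
private def cG4 (b : ZMod p) : ℤ := cU4 T b + cU4 T (3 * b) + cT4 T (3 * b) + cT4 T (9 * b) + cN4 T (9 * b)

/-- The four relation families used, on the coordinates of a Hodge multiset of level `36p`: `Z_A = Z_B = Z₁₂ = 0` fibrewise and
`Γ₋₄` constant. [folklore] -/
private structure Rels (T : Multiset (ZMod 36 × ZMod p)) : Prop where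
  za : ∀ b : ZMod p, b ≠ 0 → cZA T b = 0
  zb : ∀ b : ZMod p, b ≠ 0 → cZB T b = 0
  z12 : ∀ b : ZMod p, b ≠ 0 → cZ12 T b = 0
  g4 : ∀ b b' : ZMod p, b ≠ 0 → b' ≠ 0 → cG4 T b = cG4 T b'

variable {T}

/-- **The relations `Z_A`, `Z_B`, `Z₁₂`, `Γ₋₄` for the coordinates of a Hodge multiset of level `36p`** (the tree's
`relUnitA/relUnitB/relTwelve/gammaM4_thirtySixPrime`). [cite: Deligne1982HodgeCycles, Rem. 7.16 (a)] [cite: Aoki1983, Prop. 2.2] -/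
private theorem rels_of_isHodgeMultiset (h : Nat.Coprime 36 p) [NeZero (36 * p)] (hp : p.Prime) (h5 : 5 ≤ p)
    {s : Multiset (ZMod (36 * p))} (hs : IsHodgeMultiset s) : Rels (s.map (crt h)) := by
  refine ⟨fun b hb ↦ ?_, fun b hb ↦ ?_, fun b hb ↦ ?_, fun b b' hb hb' ↦ ?_⟩
  · have key := relUnitA_thirtySixPrime hp h5 h hs hb
    simp only [oddCt_crtPt36] at key
    simp only [cZA]
    linear_combination key
  · have key := relUnitB_thirtySixPrime hp h5 h hs hb
    simp only [oddCt_crtPt36] at key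
    simp only [cZB]
    linear_combination key
  · have key := relTwelve_thirtySixPrime hp h5 h hs hb
    simp only [oddCt_crtPt36] at key
    simp only [cZ12, cU12, cT12]
    linear_combination key
  · have key := gammaM4_thirtySixPrime hp h5 h hs hb hb'
    simp only [gammaM4Sum36, oddCt_crtPt36] at key
    simp only [cG4, cU4, cT4, cN4]
    linear_combination key

/-! ### Evaluating the functionals on explicit multisets: member contributions -/

/-- `o(u, x) = 0` when no member lies over `±x`. [folklore] -/
private theorem oc_eq_zero_of_free {T : Multiset (ZMod 36 × ZMod p)} {x : ZMod p}
    (hx : ∀ q ∈ T, q.2 ≠ x ∧ q.2 ≠ -x) (u : ZMod 36) : oc T (u, x) = 0 := by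
  classical
  have h1 : count (u, x) T = 0 := Multiset.count_eq_zero.mpr fun hm ↦ (hx _ hm).1 rfl
  have h2 : count (-u, -x) T = 0 := Multiset.count_eq_zero.mpr fun hm ↦ (hx _ hm).2 rfl
  simp [oc, Prod.neg_mk, h1, h2]

/-- `o` of the empty multiset. [folklore] -/
private theorem oc_zero (q : ZMod 36 × ZMod p) : oc (0 : Multiset (ZMod 36 × ZMod p)) q = 0 := by simp [oc]

/-- `o` of `a ::ₘ T`. [folklore] -/
private theorem oc_cons (a : ZMod 36 × ZMod p) (T : Multiset (ZMod 36 × ZMod p)) (q : ZMod 36 × ZMod p) :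
    oc (a ::ₘ T) q = oc T q + ((if q = a then 1 else 0) - (if -q = a then 1 else 0)) := by
  simp only [oc, Multiset.count_cons, Nat.cast_add, Nat.cast_ite, Nat.cast_one, Nat.cast_zero]
  ring

/-- The contribution of a member `(f, d)` to `Z_A(b)` (even brackets). [folklore] -/
private theorem cZA_cons (f : ZMod 36) (d : ZMod p) (T : Multiset (ZMod 36 × ZMod p)) (b : ZMod p) :
    cZA ((f, d) ::ₘ T) b = cZA T b + tZA f * ((if b = d then 1 else 0) - (if -b = d then 1 else 0)) := by
  simp only [cZA, oc_cons, Prod.mk.injEq, Prod.neg_mk]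
  fin_cases f <;> simp +decide [tZA] <;> split_ifs <;> omega

/-- The contribution of a member `(f, d)` to `Z_B(b)` (even brackets). [folklore] -/
private theorem cZB_cons (f : ZMod 36) (d : ZMod p) (T : Multiset (ZMod 36 × ZMod p)) (b : ZMod p) :
    cZB ((f, d) ::ₘ T) b = cZB T b + tZB f * ((if b = d then 1 else 0) - (if -b = d then 1 else 0)) := by
  simp only [cZB, oc_cons, Prod.mk.injEq, Prod.neg_mk]
  fin_cases f <;> simp +decide [tZB] <;> split_ifs <;> omega

/-- The contribution of a member `(f, d)` to the unit part of `Z₁₂` (even brackets). [folklore] -/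
private theorem cU12_cons (f : ZMod 36) (d : ZMod p) (T : Multiset (ZMod 36 × ZMod p)) (b : ZMod p) :
    cU12 ((f, d) ::ₘ T) b = cU12 T b + tU12 f * ((if b = d then 1 else 0) - (if -b = d then 1 else 0)) := by
  simp only [cU12, oc_cons, Prod.mk.injEq, Prod.neg_mk]
  fin_cases f <;> simp +decide [tU12] <;> split_ifs <;> omega

/-- The contribution of a member `(f, d)` to the `3`-part of `Z₁₂` (even brackets). [folklore] -/
private theorem cT12_cons (f : ZMod 36) (d : ZMod p) (T : Multiset (ZMod 36 × ZMod p)) (b : ZMod p) :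
    cT12 ((f, d) ::ₘ T) b = cT12 T b + tT12 f * ((if b = d then 1 else 0) - (if -b = d then 1 else 0)) := by
  simp only [cT12, oc_cons, Prod.mk.injEq, Prod.neg_mk]
  fin_cases f <;> simp +decide [tT12] <;> split_ifs <;> omega

/-- The contribution of a member `(f, d)` to the unit part of `Γ₋₄` (odd brackets). [folklore] -/
private theorem cU4_cons (f : ZMod 36) (d : ZMod p) (T : Multiset (ZMod 36 × ZMod p)) (b : ZMod p) :
    cU4 ((f, d) ::ₘ T) b = cU4 T b + tU4 f * ((if b = d then 1 else 0) + (if -b = d then 1 else 0)) := by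
  simp only [cU4, oc_cons, Prod.mk.injEq, Prod.neg_mk]
  fin_cases f <;> simp +decide [tU4] <;> split_ifs <;> omega

/-- The contribution of a member `(f, d)` to the `3`-part of `Γ₋₄` (odd brackets). [folklore] -/
private theorem cT4_cons (f : ZMod 36) (d : ZMod p) (T : Multiset (ZMod 36 × ZMod p)) (b : ZMod p) :
    cT4 ((f, d) ::ₘ T) b = cT4 T b + tT4 f * ((if b = d then 1 else 0) + (if -b = d then 1 else 0)) := by
  simp only [cT4, oc_cons, Prod.mk.injEq, Prod.neg_mk]
  fin_cases f <;> simp +decide [tT4] <;> split_ifs <;> omega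

/-- The contribution of a member `(f, d)` to the `9`-part of `Γ₋₄` (odd brackets). [folklore] -/
private theorem cN4_cons (f : ZMod 36) (d : ZMod p) (T : Multiset (ZMod 36 × ZMod p)) (b : ZMod p) :
    cN4 ((f, d) ::ₘ T) b = cN4 T b + tN4 f * ((if b = d then 1 else 0) + (if -b = d then 1 else 0)) := by
  simp only [cN4, oc_cons, Prod.mk.injEq, Prod.neg_mk]
  fin_cases f <;> simp +decide [tN4] <;> split_ifs <;> omega

/-- The contribution of a member `(f, d)` to `Z₁₂(b)`. [folklore] -/
private theorem cZ12_cons (f : ZMod 36) (d : ZMod p) (T : Multiset (ZMod 36 × ZMod p)) (b : ZMod p) :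
    cZ12 ((f, d) ::ₘ T) b = cZ12 T b + tU12 f * ((if b = d then 1 else 0) - (if -b = d then 1 else 0)) +
      tT12 f * ((if 3 * b = d then 1 else 0) - (if -(3 * b) = d then 1 else 0)) := by
  simp only [cZ12, cU12_cons, cT12_cons]; ring

/-- The contribution of a member `(f, d)` to `Γ₋₄(b)`. [folklore] -/
private theorem cG4_cons (f : ZMod 36) (d : ZMod p) (T : Multiset (ZMod 36 × ZMod p)) (b : ZMod p) :
    cG4 ((f, d) ::ₘ T) b = cG4 T b + tU4 f * ((if b = d then 1 else 0) + (if -b = d then 1 else 0)) +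
      (tU4 f + tT4 f) * ((if 3 * b = d then 1 else 0) + (if -(3 * b) = d then 1 else 0)) +
      (tT4 f + tN4 f) * ((if 9 * b = d then 1 else 0) + (if -(9 * b) = d then 1 else 0)) := by
  simp only [cG4, cU4_cons, cT4_cons, cN4_cons]; ring

/-- `cZA` of the empty multiset. [folklore] -/
private theorem cZA_zero (b : ZMod p) : cZA (0 : Multiset (ZMod 36 × ZMod p)) b = 0 := by simp [cZA, oc_zero]

/-- `cZB` of the empty multiset. [folklore] -/
private theorem cZB_zero (b : ZMod p) : cZB (0 : Multiset (ZMod 36 × ZMod p)) b = 0 := by simp [cZB, oc_zero]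

/-- `cZ12` of the empty multiset. [folklore] -/
private theorem cZ12_zero (b : ZMod p) : cZ12 (0 : Multiset (ZMod 36 × ZMod p)) b = 0 := by simp [cZ12, cU12, cT12, oc_zero]

/-- `cG4` of the empty multiset. [folklore] -/
private theorem cG4_zero (b : ZMod p) : cG4 (0 : Multiset (ZMod 36 × ZMod p)) b = 0 := by simp [cG4, cU4, cT4, cN4, oc_zero]

/-- `cZA` of a singleton. [folklore] -/
private theorem cZA_singleton (f : ZMod 36) (d : ZMod p) (b : ZMod p) :
    cZA ({(f, d)} : Multiset (ZMod 36 × ZMod p)) b = tZA f * ((if b = d then 1 else 0) - (if -b = d then 1 else 0)) := by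
  rw [← Multiset.cons_zero, cZA_cons, cZA_zero, zero_add]

/-- `cZB` of a singleton. [folklore] -/
private theorem cZB_singleton (f : ZMod 36) (d : ZMod p) (b : ZMod p) :
    cZB ({(f, d)} : Multiset (ZMod 36 × ZMod p)) b = tZB f * ((if b = d then 1 else 0) - (if -b = d then 1 else 0)) := by
  rw [← Multiset.cons_zero, cZB_cons, cZB_zero, zero_add]

/-- `cZ12` of a singleton. [folklore] -/
private theorem cZ12_singleton (f : ZMod 36) (d : ZMod p) (b : ZMod p) :
    cZ12 ({(f, d)} : Multiset (ZMod 36 × ZMod p)) b = tU12 f * ((if b = d then 1 else 0) - (if -b = d then 1 else 0)) +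
      tT12 f * ((if 3 * b = d then 1 else 0) - (if -(3 * b) = d then 1 else 0)) := by
  rw [← Multiset.cons_zero, cZ12_cons, cZ12_zero, zero_add]

/-- `cG4` of a singleton. [folklore] -/
private theorem cG4_singleton (f : ZMod 36) (d : ZMod p) (b : ZMod p) :
    cG4 ({(f, d)} : Multiset (ZMod 36 × ZMod p)) b = tU4 f * ((if b = d then 1 else 0) + (if -b = d then 1 else 0)) +
      (tU4 f + tT4 f) * ((if 3 * b = d then 1 else 0) + (if -(3 * b) = d then 1 else 0)) +
      (tT4 f + tN4 f) * ((if 9 * b = d then 1 else 0) + (if -(9 * b) = d then 1 else 0)) := by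
  rw [← Multiset.cons_zero, cG4_cons, cG4_zero, zero_add]

/-! ### Finite facts about the tables mod `36` -/

/-- A bracket sum `[x = d] + [−x = d]` with `x ≠ 0` (`p` odd) is `0` or `1`. [folklore] -/
private theorem bracket01 (hp : p.Prime) (h5 : 5 ≤ p) {x d : ZMod p} (hx : x ≠ 0) :
    ((if x = d then (1 : ℤ) else 0) + (if -x = d then 1 else 0)) = 0 ∨
      ((if x = d then (1 : ℤ) else 0) + (if -x = d then 1 else 0)) = 1 := by
  haveI := Fact.mk hp
  have h2 : (2 : ZMod p) ≠ 0 := by exact_mod_cast natCast_ne_zero_of_lt (p := p) (n := 2) (by norm_num) (by omega)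
  by_cases hA : x = d <;> by_cases hB : -x = d
  · exfalso
    exact mul_ne_zero h2 hx (by linear_combination hA - hB)
  · right; rw [if_pos hA, if_neg hB]; norm_num
  · right; rw [if_neg hA, if_pos hB]; norm_num
  · left; rw [if_neg hA, if_neg hB]; norm_num

/-- Reflected brackets, even type: `[b = −d] − [−b = −d] = −([b = d] − [−b = d])`. [folklore] -/
private theorem brkE (b d : ZMod p) :
    ((if b = -d then (1 : ℤ) else 0) - (if -b = -d then 1 else 0)) = -((if b = d then 1 else 0) - (if -b = d then 1 else 0)) := by
  have e1 : (b = -d) = (-b = d) := propext ⟨fun h ↦ by rw [h, neg_neg], fun h ↦ by rw [← h, neg_neg]⟩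
  have e2 : (-b = -d) = (b = d) := propext neg_inj
  simp only [e1, e2]; ring

/-- Reflected brackets, odd type: `[b = −d] + [−b = −d] = [b = d] + [−b = d]`. [folklore] -/
private theorem brkO (b d : ZMod p) :
    ((if b = -d then (1 : ℤ) else 0) + (if -b = -d then 1 else 0)) = ((if b = d then 1 else 0) + (if -b = d then 1 else 0)) := by
  have e1 : (b = -d) = (-b = d) := propext ⟨fun h ↦ by rw [h, neg_neg], fun h ↦ by rw [← h, neg_neg]⟩
  have e2 : (-b = -d) = (b = d) := propext neg_inj
  simp only [e1, e2]; ring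

/-- Table (same fibre): the relations for two odd members `(e, c), (e′, c)` force `e′ = e + 18`. [folklore] -/
private theorem tab_same {e e' : ZMod 36} (he : e.val % 2 = 1) (he' : e'.val % 2 = 1) (hA : tZA e + tZA e' = 0)
    (hB : tZB e + tZB e' = 0) (h12 : tT12 e + tT12 e' = 0) (h4b : tU4 e + tT4 e + (tU4 e' + tT4 e') = 0)
    (h4c : tT4 e + tN4 e + (tT4 e' + tN4 e') = 0) : e' = e + 18 := by
  revert e e' he he' hA hB h12 h4b h4c; decide

/-- Table (opposite fibres): the relations for two odd members `(e, c), (e′, −c)` force `e′ = −e`. [folklore] -/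
private theorem tab_neg {e e' : ZMod 36} (he : e.val % 2 = 1) (he' : e'.val % 2 = 1) (hA : tZA e = tZA e')
    (hB : tZB e = tZB e') (h12 : tT12 e = tT12 e') (h4b : tU4 e + tT4 e + (tU4 e' + tT4 e') = 0)
    (h4c : tT4 e + tN4 e + (tT4 e' + tN4 e') = 0) : e' = -e := by
  revert e e' he he' hA hB h12 h4b h4c; decide

/-- Table (generic fibre): an odd `e` invisible to `Z_A`, `Z_B` (so `e ∈ {3, 9, 15, 21, 27, 33}`) cannot have its weight in `Γ₋₄(c/9)`
cancelled by a second odd member unless that member is an odd multiple of `3` (not of `9`) over `±c/3`. [folklore] -/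
private theorem tab_gen {e e' : ZMod 36} (he : e.val % 2 = 1) (he' : e'.val % 2 = 1) (hA : tZA e = 0) (hB : tZB e = 0)
    {B₁ B₂ : ℤ} (hB₁ : B₁ = 0 ∨ B₁ = 1) (hB₂ : B₂ = 0 ∨ B₂ = 1)
    (hg : tT4 e + tN4 e + tU4 e' * B₁ + (tU4 e' + tT4 e') * B₂ = 0) : B₂ = 1 ∧ tT4 e' + tN4 e' ≠ 0 := by
  rcases hB₁ with rfl | rfl <;> rcases hB₂ with rfl | rfl <;> revert e e' he he' hA hB hg <;> decide

/-- Table (reflection `f ↦ 18 − f` of an odd residue): the even tables change sign, the odd ones do not. [folklore] -/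
private theorem tab_reflect {f : ZMod 36} (hf : f.val % 2 = 1) :
    tZA (18 - f) = -tZA f ∧ tZB (18 - f) = -tZB f ∧ tU12 (18 - f) = -tU12 f ∧ tT12 (18 - f) = -tT12 f ∧
      tU4 (18 - f) = tU4 f ∧ tT4 (18 - f) = tT4 f ∧ tN4 (18 - f) = tN4 f := by
  revert f hf; decide

/-- The tables vanish on an even residue. [folklore] -/
private theorem even_tables {f : ZMod 36} (hf : f.val % 2 = 0) :
    tZA f = 0 ∧ tZB f = 0 ∧ tU12 f = 0 ∧ tT12 f = 0 ∧ tU4 f = 0 ∧ tT4 f = 0 ∧ tN4 f = 0 := by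
  revert f hf; decide

/-- Even members are invisible to the four relations. [folklore] -/
private theorem Rels.of_cons_even {q : ZMod 36 × ZMod p} {T : Multiset (ZMod 36 × ZMod p)} (h : Rels (q ::ₘ T))
    (hq : q.1.val % 2 = 0) : Rels T := by
  obtain ⟨f, d⟩ := q
  obtain ⟨hA, hB, hu12, ht12, hu4, ht4, hn4⟩ := even_tables (f := f) hq
  refine ⟨fun b hb ↦ ?_, fun b hb ↦ ?_, fun b hb ↦ ?_, fun b b' hb hb' ↦ ?_⟩
  · have := h.za b hb
    rw [cZA_cons, hA, zero_mul, add_zero] at this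
    exact this
  · have := h.zb b hb
    rw [cZB_cons, hB, zero_mul, add_zero] at this
    exact this
  · have := h.z12 b hb
    rw [cZ12_cons, hu12, ht12, zero_mul, zero_mul, add_zero, add_zero] at this
    exact this
  · have := h.g4 b b' hb hb'
    simp only [cG4_cons, hu4, ht4, hn4, add_zero, zero_mul] at this
    exact this

/-! ### `Γ₋₄ ≡ 0` for a two-element coordinate multiset: a parameter whose fibres carry no member -/

/-- **For a `2`-element coordinate multiset and `p ≥ 17` some `b₀ ≠ 0` has no member over `±b₀, ±3b₀, ±9b₀`** (at most `12`
parameters are excluded). [folklore] -/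
private theorem exists_free2 (hp : p.Prime) (h17 : 17 ≤ p) (T : Multiset (ZMod 36 × ZMod p)) (hT : card T = 2) :
    ∃ b : ZMod p, b ≠ 0 ∧ (∀ q ∈ T, q.2 ≠ b ∧ q.2 ≠ -b) ∧ (∀ q ∈ T, q.2 ≠ 3 * b ∧ q.2 ≠ -(3 * b)) ∧
      ∀ q ∈ T, q.2 ≠ 9 * b ∧ q.2 ≠ -(9 * b) := by
  classical
  haveI := Fact.mk hp
  have h3 : (3 : ZMod p) ≠ 0 := by exact_mod_cast natCast_ne_zero_of_lt (p := p) (n := 3) (by norm_num) (by omega)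
  have h9 : (9 : ZMod p) ≠ 0 := by exact_mod_cast natCast_ne_zero_of_lt (p := p) (n := 9) (by norm_num) (by omega)
  let B : Finset (ZMod p) := {0} ∪ (((T.map fun q ↦ q.2).toFinset ∪ (T.map fun q ↦ -q.2).toFinset) ∪
      (((T.map fun q ↦ 3⁻¹ * q.2).toFinset ∪ (T.map fun q ↦ -(3⁻¹ * q.2)).toFinset) ∪
        ((T.map fun q ↦ 9⁻¹ * q.2).toFinset ∪ (T.map fun q ↦ -(9⁻¹ * q.2)).toFinset)))
  have hB : B.card ≤ 13 := by
    have c1 : ∀ g : ZMod 36 × ZMod p → ZMod p, ((T.map g).toFinset).card ≤ 2 := fun g ↦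
      (Multiset.toFinset_card_le _).trans (by rw [Multiset.card_map, hT])
    have u2 : ∀ (X Y : Finset (ZMod p)) (m n : ℕ), X.card ≤ m → Y.card ≤ n → (X ∪ Y).card ≤ m + n :=
      fun X Y m n hX hY ↦ (Finset.card_union_le _ _).trans (add_le_add hX hY)
    exact u2 _ _ 1 12 (by simp) (u2 _ _ 4 8 (u2 _ _ 2 2 (c1 _) (c1 _)) (u2 _ _ 4 4 (u2 _ _ 2 2 (c1 _) (c1 _))
      (u2 _ _ 2 2 (c1 _) (c1 _))))
  by_contra hcon
  push Not at hcon
  have hsub : (Finset.univ : Finset (ZMod p)) ⊆ B := by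
    intro b _
    by_cases hb0 : b = 0
    · simp [B, hb0]
    have hb := hcon b hb0
    simp only [B, Finset.mem_union, Finset.mem_singleton, Multiset.mem_toFinset, Multiset.mem_map]
    by_cases h1 : ∀ q ∈ T, q.2 ≠ b ∧ q.2 ≠ -b
    · by_cases h2 : ∀ q ∈ T, q.2 ≠ 3 * b ∧ q.2 ≠ -(3 * b)
      · obtain ⟨q, hq, hq'⟩ := hb h1 h2
        by_cases e1 : q.2 = 9 * b
        · right; right; right; left; exact ⟨q, hq, by rw [e1, inv_mul_cancel_left₀ h9]⟩
        · have e2 : q.2 = -(9 * b) := hq' e1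
          right; right; right; right; exact ⟨q, hq, by rw [e2, mul_neg, inv_mul_cancel_left₀ h9, neg_neg]⟩
      · push Not at h2
        obtain ⟨q, hq, hq'⟩ := h2
        by_cases e1 : q.2 = 3 * b
        · right; right; left; left; exact ⟨q, hq, by rw [e1, inv_mul_cancel_left₀ h3]⟩
        · have e2 : q.2 = -(3 * b) := hq' e1
          right; right; left; right; exact ⟨q, hq, by rw [e2, mul_neg, inv_mul_cancel_left₀ h3, neg_neg]⟩
    · push Not at h1
      obtain ⟨q, hq, hq'⟩ := h1
      by_cases e1 : q.2 = b
      · right; left; left; exact ⟨q, hq, e1⟩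
      · right; left; right; exact ⟨q, hq, by rw [hq' e1, neg_neg]⟩
  have := Finset.card_le_card hsub
  rw [Finset.card_univ, ZMod.card] at this
  omega

/-- **`Γ₋₄ ≡ 0` on a `2`-element coordinate multiset with the relations** (`p ≥ 17`). [folklore] -/
private theorem g4_zero (hp : p.Prime) (h17 : 17 ≤ p) {T : Multiset (ZMod 36 × ZMod p)} (hT : card T = 2) (hR : Rels T)
    {b : ZMod p} (hb : b ≠ 0) : cG4 T b = 0 := by
  obtain ⟨b₀, hb₀, h1, h3, h9⟩ := exists_free2 hp h17 T hT
  have hg : cG4 T b₀ = 0 := by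
    simp only [cG4, cU4, cT4, cN4, oc_eq_zero_of_free h1, oc_eq_zero_of_free h3, oc_eq_zero_of_free h9]; ring
  rw [hR.g4 b b₀ hb hb₀, hg]

/-! ### Two odd members: the shift `x ↦ x + 18p` -/

/-- **Periodicity for a two-element odd configuration.** If `O = {x, y}` (both odd) satisfies the relations, `x = (e, c)` with
`c ≠ 0` and `y ≠ −x`, then `y = (e + 18, c)` (`= x + 18p` in `ℤ/36p`). With `c = 27δ` the instances used are `Z_A`, `Z_B` at `c`,
`Z₁₂` and `Γ₋₄` at `9δ = c/3`, `Γ₋₄` at `3δ = c/9` (same / opposite fibre: tables `tab_same`, `tab_neg`) and, for `y` over a third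
fibre, `Γ₋₄` at `3δ` and at `δ = c/27` (`tab_gen`). [folklore] -/
private theorem two_odd_core (hp : p.Prime) (h17 : 17 ≤ p) {O : Multiset (ZMod 36 × ZMod p)} (hO : Rels O)
    {e e' : ZMod 36} {c c' : ZMod p} (hOe : O = {(e, c), (e', c')}) (he : e.val % 2 = 1) (he' : e'.val % 2 = 1) (hc : c ≠ 0)
    (hyx : ((e', c') : ZMod 36 × ZMod p) ≠ -(e, c)) : e' = e + 18 ∧ c' = c := by
  haveI := Fact.mk hp
  have h5 : 5 ≤ p := by omega
  have hcard : card O = 2 := by rw [hOe]; rfl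
  have hG : ∀ b : ZMod p, b ≠ 0 → cG4 O b = 0 := fun b hb ↦ g4_zero hp h17 hcard hO hb
  -- `δ` with `27δ = c`
  have h27 : (27 : ZMod p) ≠ 0 := fun h ↦
    smooth_mul_ne_zero hp h17 0 3 0 0 0 (δ := (1 : ZMod p)) one_ne_zero (by linear_combination h)
  obtain ⟨δ, rfl⟩ : ∃ δ, c = 27 * δ := ⟨27⁻¹ * c, by rw [← mul_assoc, mul_inv_cancel₀ h27, one_mul]⟩
  have hδ : δ ≠ 0 := fun h0 ↦ hc (by rw [h0, mul_zero])
  have N : ∀ a b c d e : ℕ, (2 : ZMod p) ^ a * 3 ^ b * 5 ^ c * 7 ^ d * 13 ^ e * δ ≠ 0 := fun a b c d e ↦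
    smooth_mul_ne_zero hp h17 a b c d e hδ
  have hδ3 : (3 : ZMod p) * δ ≠ 0 := fun h ↦ N 0 1 0 0 0 (by linear_combination h)
  have hδ9 : (9 : ZMod p) * δ ≠ 0 := fun h ↦ N 0 2 0 0 0 (by linear_combination h)
  -- arithmetic of the fibres `λδ`
  have r39 : (3 : ZMod p) * (9 * δ) = 27 * δ := by ring
  have r99 : (9 : ZMod p) * (9 * δ) = 81 * δ := by ring
  have r33 : (3 : ZMod p) * (3 * δ) = 9 * δ := by ring
  have r93 : (9 : ZMod p) * (3 * δ) = 27 * δ := by ring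
  -- non-coincidences `λδ ≠ ±27δ`
  have n1 : (9 : ZMod p) * δ ≠ 27 * δ := fun h ↦ N 1 2 0 0 0 (by linear_combination -h)
  have n2 : -((9 : ZMod p) * δ) ≠ 27 * δ := fun h ↦ N 2 2 0 0 0 (by linear_combination -h)
  have n3 : (81 : ZMod p) * δ ≠ 27 * δ := fun h ↦ N 1 3 0 0 0 (by linear_combination h)
  have n4 : -((81 : ZMod p) * δ) ≠ 27 * δ := fun h ↦ N 2 3 0 0 0 (by linear_combination -h)
  have n5 : (3 : ZMod p) * δ ≠ 27 * δ := fun h ↦ N 3 1 0 0 0 (by linear_combination -h)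
  have n6 : -((3 : ZMod p) * δ) ≠ 27 * δ := fun h ↦ N 1 1 1 0 0 (by linear_combination -h)
  have n7 : -((27 : ZMod p) * δ) ≠ 27 * δ := fun h ↦ N 1 3 0 0 0 (by linear_combination -h)
  -- expansions on `O = {(e, 27δ), (e', c')}`
  have EA : ∀ b, cZA O b = tZA e * ((if b = 27 * δ then 1 else 0) - (if -b = 27 * δ then 1 else 0)) +
      tZA e' * ((if b = c' then 1 else 0) - (if -b = c' then 1 else 0)) := fun b ↦ by
    rw [hOe, Multiset.insert_eq_cons, cZA_cons, cZA_singleton]; ring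
  have EB : ∀ b, cZB O b = tZB e * ((if b = 27 * δ then 1 else 0) - (if -b = 27 * δ then 1 else 0)) +
      tZB e' * ((if b = c' then 1 else 0) - (if -b = c' then 1 else 0)) := fun b ↦ by
    rw [hOe, Multiset.insert_eq_cons, cZB_cons, cZB_singleton]; ring
  have E12 : ∀ b, cZ12 O b = tU12 e * ((if b = 27 * δ then 1 else 0) - (if -b = 27 * δ then 1 else 0)) +
      tT12 e * ((if 3 * b = 27 * δ then 1 else 0) - (if -(3 * b) = 27 * δ then 1 else 0)) +
      (tU12 e' * ((if b = c' then 1 else 0) - (if -b = c' then 1 else 0)) +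
      tT12 e' * ((if 3 * b = c' then 1 else 0) - (if -(3 * b) = c' then 1 else 0))) := fun b ↦ by
    rw [hOe, Multiset.insert_eq_cons, cZ12_cons, cZ12_singleton]; ring
  have EG : ∀ b, cG4 O b = tU4 e * ((if b = 27 * δ then 1 else 0) + (if -b = 27 * δ then 1 else 0)) +
      (tU4 e + tT4 e) * ((if 3 * b = 27 * δ then 1 else 0) + (if -(3 * b) = 27 * δ then 1 else 0)) +
      (tT4 e + tN4 e) * ((if 9 * b = 27 * δ then 1 else 0) + (if -(9 * b) = 27 * δ then 1 else 0)) +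
      (tU4 e' * ((if b = c' then 1 else 0) + (if -b = c' then 1 else 0)) +
      (tU4 e' + tT4 e') * ((if 3 * b = c' then 1 else 0) + (if -(3 * b) = c' then 1 else 0)) +
      (tT4 e' + tN4 e') * ((if 9 * b = c' then 1 else 0) + (if -(9 * b) = c' then 1 else 0))) := fun b ↦ by
    rw [hOe, Multiset.insert_eq_cons, cG4_cons, cG4_singleton]; ring
  -- the instances
  have hA := hO.za (27 * δ) hc
  have hB := hO.zb (27 * δ) hc
  have h12 := hO.z12 (9 * δ) hδ9
  have hG9 := hG (9 * δ) hδ9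
  have hG3 := hG (3 * δ) hδ3
  rw [EA] at hA
  rw [EB] at hB
  rw [E12] at h12
  rw [EG] at hG9 hG3
  simp only [r39, r99, r33, r93] at h12 hG9 hG3
  by_cases h1 : c' = 27 * δ
  · subst c'
    simp only [if_true, if_false, n1, n2, n3, n4, n5, n6, n7] at hA hB h12 hG9 hG3
    exact ⟨tab_same he he' (by linarith) (by linarith) (by linarith) (by linarith) (by linarith), rfl⟩
  by_cases h2 : c' = -(27 * δ)
  · subst c'
    exfalso
    have m0 : (27 : ZMod p) * δ ≠ -(27 * δ) := fun h ↦ n7 h.symm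
    have m1 : (9 : ZMod p) * δ ≠ -(27 * δ) := fun h ↦ n2 (by linear_combination -h)
    have m1' : (-((9 : ZMod p) * δ) = -(27 * δ)) = False := propext ⟨fun h ↦ n1 (neg_inj.mp h), False.elim⟩
    have m3 : (81 : ZMod p) * δ ≠ -(27 * δ) := fun h ↦ n4 (by linear_combination -h)
    have m3' : (-((81 : ZMod p) * δ) = -(27 * δ)) = False := propext ⟨fun h ↦ n3 (neg_inj.mp h), False.elim⟩
    have m5 : (3 : ZMod p) * δ ≠ -(27 * δ) := fun h ↦ n6 (by linear_combination -h)
    have m5' : (-((3 : ZMod p) * δ) = -(27 * δ)) = False := propext ⟨fun h ↦ n5 (neg_inj.mp h), False.elim⟩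
    have m7' : (-((27 : ZMod p) * δ) = -(27 * δ)) = True := propext ⟨fun _ ↦ trivial, fun _ ↦ rfl⟩
    simp only [if_true, if_false, n1, n2, n3, n4, n5, n6, n7, m0, m1, m1', m3, m3', m5, m5', m7'] at hA hB h12 hG9 hG3
    have key := tab_neg he he' (by linarith) (by linarith) (by linarith) (by linarith) (by linarith)
    exact hyx (by rw [key, Prod.neg_mk])
  · exfalso
    have h1' : (27 : ZMod p) * δ ≠ c' := fun h ↦ h1 h.symm
    have h2' : -((27 : ZMod p) * δ) ≠ c' := fun h ↦ h2 h.symm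
    simp only [if_true, if_false, h1', h2', n1, n2, n3, n4, n5, n6, n7, mul_zero, add_zero, sub_zero, mul_one,
      zero_add] at hA hB hG3
    -- `Γ₋₄(3δ)`: `x` contributes its `9`-fibre weight, `y` two brackets of size `≤ 1`
    obtain ⟨hB₂, hy⟩ := tab_gen he he' hA hB (bracket01 hp h5 hδ3) (bracket01 hp h5 hδ9) (by linarith)
    -- so `y` lies over `±9δ`; then `Γ₋₄(δ)` sees `y` alone
    have hc' : c' = 9 * δ ∨ c' = -(9 * δ) := by
      by_contra hne
      push Not at hne
      have : ((if (9 : ZMod p) * δ = c' then (1 : ℤ) else 0) + (if -((9 : ZMod p) * δ) = c' then 1 else 0)) = 0 := by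
        rw [if_neg (fun h ↦ hne.1 h.symm), if_neg (fun h ↦ hne.2 h.symm)]; rfl
      omega
    have hG1 := hG δ hδ
    rw [EG] at hG1
    have q1 : (δ : ZMod p) ≠ 27 * δ := fun h ↦ N 1 0 0 0 1 (by linear_combination -h)
    have q2 : -(δ : ZMod p) ≠ 27 * δ := fun h ↦ N 2 0 0 1 0 (by linear_combination -h)
    rcases hc' with rfl | rfl
    · have s1 : (δ : ZMod p) ≠ 9 * δ := fun h ↦ N 3 0 0 0 0 (by linear_combination -h)
      have s2 : -(δ : ZMod p) ≠ 9 * δ := fun h ↦ N 1 0 1 0 0 (by linear_combination -h)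
      have s3 : (3 : ZMod p) * δ ≠ 9 * δ := fun h ↦ N 1 1 0 0 0 (by linear_combination -h)
      have s4 : -((3 : ZMod p) * δ) ≠ 9 * δ := fun h ↦ N 2 1 0 0 0 (by linear_combination -h)
      have s6 : -((9 : ZMod p) * δ) ≠ 9 * δ := fun h ↦ N 1 2 0 0 0 (by linear_combination -h)
      simp only [if_true, if_false, q1, q2, n5, n6, n1, n2, s1, s2, s3, s4, s6] at hG1
      apply hy; linarith
    · have s1 : (δ : ZMod p) ≠ -(9 * δ) := fun h ↦ N 1 0 1 0 0 (by linear_combination h)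
      have s2 : -(δ : ZMod p) ≠ -(9 * δ) := fun h ↦ N 3 0 0 0 0 (by linear_combination h)
      have s3 : (3 : ZMod p) * δ ≠ -(9 * δ) := fun h ↦ N 2 1 0 0 0 (by linear_combination h)
      have s4 : -((3 : ZMod p) * δ) ≠ -(9 * δ) := fun h ↦ N 1 1 0 0 0 (by linear_combination h)
      have s5 : (9 : ZMod p) * δ ≠ -(9 * δ) := fun h ↦ N 1 2 0 0 0 (by linear_combination h)
      simp only [if_true, if_false, q1, q2, n5, n6, n1, n2, s1, s2, s3, s4, s5] at hG1
      apply hy; linarith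

/-- The relations of a 'half-pair' configuration `{x, 18p − x, y, 18p − y}` (all odd) are twice those of `{x, y}`. [folklore] -/
private theorem rels_halfpair {e f : ZMod 36} {c c' : ZMod p} (he : e.val % 2 = 1) (hf : f.val % 2 = 1)
    (hH : Rels ({(e, c), (18 - e, -c), (f, c'), (18 - f, -c')} : Multiset (ZMod 36 × ZMod p))) :
    Rels ({(e, c), (f, c')} : Multiset (ZMod 36 × ZMod p)) := by
  obtain ⟨rA, rB, ru12, rt12, ru4, rt4, rn4⟩ := tab_reflect he
  obtain ⟨rA', rB', ru12', rt12', ru4', rt4', rn4'⟩ := tab_reflect hf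
  have kA : ∀ b, cZA ({(e, c), (18 - e, -c), (f, c'), (18 - f, -c')} : Multiset (ZMod 36 × ZMod p)) b =
      2 * cZA ({(e, c), (f, c')} : Multiset (ZMod 36 × ZMod p)) b := fun b ↦ by
    simp only [Multiset.insert_eq_cons, cZA_cons, cZA_singleton, rA, rA', brkE]; ring
  have kB : ∀ b, cZB ({(e, c), (18 - e, -c), (f, c'), (18 - f, -c')} : Multiset (ZMod 36 × ZMod p)) b =
      2 * cZB ({(e, c), (f, c')} : Multiset (ZMod 36 × ZMod p)) b := fun b ↦ by
    simp only [Multiset.insert_eq_cons, cZB_cons, cZB_singleton, rB, rB', brkE]; ring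
  have k12 : ∀ b, cZ12 ({(e, c), (18 - e, -c), (f, c'), (18 - f, -c')} : Multiset (ZMod 36 × ZMod p)) b =
      2 * cZ12 ({(e, c), (f, c')} : Multiset (ZMod 36 × ZMod p)) b := fun b ↦ by
    simp only [Multiset.insert_eq_cons, cZ12_cons, cZ12_singleton, ru12, ru12', rt12, rt12', brkE]; ring
  have kG : ∀ b, cG4 ({(e, c), (18 - e, -c), (f, c'), (18 - f, -c')} : Multiset (ZMod 36 × ZMod p)) b =
      2 * cG4 ({(e, c), (f, c')} : Multiset (ZMod 36 × ZMod p)) b := fun b ↦ by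
    simp only [Multiset.insert_eq_cons, cG4_cons, cG4_singleton, ru4, ru4', rt4, rt4', rn4, rn4', brkO]; ring
  refine ⟨fun b hb ↦ ?_, fun b hb ↦ ?_, fun b hb ↦ ?_, fun b b' hb hb' ↦ ?_⟩
  · have := hH.za b hb
    rw [kA] at this
    linarith
  · have := hH.zb b hb
    rw [kB] at this
    linarith
  · have := hH.z12 b hb
    rw [k12] at this
    linarith
  · have := hH.g4 b b' hb hb'
    rw [kG, kG] at this
    linarith

/-- **No half-pair configuration.** `{x, 18p − x, y, 18p − y}` with `x = (e, c)` odd off the fibre `0`, `y` odd, `y ≠ −x`,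
`18p − y ≠ −x`, violates the relations. [folklore] -/
private theorem halfpair_odd (hp : p.Prime) (h17 : 17 ≤ p) {e f : ZMod 36} {c c' : ZMod p} (he : e.val % 2 = 1)
    (hf : f.val % 2 = 1) (hc : c ≠ 0)
    (hH : Rels ({(e, c), (18 - e, -c), (f, c'), (18 - f, -c')} : Multiset (ZMod 36 × ZMod p)))
    (hz1 : ((f, c') : ZMod 36 × ZMod p) ≠ -(e, c)) (hz2 : ((18 - f, -c') : ZMod 36 × ZMod p) ≠ -(e, c)) : False := by
  obtain ⟨hfe, hcc⟩ := two_odd_core hp h17 (rels_halfpair he hf hH) rfl he hf hc hz1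
  apply hz2
  rw [hfe, hcc, Prod.neg_mk, Prod.mk.injEq]
  exact ⟨by ring, rfl⟩

/-! ### Level `36p`: arithmetic, the transfer to level `18p`, pair removal, the doubling map -/

/-- `18p` as a residue modulo `36p` (Shioda's `m′ = m/2`). -/
local notation "K36" => (((18 * p : ℕ)) : ZMod (36 * p))

/-- `18p + 18p = 0` in `ℤ/36p`. [folklore] -/
private theorem K_add_K : K36 + K36 = 0 := by
  have h : K36 + K36 = (((36 * p : ℕ)) : ZMod (36 * p)) := by push_cast; ring
  rw [h, ZMod.natCast_self]

/-- `2 · 18p = 0`. [folklore] -/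
private theorem two_mul_K : (2 : ZMod (36 * p)) * K36 = 0 := by rw [two_mul, K_add_K]

/-- `−18p = 18p`. [folklore] -/
private theorem neg_K : -K36 = K36 := by linear_combination -(K_add_K (p := p))

/-- `⟨18p⟩ = 18p`. [folklore] -/
private theorem val_K (hp : 0 < p) : (K36).val = 18 * p := by
  rw [ZMod.val_natCast, Nat.mod_eq_of_lt (by omega)]

/-- `18p ≠ 0`. [folklore] -/
private theorem K_ne_zero (hp : 0 < p) : K36 ≠ 0 := fun h ↦ by
  have := val_K hp; rw [h, ZMod.val_zero] at this; omega

/-- `⟨x + 18p⟩`: add `18p` and reduce. [folklore] -/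
private theorem val_add_K [NeZero (36 * p)] (hp : 0 < p) (x : ZMod (36 * p)) :
    ((x + K36).val = x.val + 18 * p ∧ x.val < 18 * p) ∨ ((x + K36).val + 36 * p = x.val + 18 * p ∧ 18 * p ≤ x.val) := by
  have hq := val_K hp
  have hx := ZMod.val_lt x
  by_cases h : x.val < 18 * p
  · left
    refine ⟨?_, h⟩
    rw [ZMod.val_add_of_lt (by rw [hq]; omega), hq]
  · right
    refine ⟨?_, by omega⟩
    have := ZMod.val_add_val_of_le (a := x) (b := K36) (by rw [hq]; omega)
    rw [hq] at this
    omega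

/-- `⟨2x⟩`: double and reduce. [folklore] -/
private theorem val_two_mul [NeZero (36 * p)] (hp : 0 < p) (x : ZMod (36 * p)) :
    (((2 : ZMod (36 * p)) * x).val = 2 * x.val ∧ x.val < 18 * p) ∨
      (((2 : ZMod (36 * p)) * x).val + 36 * p = 2 * x.val ∧ 18 * p ≤ x.val) := by
  have h2 : ((2 : ZMod (36 * p))).val = 2 := by
    rw [show (2 : ZMod (36 * p)) = ((2 : ℕ) : ZMod (36 * p)) by norm_cast, ZMod.val_natCast, Nat.mod_eq_of_lt (by omega)]
  have hx := ZMod.val_lt x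
  rw [ZMod.val_mul, h2]
  by_cases h : x.val < 18 * p
  · left
    exact ⟨Nat.mod_eq_of_lt (by omega), h⟩
  · right
    refine ⟨?_, by omega⟩
    rw [Nat.mod_eq_sub_mod (by omega), Nat.mod_eq_of_lt (by omega)]
    omega

/-- `18p · x = 18p` for odd `x`, `= 0` for even `x`. [folklore] -/
private theorem K_mul [NeZero (36 * p)] (x : ZMod (36 * p)) : K36 * x = if x.val % 2 = 1 then K36 else 0 := by
  have e : x = ((x.val : ℕ) : ZMod (36 * p)) := (ZMod.natCast_zmod_val x).symm
  have hd := Nat.div_add_mod x.val 2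
  have h2 := two_mul_K (p := p)
  push_cast at h2
  split_ifs with h
  · rw [h] at hd
    conv_lhs => rw [e, ← hd]
    push_cast
    linear_combination (↑(x.val / 2) : ZMod (36 * p)) * h2
  · have h0 : x.val % 2 = 0 := by omega
    rw [h0, add_zero] at hd
    conv_lhs => rw [e, ← hd]
    push_cast
    linear_combination (↑(x.val / 2) : ZMod (36 * p)) * h2

/-- A unit of `ℤ/36p` is odd. [folklore] -/
private theorem odd_of_isUnit {u : ZMod (36 * p)} (hu : IsUnit u) : u.val % 2 = 1 := by
  obtain ⟨u, rfl⟩ := hu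
  have hc := ZMod.val_coe_unit_coprime u
  by_contra h
  have h2 : 2 ∣ (u : ZMod (36 * p)).val := Nat.dvd_of_mod_eq_zero (by omega)
  have : 2 ∣ Nat.gcd (u : ZMod (36 * p)).val (36 * p) := Nat.dvd_gcd h2 ⟨18 * p, by omega⟩
  rw [hc] at this
  omega

/-- `1 + 18p` is a unit (an involution). [folklore] -/
private theorem isUnit_one_add_K : IsUnit (1 + K36 : ZMod (36 * p)) := by
  have hq2 : (K36 : ZMod (36 * p)) * K36 = 0 := by
    have : (K36 : ZMod (36 * p)) * K36 = ((9 * p : ℕ) : ZMod (36 * p)) * (((36 * p : ℕ)) : ZMod (36 * p)) := by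
      push_cast; ring
    rw [this, ZMod.natCast_self, mul_zero]
  have h1 : (1 + K36 : ZMod (36 * p)) * (1 + K36) = 1 := by linear_combination hq2 + two_mul_K (p := p)
  exact ⟨⟨1 + K36, 1 + K36, h1, h1⟩, rfl⟩

/-- Half the representative: `⟨w⟩/2` as a residue (used for even `w`). [folklore] -/
private def half (w : ZMod (36 * p)) : ZMod (36 * p) := ((w.val / 2 : ℕ) : ZMod (36 * p))

/-- `2 · (⟨w⟩/2) = w` for even `w`. [folklore] -/
private theorem two_mul_half [NeZero (36 * p)] {w : ZMod (36 * p)} (hw : w.val % 2 = 0) : (2 : ZMod (36 * p)) * half w = w := by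
  have h := Nat.div_add_mod w.val 2
  rw [hw, add_zero] at h
  have e : (((2 * (w.val / 2) : ℕ)) : ZMod (36 * p)) = w := by rw [h, ZMod.natCast_zmod_val]
  calc (2 : ZMod (36 * p)) * half w = (((2 * (w.val / 2) : ℕ)) : ZMod (36 * p)) := by unfold half; push_cast; ring
    _ = w := e

/-- `⟨w⟩/2 + ⟨w⟩/2 = w` for even `w`. [folklore] -/
private theorem half_add_half [NeZero (36 * p)] {w : ZMod (36 * p)} (hw : w.val % 2 = 0) : half w + half w = w := by
  rw [← two_mul, two_mul_half hw]

/-- The norm sum of a mapped multiset as a sum of representatives. [folklore] -/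
private theorem mNormSum_map {X : Type*} (t : Multiset X) {k : ℕ} (g : X → ZMod k) :
    mNormSum (t.map g) = (t.map fun w ↦ (g w).val).sum := by
  simp only [mNormSum, Multiset.map_map, Function.comp_def]

/-- The representative of the reduction modulo `18p`. [folklore] -/
private theorem val_castHom [NeZero (36 * p)] (hnm : 18 * p ∣ 36 * p) (y : ZMod (36 * p)) :
    (ZMod.castHom hnm (ZMod (18 * p)) y).val = y.val % (18 * p) := by
  rw [ZMod.castHom_apply, ZMod.cast_eq_val, ZMod.val_natCast]

/-- **`⟨y⟩ + ⟨y + 18p⟩ = 2⟨ȳ⟩ + 18p`** (`ȳ = y mod 18p`). [folklore] -/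
private theorem val_add_val_add_K [NeZero (36 * p)] (hp : 0 < p) (hnm : 18 * p ∣ 36 * p) (y : ZMod (36 * p)) :
    y.val + (y + K36).val = 2 * (ZMod.castHom hnm (ZMod (18 * p)) y).val + 18 * p := by
  rw [val_castHom]
  rcases val_add_K hp y with ⟨h, hlt⟩ | ⟨h, hle⟩
  · rw [Nat.mod_eq_of_lt hlt]; omega
  · rw [Nat.mod_eq_sub_mod hle, Nat.mod_eq_of_lt (by have := ZMod.val_lt y; omega)]; omega

/-- **`⟨2y⟩ = 2⟨ȳ⟩`**. [folklore] -/
private theorem val_two_mul_eq [NeZero (36 * p)] (hp : 0 < p) (hnm : 18 * p ∣ 36 * p) (y : ZMod (36 * p)) :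
    ((2 : ZMod (36 * p)) * y).val = 2 * (ZMod.castHom hnm (ZMod (18 * p)) y).val := by
  rw [val_castHom]
  rcases val_two_mul hp y with ⟨h, hlt⟩ | ⟨h, hle⟩
  · rw [Nat.mod_eq_of_lt hlt]; omega
  · rw [Nat.mod_eq_sub_mod hle, Nat.mod_eq_of_lt (by have := ZMod.val_lt y; omega)]; omega

/-- The reduction of an odd residue is non-zero. [folklore] -/
private theorem castHom_ne_zero_of_odd [NeZero (36 * p)] (hnm : 18 * p ∣ 36 * p) {w : ZMod (36 * p)} (hw : w.val % 2 = 1) :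
    ZMod.castHom hnm (ZMod (18 * p)) w ≠ 0 := by
  intro h
  have hv := congrArg ZMod.val h
  rw [val_castHom, ZMod.val_zero] at hv
  obtain ⟨k, hk⟩ := Nat.dvd_of_mod_eq_zero hv
  have : 2 ∣ w.val := ⟨9 * p * k, by rw [hk]; ring⟩
  omega

/-- The reduction of half a non-zero even residue is non-zero. [folklore] -/
private theorem castHom_half_ne_zero [NeZero (36 * p)] (hnm : 18 * p ∣ 36 * p) {w : ZMod (36 * p)} (hw0 : w ≠ 0)
    (hw : w.val % 2 = 0) : ZMod.castHom hnm (ZMod (18 * p)) (half w) ≠ 0 := by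
  intro h
  have hv := congrArg ZMod.val h
  rw [val_castHom, ZMod.val_zero, half, ZMod.val_natCast, Nat.mod_mod_of_dvd _ ⟨2, by ring⟩] at hv
  have hlt := ZMod.val_lt w
  have hdvd : 18 * p ∣ w.val / 2 := Nat.dvd_of_mod_eq_zero hv
  have h0' : w.val / 2 = 0 := Nat.eq_zero_of_dvd_of_lt hdvd (by omega)
  have h0 : w.val = 0 := by omega
  exact hw0 ((ZMod.val_eq_zero w).mp h0)

/-- The image of a unit under `unitsMap` is its reduction. [folklore] -/
private theorem coe_unitsMap (hnm : 18 * p ∣ 36 * p) (u : (ZMod (36 * p))ˣ) :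
    ((ZMod.unitsMap hnm u : (ZMod (18 * p))ˣ) : ZMod (18 * p)) = ZMod.castHom hnm (ZMod (18 * p)) (u : ZMod (36 * p)) := by
  simp [ZMod.unitsMap_def]

/-- **The transfer of a Hodge multiset of level `36p` is a Hodge multiset of level `18p`.** Split a multiset over `ℤ/36p` into
its odd part `s₁` and its even part `s₀`; then `T(s) = (s₁ mod 18p) + 2·((s₀/2) mod 18p)` (halve the even members, reduce
everything modulo `18p`, count the halved members twice) is a Hodge multiset over `ℤ/18p` whenever `s₁ + s₀` is one over `ℤ/36p`.
PROOF: for a unit `u` of `ℤ/36p` also `u(1 + 18p)` is a unit, and `u(1 + 18p)w = uw + 18p` for odd `w`, `= uw` for even `w`;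
adding the two norm equations and using `⟨y⟩ + ⟨y + 18p⟩ = 2⟨ȳ⟩ + 18p`, `⟨2y⟩ = 2⟨ȳ⟩` gives the norm equation of `T(s)` at `ū`;
every unit of `ℤ/18p` is such a `ū` (verbatim the argument of `isHodgeMultiset_transfer_twentyFourPrime`, the elementary shadow of
the distribution relation of the Bernoulli function). [cite: Aoki1983, Prop. 2.2] [cite: Shioda1979PJA, §1 eq. (2)] -/
theorem isHodgeMultiset_transfer_thirtySixPrime [NeZero (36 * p)] (hp : 0 < p) (hnm : 18 * p ∣ 36 * p)
    {so se : Multiset (ZMod (36 * p))} (hso : ∀ w ∈ so, w.val % 2 = 1) (hse : ∀ w ∈ se, w.val % 2 = 0)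
    (hs : IsHodgeMultiset (so + se)) :
    IsHodgeMultiset (so.map (ZMod.castHom hnm (ZMod (18 * p))) +
      (se.map fun w ↦ ZMod.castHom hnm (ZMod (18 * p)) (half w)) + se.map fun w ↦ ZMod.castHom hnm (ZMod (18 * p)) (half w)) := by
  classical
  set R := ZMod.castHom hnm (ZMod (18 * p)) with hR
  obtain ⟨⟨hne, hsum⟩, hnorm⟩ := hs
  refine ⟨⟨?_, ?_⟩, fun v ↦ ?_⟩
  · intro a ha
    rcases Multiset.mem_add.mp ha with ha | ha
    · rcases Multiset.mem_add.mp ha with ha | ha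
      · obtain ⟨w, hw, rfl⟩ := Multiset.mem_map.mp ha
        exact castHom_ne_zero_of_odd hnm (hso w hw)
      · obtain ⟨w, hw, rfl⟩ := Multiset.mem_map.mp ha
        exact castHom_half_ne_zero hnm (hne w (Multiset.mem_add.mpr (Or.inr hw))) (hse w hw)
    · obtain ⟨w, hw, rfl⟩ := Multiset.mem_map.mp ha
      exact castHom_half_ne_zero hnm (hne w (Multiset.mem_add.mpr (Or.inr hw))) (hse w hw)
  · have h1 : (so.map R).sum = R so.sum := (map_multiset_sum R so).symm
    have h2 : (se.map fun w ↦ R (half w)).sum + (se.map fun w ↦ R (half w)).sum = R se.sum := by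
      rw [← Multiset.sum_map_add, map_multiset_sum]
      congr 1
      refine Multiset.map_congr rfl fun w hw ↦ ?_
      rw [← RingHom.map_add, half_add_half (hse w hw)]
    rw [Multiset.sum_add, Multiset.sum_add, add_assoc, h1, h2, ← RingHom.map_add, ← Multiset.sum_add, hsum, RingHom.map_zero]
  · obtain ⟨u, hu⟩ := ZMod.unitsMap_surjective hnm v
    have hvu : (v : ZMod (18 * p)) = R u := by rw [← hu, coe_unitsMap]
    obtain ⟨w1, hw1⟩ := isUnit_one_add_K (p := p)
    have odd_u : (u : ZMod (36 * p)).val % 2 = 1 := odd_of_isUnit u.isUnit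
    have hqu : K36 * (u : ZMod (36 * p)) = K36 := by rw [K_mul, if_pos odd_u]
    have h1 := hnorm u
    have h2 := hnorm (u * w1)
    rw [Multiset.map_add, mNormSum_add, mNormSum_map, mNormSum_map, Multiset.card_add] at h1 h2
    have eso : (so.map fun w ↦ (((u * w1 : (ZMod (36 * p))ˣ) : ZMod (36 * p)) * w).val) =
        so.map fun w ↦ ((u : ZMod (36 * p)) * w + K36).val := by
      refine Multiset.map_congr rfl fun w hw ↦ ?_
      have hqw : K36 * w = K36 := by rw [K_mul, if_pos (hso w hw)]
      rw [Units.val_mul, hw1]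
      congr 1
      linear_combination (u : ZMod (36 * p)) * hqw + hqu
    have ese : (se.map fun w ↦ (((u * w1 : (ZMod (36 * p))ˣ) : ZMod (36 * p)) * w).val) =
        se.map fun w ↦ ((u : ZMod (36 * p)) * w).val := by
      refine Multiset.map_congr rfl fun w hw ↦ ?_
      have hqw : K36 * w = 0 := by rw [K_mul, if_neg (by rw [hse w hw]; omega)]
      rw [Units.val_mul, hw1]
      congr 1
      linear_combination (u : ZMod (36 * p)) * hqw
    rw [eso, ese] at h2
    have hO : (so.map fun w ↦ ((u : ZMod (36 * p)) * w).val).sum + (so.map fun w ↦ ((u : ZMod (36 * p)) * w + K36).val).sum =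
        2 * (so.map fun w ↦ (R ((u : ZMod (36 * p)) * w)).val).sum + 18 * p * Multiset.card so := by
      rw [← Multiset.sum_map_add]
      have : (so.map fun w ↦ ((u : ZMod (36 * p)) * w).val + ((u : ZMod (36 * p)) * w + K36).val) =
          so.map fun w ↦ 2 * (R ((u : ZMod (36 * p)) * w)).val + 18 * p :=
        Multiset.map_congr rfl fun w _ ↦ val_add_val_add_K hp hnm _
      rw [this, Multiset.sum_map_add, Multiset.sum_map_mul_left, Multiset.map_const', Multiset.sum_replicate, smul_eq_mul,
        mul_comm (Multiset.card so)]
    have hE : (se.map fun w ↦ ((u : ZMod (36 * p)) * w).val).sum =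
        2 * (se.map fun w ↦ (R ((u : ZMod (36 * p)) * half w)).val).sum := by
      rw [← Multiset.sum_map_mul_left]
      congr 1
      refine Multiset.map_congr rfl fun w hw ↦ ?_
      rw [← val_two_mul_eq hp hnm, mul_left_comm, two_mul_half (hse w hw)]
    simp only [Multiset.map_add, mNormSum_add, Multiset.map_map, mNormSum_map, Multiset.card_add, Multiset.card_map,
      Function.comp_apply]
    have tso : (so.map fun w ↦ ((v : ZMod (18 * p)) * R w).val) = so.map fun w ↦ (R ((u : ZMod (36 * p)) * w)).val := by
      refine Multiset.map_congr rfl fun w _ ↦ ?_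
      rw [hvu, ← map_mul]
    have tse : (se.map fun w ↦ ((v : ZMod (18 * p)) * R (half w)).val) =
        se.map fun w ↦ (R ((u : ZMod (36 * p)) * half w)).val := by
      refine Multiset.map_congr rfl fun w _ ↦ ?_
      rw [hvu, ← map_mul]
    rw [tso, tse]
    generalize Multiset.card so = cso at h1 h2 hO ⊢
    generalize Multiset.card se = cse at h1 h2 ⊢
    have hmn : 36 * p * (cso + cse) = 2 * (18 * p * cso) + 2 * (18 * p * cse) := by ring
    have hgoal : 18 * p * (cso + cse + cse) = 18 * p * cso + 2 * (18 * p * cse) := by ring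
    rw [hgoal]
    omega

/-- **Pair removal.** A Hodge multiset minus a pair `{a, −a}` is a Hodge multiset (the norm of a pair is the level at every
unit). [cite: Shioda1979PJA, §1 (elements of length 1)] -/
private theorem isHodgeMultiset_of_cons_cons_neg {n : ℕ} [NeZero n] {a : ZMod n} {τ : Multiset (ZMod n)}
    (h : IsHodgeMultiset (a ::ₘ (-a) ::ₘ τ)) : IsHodgeMultiset τ := by
  obtain ⟨⟨hne, hsum⟩, hnorm⟩ := h
  have ha : a ≠ 0 := hne a (Multiset.mem_cons_self _ _)
  refine ⟨⟨fun x hx ↦ hne x (Multiset.mem_cons_of_mem (Multiset.mem_cons_of_mem hx)), ?_⟩, fun t ↦ ?_⟩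
  · simpa [Multiset.sum_cons] using hsum
  · have h := hnorm t
    simp only [Multiset.map_cons, mNormSum_cons, Multiset.card_cons] at h
    have hta : ((t : ZMod n) * a) ≠ 0 := (t.isUnit.mul_right_eq_zero).not.mpr ha
    have hneg : ((t : ZMod n) * -a).val = n - ((t : ZMod n) * a).val := by
      rw [mul_neg, ZMod.neg_val, if_neg hta]
    have hlt := ZMod.val_lt ((t : ZMod n) * a)
    rw [hneg] at h
    have e : n * (Multiset.card τ + 1 + 1) = n * Multiset.card τ + 2 * n := by ring
    rw [e] at h
    omega

/-- **A Hodge pair sums to zero** (the congruence part of the definition). [folklore] -/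
private theorem eq_neg_of_isHodgeMultiset_pair {n : ℕ} {a b : ZMod n} (h : IsHodgeMultiset ({a, b} : Multiset (ZMod n))) :
    b = -a := by
  have := h.1.2
  simp only [Multiset.insert_eq_cons, Multiset.sum_cons, Multiset.sum_singleton] at this
  linear_combination this

/-- **Halving the multiplicities keeps the norm equations** (`T(s) = σ + σ`). [folklore] -/
private theorem norm_of_add_self {n : ℕ} {σ : Multiset (ZMod n)} (h : IsHodgeMultiset (σ + σ)) (t : (ZMod n)ˣ) :
    2 * mNormSum (σ.map fun a ↦ (t : ZMod n) * a) = n * Multiset.card σ := by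
  have := h.2 t
  rw [Multiset.map_add, mNormSum_add, Multiset.card_add,
    show n * (Multiset.card σ + Multiset.card σ) = 2 * (n * Multiset.card σ) by ring] at this
  omega

/-- `9p` as a residue modulo `18p` (Shioda's `m′` of the level `18p`). -/
local notation "L18" => (((9 * p : ℕ)) : ZMod (18 * p))

/-- `6p` as a residue modulo `18p` (Shioda's `m″` of the level `18p`). -/
local notation "E18" => (((6 * p : ℕ)) : ZMod (18 * p))

/-- `12p` as a residue modulo `36p` (Shioda's `m″ = m/3`). -/
local notation "D36" => (((12 * p : ℕ)) : ZMod (36 * p))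

section Double

/-- The doubling map `t ↦ 2t` from `ℤ/18p` to `ℤ/36p` (on representatives). [folklore] -/
private def dbl (t : ZMod (18 * p)) : ZMod (36 * p) := ((2 * t.val : ℕ) : ZMod (36 * p))

/-- `dbl` is additive. [folklore] -/
private theorem dbl_add [NeZero (18 * p)] (a b : ZMod (18 * p)) : dbl (a + b) = dbl a + dbl b := by
  have key : ∃ k : ℕ, 2 * a.val + 2 * b.val = 2 * (a + b).val + 36 * p * k := by
    by_cases h : a.val + b.val < 18 * p
    · exact ⟨0, by rw [ZMod.val_add_of_lt h]; ring⟩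
    · refine ⟨1, ?_⟩
      have e := ZMod.val_add_val_of_le (not_lt.mp h)
      omega
  obtain ⟨k, hk⟩ := key
  have := congrArg (Nat.cast : ℕ → ZMod (36 * p)) hk
  rw [Nat.cast_add, Nat.cast_add, Nat.cast_mul ((36 * p : ℕ)), ZMod.natCast_self, zero_mul, add_zero] at this
  unfold dbl
  rw [this]

/-- `dbl 0 = 0`. [folklore] -/
private theorem dbl_zero : dbl (0 : ZMod (18 * p)) = 0 := by
  simp [dbl]

/-- `dbl (−a) = −dbl a`. [folklore] -/
private theorem dbl_neg [NeZero (18 * p)] (a : ZMod (18 * p)) : dbl (-a) = -dbl a :=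
  eq_neg_of_add_eq_zero_left (by rw [← dbl_add, neg_add_cancel, dbl_zero])

/-- `dbl (k a) = k dbl a`. [folklore] -/
private theorem dbl_natCast_mul [NeZero (18 * p)] (k : ℕ) (a : ZMod (18 * p)) :
    dbl ((k : ZMod (18 * p)) * a) = (k : ZMod (36 * p)) * dbl a := by
  induction k with
  | zero => simp [dbl_zero]
  | succ k ih => rw [Nat.cast_succ, Nat.cast_succ, add_mul, one_mul, dbl_add, ih, add_mul, one_mul]

/-- `dbl (2a) = 2 dbl a`. [folklore] -/
private theorem dbl_two_mul [NeZero (18 * p)] (a : ZMod (18 * p)) : dbl (2 * a) = 2 * dbl a := by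
  exact_mod_cast dbl_natCast_mul 2 a

/-- `dbl (4a) = 4 dbl a`. [folklore] -/
private theorem dbl_four_mul [NeZero (18 * p)] (a : ZMod (18 * p)) : dbl (4 * a) = 4 * dbl a := by
  exact_mod_cast dbl_natCast_mul 4 a

/-- `dbl (y mod 18p) = 2y`. [folklore] -/
private theorem dbl_castHom [NeZero (36 * p)] (hnm : 18 * p ∣ 36 * p) (y : ZMod (36 * p)) :
    dbl (ZMod.castHom hnm (ZMod (18 * p)) y) = 2 * y := by
  unfold dbl
  rw [val_castHom]
  have key : ∃ k : ℕ, 2 * y.val = 2 * (y.val % (18 * p)) + 36 * p * k := by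
    have hlt := ZMod.val_lt y
    by_cases h : y.val < 18 * p
    · exact ⟨0, by rw [Nat.mod_eq_of_lt h]; ring⟩
    · refine ⟨1, ?_⟩
      rw [Nat.mod_eq_sub_mod (not_lt.mp h), Nat.mod_eq_of_lt (by omega)]
      omega
  obtain ⟨k, hk⟩ := key
  have := congrArg (Nat.cast : ℕ → ZMod (36 * p)) hk
  rw [Nat.cast_add, Nat.cast_mul ((36 * p : ℕ)), ZMod.natCast_self, zero_mul, add_zero, Nat.cast_mul, Nat.cast_ofNat,
    ZMod.natCast_zmod_val] at this
  rw [← this]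

/-- `dbl ((w/2) mod 18p) = w` for even `w`. [folklore] -/
private theorem dbl_castHom_half [NeZero (36 * p)] (hnm : 18 * p ∣ 36 * p) {w : ZMod (36 * p)} (hw : w.val % 2 = 0) :
    dbl (ZMod.castHom hnm (ZMod (18 * p)) (half w)) = w := by
  rw [dbl_castHom hnm, two_mul_half hw]

/-- `⟨9p̄⟩ = 9p` at level `18p`. [folklore] -/
private theorem val_L18 (hp : 0 < p) : (L18).val = 9 * p := by
  rw [ZMod.val_natCast, Nat.mod_eq_of_lt (by omega)]

/-- `dbl 9p̄ = 18p`. [folklore] -/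
private theorem dbl_L18 (hp : 0 < p) : dbl L18 = K36 := by
  unfold dbl
  rw [val_L18 hp, show 2 * (9 * p) = 18 * p by ring]

/-- `9p̄ ≠ 0` at level `18p`. [folklore] -/
private theorem L18_ne_zero (hp : 0 < p) : L18 ≠ 0 := fun h ↦ by
  have h1 := congrArg ZMod.val h
  rw [val_L18 hp, ZMod.val_zero] at h1
  omega

/-- `−9p̄ = 9p̄` at level `18p`. [folklore] -/
private theorem neg_L18 : -L18 = L18 := by
  have h : L18 + L18 = (((18 * p : ℕ)) : ZMod (18 * p)) := by push_cast; ring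
  rw [ZMod.natCast_self] at h
  linear_combination -h

/-- `2z = 0` iff `z ∈ {0, 9p̄}` at level `18p`. [folklore] -/
private theorem two_mul_eq_zero_eighteenP [NeZero (18 * p)] (hp : 0 < p) {z : ZMod (18 * p)} :
    (2 : ZMod (18 * p)) * z = 0 ↔ z = 0 ∨ z = L18 := by
  constructor
  · intro h
    have hv := congrArg ZMod.val h
    have h2 : ((2 : ZMod (18 * p))).val = 2 := by
      rw [show (2 : ZMod (18 * p)) = ((2 : ℕ) : ZMod (18 * p)) by norm_cast, ZMod.val_natCast, Nat.mod_eq_of_lt (by omega)]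
    rw [ZMod.val_mul, h2, ZMod.val_zero] at hv
    have hlt := ZMod.val_lt z
    obtain ⟨k, hk⟩ := Nat.dvd_of_mod_eq_zero hv
    have hk2 : k < 2 := by
      by_contra hk2
      have : 18 * p * 2 ≤ 18 * p * k := Nat.mul_le_mul_left _ (by omega)
      omega
    interval_cases k
    · left
      apply ZMod.val_injective (18 * p)
      rw [ZMod.val_zero]; omega
    · right
      apply ZMod.val_injective (18 * p)
      rw [val_L18 hp]; omega
  · rintro (rfl | rfl)
    · rw [mul_zero]
    · linear_combination -(neg_L18 (p := p))

/-- The residue of the norm sum is the sum. [folklore] -/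
private theorem natCast_mNormSum {n : ℕ} [NeZero n] (t : Multiset (ZMod n)) : ((mNormSum t : ℕ) : ZMod n) = t.sum := by
  rw [mNormSum, Nat.cast_multiset_sum, Multiset.map_map]
  have : (t.map (Nat.cast ∘ ZMod.val) : Multiset (ZMod n)) = t.map id :=
    Multiset.map_congr rfl fun a _ ↦ ZMod.natCast_zmod_val a
  rw [this, Multiset.map_id]

/-- Parity at level `18p`: the reduction keeps the parity of the representative. [folklore] -/
private theorem val_castHom_mod_two [NeZero (36 * p)] (hnm : 18 * p ∣ 36 * p) (y : ZMod (36 * p)) :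
    (ZMod.castHom hnm (ZMod (18 * p)) y).val % 2 = y.val % 2 := by
  rw [val_castHom, Nat.mod_mod_of_dvd _ (⟨9 * p, by ring⟩ : 2 ∣ 18 * p)]

/-- Parity at level `18p`: negation keeps parity. [folklore] -/
private theorem val_neg_mod_two_eighteen [NeZero (18 * p)] (a : ZMod (18 * p)) : (-a).val % 2 = a.val % 2 := by
  rw [ZMod.neg_val]
  split_ifs with h
  · rw [h, ZMod.val_zero]
  · have := ZMod.val_lt a
    omega

/-- Parity at level `18p`: a `2`-multiple is even. [folklore] -/
private theorem val_two_mul_mod_two_eighteen [NeZero (18 * p)] (a : ZMod (18 * p)) : ((2 : ZMod (18 * p)) * a).val % 2 = 0 := by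
  have h2 : ((2 : ZMod (18 * p))).val % 2 = 0 := by
    rw [show (2 : ZMod (18 * p)) = ((2 : ℕ) : ZMod (18 * p)) by norm_cast, ZMod.val_natCast]
    rcases Nat.lt_or_ge 2 (18 * p) with h | h
    · rw [Nat.mod_eq_of_lt h]
    · have : 18 * p = 0 ∨ 18 * p = 1 ∨ 18 * p = 2 := by omega
      rcases this with h0 | h0 | h0
      · exact absurd h0 (NeZero.ne _)
      · omega
      · rw [h0]
  rw [ZMod.val_mul, Nat.mod_mod_of_dvd _ ⟨9 * p, by ring⟩, Nat.mul_mod, h2, zero_mul, Nat.zero_mod]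

/-- `dbl (3a) = 3 dbl a`. [folklore] -/
private theorem dbl_three_mul [NeZero (18 * p)] (a : ZMod (18 * p)) : dbl (3 * a) = 3 * dbl a := by
  exact_mod_cast dbl_natCast_mul 3 a

/-- `⟨6p̄⟩ = 6p` at level `18p`. [folklore] -/
private theorem val_E18 (hp : 0 < p) : (E18).val = 6 * p := by
  rw [ZMod.val_natCast, Nat.mod_eq_of_lt (by omega)]

/-- `dbl 6p̄ = 12p`. [folklore] -/
private theorem dbl_E18 (hp : 0 < p) : dbl E18 = D36 := by
  unfold dbl
  rw [val_E18 hp, show 2 * (6 * p) = 12 * p by ring]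

/-- `dbl (t p)` for a representative `t < 18`. [folklore] -/
private theorem dbl_natCast_mul_P (hp : 0 < p) {t : ℕ} (ht : t < 18) :
    dbl (((t * p : ℕ)) : ZMod (18 * p)) = 2 * ((t * p : ℕ) : ZMod (36 * p)) := by
  unfold dbl
  rw [ZMod.val_natCast, Nat.mod_eq_of_lt (by nlinarith)]
  push_cast; ring


end Double

/-! ### Indices: pair-freeness of explicit quadruples -/

/-- Two distinct positions of a tuple give a member of the value multiset and a member of its erasure. [folklore] -/
private theorem apply_mem_erase_of_ne {K : ℕ} {X : Type*} [DecidableEq X] (Z : Fin K → X) {i j : Fin K} (hij : i ≠ j) :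
    Z j ∈ (univ.val.map Z).erase (Z i) := by
  by_cases h : Z j = Z i
  · rw [h, ← Multiset.count_pos, Multiset.count_erase_self]
    have h2 : 2 ≤ count (Z i) (univ.val.map Z) := by
      rw [Multiset.count_map]
      have hsub : ({i, j} : Finset (Fin K)).val ≤ univ.val.filter fun k ↦ Z i = Z k := by
        rw [Multiset.le_iff_subset (Finset.nodup _)]
        intro k hk
        rw [Finset.mem_val, Finset.mem_insert, Finset.mem_singleton] at hk
        rw [Multiset.mem_filter]
        rcases hk with rfl | rfl
        · exact ⟨Finset.mem_univ_val _, rfl⟩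
        · exact ⟨Finset.mem_univ_val _, h.symm⟩
      calc 2 = Multiset.card ({i, j} : Finset (Fin K)).val := by rw [Finset.card_val, Finset.card_pair hij]
        _ ≤ _ := Multiset.card_le_card hsub
    omega
  · exact (Multiset.mem_erase_of_ne h).mpr (Multiset.mem_map.mpr ⟨j, Finset.mem_univ_val j, rfl⟩)

/-- Indecomposability of a tuple in terms of its multiset of values. [folklore] -/
private theorem pairfree_of_fun {n : ℕ} {α : Fin 4 → ZMod n} (hind : ∀ i j : Fin 4, i ≠ j → α i + α j ≠ 0) :
    ∀ a ∈ univ.val.map α, ∀ b ∈ (univ.val.map α).erase a, a + b ≠ 0 := by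
  classical
  intro a ha b hb hab
  obtain ⟨i, -, rfl⟩ := Multiset.mem_map.mp ha
  by_cases hba : b = α i
  · have h2 : 2 ≤ count (α i) (univ.val.map α) := by
      have := Multiset.count_pos.mpr (hba ▸ hb)
      rw [Multiset.count_erase_self] at this
      omega
    rw [count_univ_val_map] at h2
    obtain ⟨j, hj, k, hk, hjk⟩ := Finset.one_lt_card.mp h2
    simp only [Finset.mem_filter, Finset.mem_univ, true_and] at hj hk
    exact hind j k hjk (by rw [hj, hk, ← hba]; nth_rw 1 [hba]; exact hab)
  · have hb' : b ∈ univ.val.map α := Multiset.mem_of_mem_erase hb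
    obtain ⟨j, -, rfl⟩ := Multiset.mem_map.mp hb'
    exact hind i j (fun e ↦ hba (by rw [e])) hab

/-- The value multiset of `![a, b, c, d]`. [folklore] -/
private theorem univ_val_map_four {X : Type*} (a b c d : X) : univ.val.map ![a, b, c, d] = {a, b, c, d} := by
  simp; rfl

/-- **Parity count.** A multiset over `ℤ/36p` with sum `0` has an even number of odd entries. [folklore] -/
private theorem even_card_filter_odd [NeZero (36 * p)] {s : Multiset (ZMod (36 * p))} (hs : s.sum = 0) :
    Even (Multiset.card (s.filter fun a ↦ a.val % 2 = 1)) := by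
  have hsum : 36 * p ∣ (s.map ZMod.val).sum := by
    rw [← ZMod.natCast_eq_zero_iff, Nat.cast_multiset_sum, Multiset.map_map]
    have : (s.map (Nat.cast ∘ ZMod.val) : Multiset (ZMod (36 * p))) = s.map id :=
      Multiset.map_congr rfl fun a _ ↦ ZMod.natCast_zmod_val a
    rw [this, Multiset.map_id, hs]
  have h2 : 2 ∣ (s.map ZMod.val).sum := Nat.dvd_trans ⟨18 * p, by ring⟩ hsum
  have key : ∀ t : Multiset (ZMod (36 * p)),
      (t.map ZMod.val).sum % 2 = Multiset.card (t.filter fun a ↦ a.val % 2 = 1) % 2 := by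
    intro t
    induction t using Multiset.induction_on with
    | empty => simp
    | cons a t ih =>
      rw [Multiset.map_cons, Multiset.sum_cons, Multiset.filter_cons, Multiset.card_add, Nat.add_mod, ih]
      split_ifs with ha
      · rw [Multiset.card_singleton]
        omega
      · rw [Multiset.card_zero]
        omega
  have := key s
  rw [Nat.even_iff]
  omega

/-! ### Small multiset and coordinate helpers -/

/-- `{a, b} + {c, d} = {a, b, c, d}`. [folklore] -/
private theorem pair_add_pair {X : Type*} (a b c d : X) : ({a, b} : Multiset X) + {c, d} = {a, b, c, d} := by
  simp only [Multiset.insert_eq_cons, Multiset.cons_add, Multiset.singleton_add]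

/-- A `4`-multiset whose six pairwise sums are non-zero is pair-free. [folklore] -/
private theorem pairfree_quad {n : ℕ} {a b c d : ZMod n} (hab : a + b ≠ 0) (hac : a + c ≠ 0) (had : a + d ≠ 0)
    (hbc : b + c ≠ 0) (hbd : b + d ≠ 0) (hcd : c + d ≠ 0) :
    ∀ u ∈ ({a, b, c, d} : Multiset (ZMod n)), ∀ v ∈ (({a, b, c, d} : Multiset (ZMod n))).erase u, u + v ≠ 0 := by
  rw [← univ_val_map_four]
  refine pairfree_of_fun fun i j hij h ↦ ?_
  fin_cases i <;> fin_cases j <;> simp at hij h <;>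
    first
    | exact hab (by linear_combination h)
    | exact hac (by linear_combination h)
    | exact had (by linear_combination h)
    | exact hbc (by linear_combination h)
    | exact hbd (by linear_combination h)
    | exact hcd (by linear_combination h)

/-- The kernel of the reduction `ℤ/36p → ℤ/18p` is `{0, 18p}`. [folklore] -/
private theorem castHom_eq_zero_iff [NeZero (36 * p)] (hp : 0 < p) (hnm : 18 * p ∣ 36 * p) {w : ZMod (36 * p)} :
    ZMod.castHom hnm (ZMod (18 * p)) w = 0 ↔ w = 0 ∨ w = K36 := by
  haveI : NeZero (18 * p) := ⟨by omega⟩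
  constructor
  · intro h0
    have hv := congrArg ZMod.val h0
    rw [val_castHom, ZMod.val_zero] at hv
    have hlt := ZMod.val_lt w
    obtain ⟨k, hk⟩ := Nat.dvd_of_mod_eq_zero hv
    have hk2 : k < 2 := by
      by_contra hk2
      have : 18 * p * 2 ≤ 18 * p * k := Nat.mul_le_mul_left _ (by omega)
      omega
    interval_cases k
    · left
      apply ZMod.val_injective (36 * p)
      rw [ZMod.val_zero]; omega
    · right
      apply ZMod.val_injective (36 * p)
      rw [val_K hp]; omega
  · rintro (rfl | rfl)
    · exact _root_.map_zero _
    · rw [map_natCast, show ((18 * p : ℕ) : ZMod (18 * p)) = 0 from ZMod.natCast_self _]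

/-- Two residues with the same reduction mod `18p` differ by `0` or `18p`. [folklore] -/
private theorem lift_eq [NeZero (36 * p)] (hp : 0 < p) (hnm : 18 * p ∣ 36 * p) {a b : ZMod (36 * p)}
    (h : ZMod.castHom hnm (ZMod (18 * p)) a = ZMod.castHom hnm (ZMod (18 * p)) b) : a = b ∨ a = b + K36 := by
  have : ZMod.castHom hnm (ZMod (18 * p)) (a - b) = 0 := by rw [_root_.map_sub, h, sub_self]
  rcases (castHom_eq_zero_iff hp hnm).mp this with e | e
  · left; linear_combination e
  · right; linear_combination e


/-! ### Lifts along `k ↦ ⟨k⟩·d : ℤ/n → ℤ/nd` (the tree's `liftBy`; API re-proved here, private in `HodgeQuadruplesTenPrime`) -/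

section Lift

variable {m n d : ℕ} [NeZero m] [NeZero n]

-- BEGIN DUP (verbatim from HodgeQuadruplesTenPrime.lean; private there)
/-- `⟨liftBy k⟩ = ⟨k⟩ d`. [folklore] -/
private theorem val_liftBy (hm : m = n * d) (k : ZMod n) : (liftBy m n d k).val = k.val * d := by
  rw [liftBy, ZMod.val_natCast, Nat.mod_eq_of_lt (by rw [hm]; have := ZMod.val_lt k; have := NeZero.pos m; nlinarith)]

/-- `liftBy` is injective (`d > 0`). [folklore] -/
private theorem liftBy_injective (hm : m = n * d) (hd : 0 < d) : Function.Injective (liftBy m n d) := by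
  intro a b h
  have := congrArg ZMod.val h
  rw [val_liftBy hm, val_liftBy hm] at this
  exact ZMod.val_injective n (Nat.eq_of_mul_eq_mul_right hd this)

omit [NeZero m] in
/-- `liftBy` is additive. [folklore] -/
private theorem liftBy_add (hm : m = n * d) (a b : ZMod n) : liftBy m n d (a + b) = liftBy m n d a + liftBy m n d b := by
  rw [liftBy, liftBy, liftBy, ← Nat.cast_add, ZMod.natCast_eq_natCast_iff, hm, ZMod.val_add, ← Nat.add_mul,
    ← Nat.mul_mod_mul_right]
  exact Nat.mod_modEq _ _

omit [NeZero m] [NeZero n] in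
/-- `liftBy 0 = 0`. [folklore] -/
private theorem liftBy_zero : liftBy m n d 0 = 0 := by
  simp [liftBy]

omit [NeZero n] in
/-- Every residue in `dℤ/m` is a lift. [folklore] -/
private theorem liftBy_div (hm : m = n * d) (hd : 0 < d) {w : ZMod m} (hw : d ∣ w.val) :
    liftBy m n d ((w.val / d : ℕ) : ZMod n) = w := by
  have hlt : w.val / d < n := by
    rw [Nat.div_lt_iff_lt_mul hd]; exact lt_of_lt_of_eq (ZMod.val_lt w) hm
  rw [liftBy, ZMod.val_natCast, Nat.mod_eq_of_lt hlt, Nat.div_mul_cancel hw, ZMod.natCast_zmod_val]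

/-- A multiset all of whose members lie in `dℤ/m` is a lift; the lift is pair-free if the original is. [folklore] -/
private theorem exists_eq_map_liftBy (hm : m = n * d) (hd : 0 < d) {s : Multiset (ZMod m)} (hs : ∀ w ∈ s, d ∣ w.val) :
    ∃ M : Multiset (ZMod n), s = M.map (liftBy m n d) ∧ Multiset.card M = Multiset.card s ∧
      ((∀ a ∈ s, ∀ b ∈ s.erase a, a + b ≠ 0) → ∀ a ∈ M, ∀ b ∈ M.erase a, a + b ≠ 0) := by
  classical
  set g : ZMod m → ZMod n := fun w ↦ ((w.val / d : ℕ) : ZMod n) with hg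
  have hga : ∀ w ∈ s, liftBy m n d (g w) = w := fun w hw ↦ liftBy_div hm hd (hs w hw)
  refine ⟨s.map g, ?_, by rw [Multiset.card_map], fun hpf a ha b hb hab ↦ ?_⟩
  · rw [Multiset.map_map]
    conv_lhs => rw [← Multiset.map_id s]
    exact Multiset.map_congr rfl fun w hw ↦ (hga w hw).symm
  · obtain ⟨a', ha', rfl⟩ := Multiset.mem_map.mp ha
    rw [← Multiset.map_erase_of_mem _ _ ha'] at hb
    obtain ⟨b', hb', rfl⟩ := Multiset.mem_map.mp hb
    have hb's : b' ∈ s := Multiset.mem_of_mem_erase hb'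
    apply hpf a' ha' b' hb'
    have e : liftBy m n d (g a' + g b') = 0 := by rw [hab, liftBy_zero]
    rwa [liftBy_add hm, hga a' ha', hga b' hb's] at e
-- END DUP

omit [NeZero m] in
/-- `liftBy (−a) = −liftBy a`. [folklore] -/
private theorem liftBy_neg (hm : m = n * d) (a : ZMod n) : liftBy m n d (-a) = -liftBy m n d a :=
  eq_neg_of_add_eq_zero_left (by rw [← liftBy_add hm, neg_add_cancel, liftBy_zero])

omit [NeZero m] in
/-- `liftBy (k a) = k liftBy a`. [folklore] -/
private theorem liftBy_natCast_mul (hm : m = n * d) (k : ℕ) (a : ZMod n) :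
    liftBy m n d ((k : ZMod n) * a) = (k : ZMod m) * liftBy m n d a := by
  induction k with
  | zero => simp [liftBy_zero]
  | succ k ih => rw [Nat.cast_succ, Nat.cast_succ, add_mul, one_mul, liftBy_add hm, ih, add_mul, one_mul]

omit [NeZero m] in
/-- `liftBy (k a) = k liftBy a` for numerals. [folklore] -/
private theorem liftBy_ofNat_mul (hm : m = n * d) (k : ℕ) [k.AtLeastTwo] (a : ZMod n) :
    liftBy m n d (OfNat.ofNat k * a) = (OfNat.ofNat k : ZMod m) * liftBy m n d a := by
  exact_mod_cast liftBy_natCast_mul hm k a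

omit [NeZero m] [NeZero n] in
/-- `liftBy` of a natural-number residue. [folklore] -/
private theorem liftBy_natCast (j : ℕ) (hj : j < n) : liftBy m n d (j : ZMod n) = ((j * d : ℕ) : ZMod m) := by
  rw [liftBy, ZMod.val_natCast, Nat.mod_eq_of_lt hj]

end Lift

/-! ### The conclusion of the classification -/

/-- The conclusion of the classification at level `36p` for `s`: `α_x`, `β_x`, `γ_x`, or one of the `44` lifted non-standard
quadruples of level `36`. [folklore] -/
private def Concl (s : Multiset (ZMod (36 * p))) : Prop :=
  ∃ x : ZMod (36 * p), s = {x, x + K36, -(2 * x), K36} ∨ s = {x, x + K36, 2 * x + K36, -(4 * x)} ∨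
    s = {x, x + D36, x + 2 * D36, -(3 * x)} ∨
    ((∃ t : ℕ, (t = 1 ∨ t = 5 ∨ t = 7 ∨ t = 11 ∨ t = 13 ∨ t = 17 ∨ t = 19 ∨ t = 23 ∨ t = 25 ∨ t = 29 ∨ t = 31 ∨ t = 35) ∧
        x = ((t * p : ℕ) : ZMod (36 * p))) ∧
      (s = {x, 19 * x, 24 * x, 28 * x} ∨ s = {2 * x, 9 * x, 28 * x, 33 * x} ∨ s = {2 * x, 12 * x, 28 * x, 30 * x} ∨
        s = {2 * x, 14 * x, 24 * x, 32 * x} ∨ s = {2 * x, 18 * x, 24 * x, 28 * x} ∨ s = {3 * x, 12 * x, 27 * x, 30 * x} ∨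
        s = {3 * x, 18 * x, 24 * x, 27 * x}))

/-! ### Case 0: all members in the fibre `0` — the level `36` (`HodgeQuadruplesThirtySix`) -/

/-- The units of `ℤ/36` by representative. [folklore] -/
private theorem unit_val36 {k : ZMod 36}
    (hk : k = 1 ∨ k = 5 ∨ k = 7 ∨ k = 11 ∨ k = 13 ∨ k = 17 ∨ k = 19 ∨ k = 23 ∨ k = 25 ∨ k = 29 ∨ k = 31 ∨ k = 35) :
    k.val = 1 ∨ k.val = 5 ∨ k.val = 7 ∨ k.val = 11 ∨ k.val = 13 ∨ k.val = 17 ∨ k.val = 19 ∨ k.val = 23 ∨ k.val = 25 ∨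
      k.val = 29 ∨ k.val = 31 ∨ k.val = 35 := by
  rcases hk with rfl | rfl | rfl | rfl | rfl | rfl | rfl | rfl | rfl | rfl | rfl | rfl <;> decide

/-- **All members in `pℤ/36p`:** `s = p·M` with `M` a pair-free Hodge quadruple of level `36` (`𝔍ₘ(p) ≅ 𝔍₃₆(1)`), classified by
`classify_hodgeMultiset_thirtySix`. [cite: Shioda1982PicardFermat, §2 p. 726 (𝔍ₘ(d) ≅ 𝔍_{m/d}(1)) and table p. 727 (m = 36)]
[cite: MeyerNeutsch1981Fermatquadrupel, Tabelle 1 p. 54 (N = 12, 18, 36)] -/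
private theorem fibre_zero (h : Nat.Coprime 36 p) [NeZero (36 * p)] (hp : p.Prime)
    {s : Multiset (ZMod (36 * p))} (hs : IsHodgeMultiset s) (hcard : Multiset.card s = 4)
    (hind : ∀ a ∈ s, ∀ b ∈ s.erase a, a + b ≠ 0) (h0 : ∀ w ∈ s, (crt h w).2 = 0) : Concl s := by
  classical
  have hp0 := hp.pos
  have hm : 36 * p = 36 * p := rfl
  have hdiv : ∀ w ∈ s, p ∣ w.val := fun w hw ↦ by
    have := h0 w hw
    rwa [crt_snd, ZMod.natCast_eq_zero_iff] at this
  obtain ⟨M, hsM, hcM, hpfM⟩ := exists_eq_map_liftBy (m := 36 * p) (n := 36) (d := p) hm hp0 hdiv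
  rw [hcard] at hcM
  have hMH : IsHodgeMultiset M := (isHodgeMultiset_map_liftBy_iff hm hp0 M).mp (hsM ▸ hs)
  obtain ⟨k, hk⟩ := classify_hodgeMultiset_thirtySix hMH hcM (hpfM hind)
  have ΦK : liftBy (36 * p) 36 p 18 = K36 := by
    rw [show (18 : ZMod 36) = ((18 : ℕ) : ZMod 36) from (Nat.cast_ofNat).symm, liftBy_natCast 18 (by norm_num)]
  have ΦD : liftBy (36 * p) 36 p 12 = D36 := by
    rw [show (12 : ZMod 36) = ((12 : ℕ) : ZMod 36) from (Nat.cast_ofNat).symm, liftBy_natCast 12 (by norm_num)]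
  have ΦD2 : liftBy (36 * p) 36 p 24 = 2 * D36 := by
    rw [show (24 : ZMod 36) = ((24 : ℕ) : ZMod 36) from (Nat.cast_ofNat).symm, liftBy_natCast 24 (by norm_num)]
    push_cast; ring
  refine ⟨liftBy (36 * p) 36 p k, ?_⟩
  rw [hsM]
  rcases hk with e | e | e | ⟨hkk, e⟩
  · left
    rw [e]
    simp only [Multiset.insert_eq_cons, Multiset.map_cons, Multiset.map_singleton, liftBy_add hm, liftBy_neg hm,
      liftBy_ofNat_mul hm, ΦK]
  · right; left
    rw [e]
    simp only [Multiset.insert_eq_cons, Multiset.map_cons, Multiset.map_singleton, liftBy_add hm, liftBy_neg hm,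
      liftBy_ofNat_mul hm, ΦK]
  · right; right; left
    rw [e]
    simp only [Multiset.insert_eq_cons, Multiset.map_cons, Multiset.map_singleton, liftBy_add hm, liftBy_neg hm,
      liftBy_ofNat_mul hm, ΦD, ΦD2]
  · right; right; right
    refine ⟨⟨k.val, unit_val36 hkk, rfl⟩, ?_⟩
    rcases e with e | e | e | e | e | e | e <;> rw [e] <;>
      simp only [Multiset.insert_eq_cons, Multiset.map_cons, Multiset.map_singleton, liftBy_ofNat_mul hm, true_or, or_true]

/-! ### Case I: all members even — the level `18p` -/

/-- **All members even:** `s = 2σ` with `σ` a pair-free Hodge `4`-multiset of level `18p` (`𝔍ₘ(2) ≅ 𝔍_{18p}(1)`), which the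
level-`18p` theorem classifies (`p ≥ 17`); doubling back gives `α_x`, `β_x`, `γ_x` with `x = 2y`, or twice a lifted exceptional
quadruple of level `18`. [cite: Shioda1982PicardFermat, §2 p. 726 (𝔍ₘ(d) ≅ 𝔍_{m/d}(1)) and Prop. 4 (Q′) p. 729] -/
private theorem case_all_even [NeZero (36 * p)] (hp : p.Prime) (h17 : 17 ≤ p) {s : Multiset (ZMod (36 * p))}
    (hs : IsHodgeMultiset s) (hcard : Multiset.card s = 4) (hpf : ∀ a ∈ s, ∀ b ∈ s.erase a, a + b ≠ 0)
    (hev : ∀ w ∈ s, w.val % 2 = 0) : Concl s := by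
  classical
  have hp0 := hp.pos
  haveI : NeZero (18 * p) := ⟨by omega⟩
  have hm : 36 * p = 18 * p * 2 := by ring
  have hdiv : ∀ w ∈ s, 2 ∣ w.val := fun w hw ↦ Nat.dvd_of_mod_eq_zero (hev w hw)
  obtain ⟨σ, hsσ, hcσ, hpfσ⟩ := exists_eq_map_liftBy hm two_pos hdiv
  rw [hcard] at hcσ
  have hσH : IsHodgeMultiset σ := (isHodgeMultiset_map_liftBy_iff hm two_pos σ).mp (hsσ ▸ hs)
  obtain ⟨y, hy⟩ := classify_hodgeMultiset_eighteenPrime hp h17 hσH hcσ (hpfσ hpf)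
  have ΦK : liftBy (36 * p) (18 * p) 2 L18 = K36 := by rw [liftBy_natCast (9 * p) (by omega)]; push_cast; ring
  have ΦE : liftBy (36 * p) (18 * p) 2 E18 = D36 := by rw [liftBy_natCast (6 * p) (by omega)]; push_cast; ring
  rw [hsσ]
  rcases hy with e | e | e | ⟨⟨t, ht, hty⟩, e⟩
  · refine ⟨liftBy (36 * p) (18 * p) 2 y, Or.inl ?_⟩
    rw [e]
    simp only [Multiset.insert_eq_cons, Multiset.map_cons, Multiset.map_singleton, liftBy_add hm, liftBy_neg hm,
      liftBy_ofNat_mul hm, ΦK]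
  · refine ⟨liftBy (36 * p) (18 * p) 2 y, Or.inr (Or.inl ?_)⟩
    rw [e]
    simp only [Multiset.insert_eq_cons, Multiset.map_cons, Multiset.map_singleton, liftBy_add hm, liftBy_neg hm,
      liftBy_ofNat_mul hm, ΦK]
  · refine ⟨liftBy (36 * p) (18 * p) 2 y, Or.inr (Or.inr (Or.inl ?_))⟩
    rw [e]
    simp only [Multiset.insert_eq_cons, Multiset.map_cons, Multiset.map_singleton, liftBy_add hm, liftBy_neg hm,
      liftBy_ofNat_mul hm, ΦE]
  · -- twice a lifted exceptional quadruple of level `18`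
    set x : ZMod (36 * p) := ((t * p : ℕ) : ZMod (36 * p)) with hx
    have ht18 : t < 18 := by rcases ht with rfl | rfl | rfl | rfl | rfl | rfl <;> norm_num
    have htp : t * p < 18 * p := by nlinarith
    have hΦy : liftBy (36 * p) (18 * p) 2 y = 2 * x := by
      rw [hty, liftBy_natCast (t * p) htp, hx]; push_cast; ring
    have ht' : t = 1 ∨ t = 5 ∨ t = 7 ∨ t = 11 ∨ t = 13 ∨ t = 17 ∨ t = 19 ∨ t = 23 ∨ t = 25 ∨ t = 29 ∨ t = 31 ∨ t = 35 := by
      rcases ht with rfl | rfl | rfl | rfl | rfl | rfl <;> simp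
    refine ⟨x, Or.inr (Or.inr (Or.inr ⟨⟨t, ht', hx⟩, ?_⟩))⟩
    have e6 : (6 : ZMod (36 * p)) * (2 * x) = 12 * x := by ring
    have e7 : (7 : ZMod (36 * p)) * (2 * x) = 14 * x := by ring
    have e9 : (9 : ZMod (36 * p)) * (2 * x) = 18 * x := by ring
    have e12 : (12 : ZMod (36 * p)) * (2 * x) = 24 * x := by ring
    have e14 : (14 : ZMod (36 * p)) * (2 * x) = 28 * x := by ring
    have e15 : (15 : ZMod (36 * p)) * (2 * x) = 30 * x := by ring
    have e16 : (16 : ZMod (36 * p)) * (2 * x) = 32 * x := by ring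
    rcases e with e | e | e <;> rw [e] <;>
      simp only [Multiset.insert_eq_cons, Multiset.map_cons, Multiset.map_singleton, liftBy_ofNat_mul hm, hΦy, e6, e7, e9,
        e12, e14, e15, e16, true_or, or_true]

/-! ### Case T: all members divisible by `3` — the level `12p` -/

/-- **All members divisible by `3`:** `s = 3σ` with `σ` a pair-free Hodge `4`-multiset of level `12p` (`𝔍ₘ(3) ≅ 𝔍_{12p}(1)`), which
the level-`12p` theorem classifies (`p ≥ 17`); tripling back gives `α_x`, `β_x`, `γ_x` with `x = 3y`, or three times a lifted
exceptional quadruple of level `12`. [cite: Shioda1982PicardFermat, §2 p. 726 (𝔍ₘ(d) ≅ 𝔍_{m/d}(1)) and Prop. 4 (Q′) p. 729] -/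
private theorem case_all_triple [NeZero (36 * p)] (hp : p.Prime) (h17 : 17 ≤ p) {s : Multiset (ZMod (36 * p))}
    (hs : IsHodgeMultiset s) (hcard : Multiset.card s = 4) (hpf : ∀ a ∈ s, ∀ b ∈ s.erase a, a + b ≠ 0)
    (h3 : ∀ w ∈ s, w.val % 3 = 0) : Concl s := by
  classical
  have hp0 := hp.pos
  haveI : NeZero (12 * p) := ⟨by omega⟩
  have hm : 36 * p = 12 * p * 3 := by ring
  have hdiv : ∀ w ∈ s, 3 ∣ w.val := fun w hw ↦ Nat.dvd_of_mod_eq_zero (h3 w hw)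
  obtain ⟨σ, hsσ, hcσ, hpfσ⟩ := exists_eq_map_liftBy hm (by norm_num) hdiv
  rw [hcard] at hcσ
  have hσH : IsHodgeMultiset σ := (isHodgeMultiset_map_liftBy_iff hm (by norm_num) σ).mp (hsσ ▸ hs)
  obtain ⟨y, hy⟩ := classify_hodgeMultiset_twelvePrime hp h17 hσH hcσ (hpfσ hpf)
  have ΦK : liftBy (36 * p) (12 * p) 3 (((6 * p : ℕ)) : ZMod (12 * p)) = K36 := by
    rw [liftBy_natCast (6 * p) (by omega)]; push_cast; ring
  have ΦE : liftBy (36 * p) (12 * p) 3 (((4 * p : ℕ)) : ZMod (12 * p)) = D36 := by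
    rw [liftBy_natCast (4 * p) (by omega)]; push_cast; ring
  rw [hsσ]
  rcases hy with e | e | e | ⟨⟨t, ht, hty⟩, e⟩
  · refine ⟨liftBy (36 * p) (12 * p) 3 y, Or.inl ?_⟩
    rw [e]
    simp only [Multiset.insert_eq_cons, Multiset.map_cons, Multiset.map_singleton, liftBy_add hm, liftBy_neg hm,
      liftBy_ofNat_mul hm, ΦK]
  · refine ⟨liftBy (36 * p) (12 * p) 3 y, Or.inr (Or.inl ?_)⟩
    rw [e]
    simp only [Multiset.insert_eq_cons, Multiset.map_cons, Multiset.map_singleton, liftBy_add hm, liftBy_neg hm,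
      liftBy_ofNat_mul hm, ΦK]
  · refine ⟨liftBy (36 * p) (12 * p) 3 y, Or.inr (Or.inr (Or.inl ?_))⟩
    rw [e]
    simp only [Multiset.insert_eq_cons, Multiset.map_cons, Multiset.map_singleton, liftBy_add hm, liftBy_neg hm,
      liftBy_ofNat_mul hm, ΦE]
  · -- three times a lifted exceptional quadruple of level `12`
    set x : ZMod (36 * p) := ((t * p : ℕ) : ZMod (36 * p)) with hx
    have ht12 : t < 12 := by rcases ht with rfl | rfl | rfl | rfl <;> norm_num
    have htp : t * p < 12 * p := by nlinarith
    have hΦy : liftBy (36 * p) (12 * p) 3 y = 3 * x := by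
      rw [hty, liftBy_natCast (t * p) htp, hx]; push_cast; ring
    have ht' : t = 1 ∨ t = 5 ∨ t = 7 ∨ t = 11 ∨ t = 13 ∨ t = 17 ∨ t = 19 ∨ t = 23 ∨ t = 25 ∨ t = 29 ∨ t = 31 ∨ t = 35 := by
      rcases ht with rfl | rfl | rfl | rfl <;> simp
    refine ⟨x, Or.inr (Or.inr (Or.inr ⟨⟨t, ht', hx⟩, ?_⟩))⟩
    have e4 : (4 : ZMod (36 * p)) * (3 * x) = 12 * x := by ring
    have e6 : (6 : ZMod (36 * p)) * (3 * x) = 18 * x := by ring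
    have e8 : (8 : ZMod (36 * p)) * (3 * x) = 24 * x := by ring
    have e9 : (9 : ZMod (36 * p)) * (3 * x) = 27 * x := by ring
    have e10 : (10 : ZMod (36 * p)) * (3 * x) = 30 * x := by ring
    rcases e with e | e <;> rw [e] <;>
      simp only [Multiset.insert_eq_cons, Multiset.map_cons, Multiset.map_singleton, liftBy_ofNat_mul hm, hΦy, e4, e6, e8, e9,
        e10, true_or, or_true]

/-! ### Two odd members in the fibre `0`: the norm equations at the units `pt(1, λ)` -/

/-- For a prime `p ≥ 11`, an even `n ≤ 36` divisible by `p` is `0`. [folklore] -/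
private theorem eq_zero_of_dvd_of_even (hp : p.Prime) (h19 : 19 ≤ p) {n : ℕ} (hn : n ≤ 36) (he : n % 2 = 0) (hd : p ∣ n) :
    n = 0 := by
  obtain ⟨k, rfl⟩ := hd
  have hp2 : p % 2 = 1 := Nat.odd_iff.mp (hp.odd_of_ne_two (by omega))
  rcases Nat.lt_or_ge k 2 with hk | hk
  · interval_cases k
    · rfl
    · rw [mul_one] at he; omega
  · have : p * 2 ≤ p * k := Nat.mul_le_mul_left _ hk
    omega

/-- **The step-function contradiction.** If for every `μ ≠ 0` in `ℤ/p` there are `A, B < p` with `36A + F ≡ μ`,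
`36B + F′ ≡ −μ` and `A + B` independent of `μ` — where `F, F′ < 36` are even with `F + F′ ∉ {0, 36}` — then `p ≤ 17`:
`B` is an affine function of `A` modulo `p`, so `A + B` jumps by `p` inside `[0, p)` unless the jump is hidden at the at most
one excluded value of `A`, which the parity of `F, F′` forbids for `p ≥ 19`. [folklore] -/
private theorem step_contra (hp : p.Prime) (h19 : 19 ≤ p) (h36 : ((36 : ℕ) : ZMod p) ≠ 0) {F F' N : ℕ} (hF : F < 36)
    (hF' : F' < 36) (hFe : F % 2 = 0) (hF'e : F' % 2 = 0) (hS0 : F + F' ≠ 0) (hS20 : F + F' ≠ 36)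
    (H : ∀ μ : ZMod p, μ ≠ 0 → ∃ A B : ℕ, A < p ∧ B < p ∧ ((36 * A + F : ℕ) : ZMod p) = μ ∧
      ((36 * B + F' : ℕ) : ZMod p) = -μ ∧ A + B = N) : False := by
  haveI := Fact.mk hp
  have hp2 : p % 2 = 1 := Nat.odd_iff.mp (hp.odd_of_ne_two (by omega))
  -- the value of `A` at `μ = 36a + F` is `a`
  have HA : ∀ a : ℕ, a < p → ((36 * a + F : ℕ) : ZMod p) ≠ 0 →
      ∃ B : ℕ, B < p ∧ ((36 * B + F' : ℕ) : ZMod p) = -((36 * a + F : ℕ) : ZMod p) ∧ a + B = N := by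
    intro a ha hμ
    obtain ⟨A, B, hA, hB, eA, eB, hN⟩ := H _ hμ
    have eAa : A = a := by
      have e1 : ((36 : ℕ) : ZMod p) * (A : ZMod p) = ((36 : ℕ) : ZMod p) * (a : ZMod p) := by
        have := eA; push_cast at this ⊢; linear_combination this
      have e2 : (A : ZMod p) = (a : ZMod p) := mul_left_cancel₀ h36 e1
      rw [ZMod.natCast_eq_natCast_iff'] at e2
      rw [Nat.mod_eq_of_lt hA, Nat.mod_eq_of_lt ha] at e2
      exact e2
    subst eAa
    exact ⟨B, hB, eB, hN⟩
  -- admissibility of `a = 0` and `a = p − 1`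
  by_cases h0 : ((36 * 0 + F : ℕ) : ZMod p) = 0
  · -- `F ≡ 0`: then `F = 0`; use `a = 1` and `a = p − 1`
    have hF0 : F = 0 := by
      rw [ZMod.natCast_eq_zero_iff] at h0
      exact eq_zero_of_dvd_of_even hp h19 (by omega) (by omega) (by simpa using h0)
    subst hF0
    have h1ne : ((36 * 1 + 0 : ℕ) : ZMod p) ≠ 0 := by simpa using h36
    have hpne : ((36 * (p - 1) + 0 : ℕ) : ZMod p) ≠ 0 := by
      intro h
      have e : ((36 * (p - 1) + 0 : ℕ) : ZMod p) = -((36 : ℕ) : ZMod p) := by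
        have : 36 * (p - 1) + 0 + 36 = 36 * p := by omega
        have h' := congrArg (Nat.cast : ℕ → ZMod p) this
        push_cast at h' ⊢
        rw [ZMod.natCast_self, mul_zero] at h'
        linear_combination h'
      rw [e, neg_eq_zero] at h
      exact h36 h
    obtain ⟨B1, hB1, eB1, hN1⟩ := HA 1 (by omega) h1ne
    obtain ⟨Bp, hBp, eBp, hNp⟩ := HA (p - 1) (by omega) hpne
    -- `B1 ≥ p − 2`
    have hB1ge : p - 2 ≤ B1 := by omega
    -- `36 B1 + F' ≡ −36`
    have e1 : ((36 * B1 + F' + 36 : ℕ) : ZMod p) = 0 := by push_cast at eB1 ⊢; linear_combination eB1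
    rw [ZMod.natCast_eq_zero_iff] at e1
    rcases Nat.lt_or_ge B1 (p - 1) with hlt | hge
    · -- `B1 = p − 2`: `36(p−2) + F' + 36 = 36p + (F' − 36)`, so `p ∣ 36 − F'`
      have hB1eq : B1 = p - 2 := by omega
      subst hB1eq
      have hd : p ∣ 36 * p - (36 - F') := by
        have : 36 * (p - 2) + F' + 36 = 36 * p - (36 - F') := by omega
        rwa [this] at e1
      have hd' : p ∣ 36 - F' := by
        have h2 : p ∣ 36 * p := dvd_mul_left p 36
        have := (Nat.dvd_sub h2 hd)
        rwa [Nat.sub_sub_self (by omega)] at this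
      have := eq_zero_of_dvd_of_even hp h19 (n := 36 - F') (by omega) (by omega) hd'
      omega
    · -- `B1 = p − 1`: `36(p−1) + F' + 36 = 36p + F'`, so `p ∣ F'`
      have hB1eq : B1 = p - 1 := by omega
      subst hB1eq
      have hd : p ∣ 36 * p + F' := by
        have : 36 * (p - 1) + F' + 36 = 36 * p + F' := by omega
        rwa [this] at e1
      have hd' : p ∣ F' := (Nat.dvd_add_right (dvd_mul_left p 36)).mp hd
      have := eq_zero_of_dvd_of_even hp h19 (n := F') (by omega) hF'e hd'
      omega
  by_cases hP : ((36 * (p - 1) + F : ℕ) : ZMod p) = 0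
  · -- `F ≡ 36`: `p ∣ 36 − F`, impossible by parity
    rw [ZMod.natCast_eq_zero_iff] at hP
    have hd : p ∣ 36 * p - (36 - F) := by
      have : 36 * (p - 1) + F = 36 * p - (36 - F) := by omega
      rwa [this] at hP
    have hd' : p ∣ 36 - F := by
      have h2 : p ∣ 36 * p := dvd_mul_left p 36
      have := Nat.dvd_sub h2 hd
      rwa [Nat.sub_sub_self (by omega)] at this
    have := eq_zero_of_dvd_of_even hp h19 (n := 36 - F) (by omega) (by omega) hd'
    omega
  -- both `a = 0` and `a = p − 1` admissible: `N = B₀ ≤ p − 1` and `N ≥ p − 1`, so `B_{p−1} = 0` and `F + F' ≡ 36`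
  obtain ⟨B0, hB0, eB0, hN0⟩ := HA 0 (by omega) h0
  obtain ⟨Bp, hBp, eBp, hNp⟩ := HA (p - 1) (by omega) hP
  have hBp0 : Bp = 0 := by omega
  subst hBp0
  have e1 : ((F' + 36 * (p - 1) + F : ℕ) : ZMod p) = 0 := by push_cast at eBp ⊢; linear_combination eBp
  rw [ZMod.natCast_eq_zero_iff] at e1
  -- `F' + 36(p − 1) + F = 36p + (F + F' − 36)`
  rcases Nat.lt_or_ge (F + F') 36 with hlt | hge
  · have hd : p ∣ 36 * p - (36 - (F + F')) := by
      have : F' + 36 * (p - 1) + F = 36 * p - (36 - (F + F')) := by omega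
      rwa [this] at e1
    have hd' : p ∣ 36 - (F + F') := by
      have h2 : p ∣ 36 * p := dvd_mul_left p 36
      have := Nat.dvd_sub h2 hd
      rwa [Nat.sub_sub_self (by omega)] at this
    have := eq_zero_of_dvd_of_even hp h19 (n := 36 - (F + F')) (by omega) (by omega) hd'
    omega
  · have hd : p ∣ 36 * p + (F + F' - 36) := by
      have : F' + 36 * (p - 1) + F = 36 * p + (F + F' - 36) := by omega
      rwa [this] at e1
    have hd' : p ∣ F + F' - 36 := (Nat.dvd_add_right (dvd_mul_left p 36)).mp hd
    have := eq_zero_of_dvd_of_even hp h19 (n := F + F' - 36) (by omega) (by omega) hd'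
    omega

/-- **Two odd members, both in the fibre `0`:** impossible. The even members are `pt(f, c)`, `pt(f′, −c)` (`c ≠ 0`); the units
`t = pt(1, λ)` fix the odd members and move the even ones to `pt(f, μ)`, `pt(f′, −μ)`, `μ = λc`; writing `⟨pt(f, μ)⟩ = 36A + ⟨f⟩`,
`⟨pt(f′, −μ)⟩ = 36B + ⟨f′⟩`, the norm equations say that `A + B` is independent of `μ ≠ 0` — `step_contra`.
[cite: Shioda1979PJA, §1 eq. (2)] -/
private theorem case_two_odd_fibre (h : Nat.Coprime 36 p) [NeZero (36 * p)] (hp : p.Prime) (h19 : 19 ≤ p)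
    {s : Multiset (ZMod (36 * p))} (hs : IsHodgeMultiset s) (hpf : ∀ a ∈ s, ∀ b ∈ s.erase a, a + b ≠ 0)
    {x y z w : ZMod (36 * p)} (hsx : s = {x, y, z, w})
    (hz0 : z.val % 2 = 0) (hw0 : w.val % 2 = 0) (hxc : (crt h x).2 = 0) (hyc : (crt h y).2 = 0)
    (hzc : (crt h z).2 ≠ 0) : False := by
  classical
  haveI := Fact.mk hp
  have h36 := thirtysix_ne_zero h hp
  have hz : z ∈ s := by rw [hsx]; simp
  have hwz : w ∈ s.erase z := by
    rw [hsx, show ({x, y, z, w} : Multiset (ZMod (36 * p))) = {z, x, y, w} by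
      simp only [Multiset.insert_eq_cons, ← Multiset.singleton_add]; abel, Multiset.insert_eq_cons,
      Multiset.erase_cons_head]
    simp
  -- coordinates
  obtain ⟨e₁, rfl⟩ : ∃ e₁, x = pt h e₁ 0 := ⟨(crt h x).1, by conv_lhs => rw [← pt_crt h x, hxc]⟩
  obtain ⟨e₂, rfl⟩ : ∃ e₂, y = pt h e₂ 0 := ⟨(crt h y).1, by conv_lhs => rw [← pt_crt h y, hyc]⟩
  obtain ⟨f, c, rfl⟩ : ∃ f c, z = pt h f c := ⟨_, _, (pt_crt h z).symm⟩
  obtain ⟨f', c', rfl⟩ : ∃ f' c', w = pt h f' c' := ⟨_, _, (pt_crt h w).symm⟩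
  simp only [crt_pt] at hzc
  have hc' : c' = -c := by
    have := congrArg (fun v ↦ (crt h v).2) hs.1.2
    simp only [hsx, Multiset.insert_eq_cons, Multiset.sum_cons, Multiset.sum_singleton, _root_.map_add, Prod.snd_add, crt_pt,
      _root_.map_zero, Prod.snd_zero] at this
    linear_combination this
  subst hc'
  have hf : f.val % 2 = 0 := by rwa [val_pt_mod_two] at hz0
  have hf' : f'.val % 2 = 0 := by rwa [val_pt_mod_two] at hw0
  -- no pair: `f + f' ≠ 0`, i.e. `⟨f⟩ + ⟨f'⟩ ∉ {0, 36}`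
  have hff : f + f' ≠ 0 := by
    intro e
    apply hpf _ hz _ hwz
    rw [pt_add, e, add_neg_cancel, pt_zero]
  have hvf := ZMod.val_lt f
  have hvf' := ZMod.val_lt f'
  have hS : f.val + f'.val ≠ 0 ∧ f.val + f'.val ≠ 36 := by
    have key : (((f.val + f'.val : ℕ)) : ZMod 36) ≠ 0 := by
      rw [Nat.cast_add, ZMod.natCast_zmod_val, ZMod.natCast_zmod_val]; exact hff
    constructor
    · intro e; apply key; rw [e, Nat.cast_zero]
    · intro e; apply key; rw [e]; rfl
  -- the norm equations at the units `pt(1, λ)`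
  set N : ℕ := (72 * p - (pt h e₁ 0).val - (pt h e₂ 0).val - f.val - f'.val) / 36 with hN
  refine step_contra hp (by omega) h36 hvf hvf' hf hf' hS.1 hS.2 (N := N) fun μ hμ ↦ ?_
  obtain ⟨t, ht⟩ := isUnit_pt_one h hp (b := μ * c⁻¹) (mul_ne_zero hμ (inv_ne_zero hzc))
  have key := hs.2 t
  rw [hsx] at key
  simp only [Multiset.insert_eq_cons, Multiset.map_cons, Multiset.map_singleton, Multiset.card_cons, Multiset.card_singleton,
    mNormSum_cons, ht, pt_mul, one_mul, mul_zero, mul_neg, inv_mul_cancel_right₀ hzc] at key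
  simp only [mNormSum, Multiset.map_singleton, Multiset.sum_singleton] at key
  have hA := Nat.div_add_mod (pt h f μ).val 36
  have hB := Nat.div_add_mod (pt h f' (-μ)).val 36
  rw [val_pt_mod_thirtysix] at hA hB
  have hAlt := ZMod.val_lt (pt h f μ)
  have hBlt := ZMod.val_lt (pt h f' (-μ))
  refine ⟨(pt h f μ).val / 36, (pt h f' (-μ)).val / 36, by omega, by omega, ?_, ?_, by omega⟩
  · rw [hA, natCast_val_pt]
  · rw [hB, natCast_val_pt]

/-! ### Case II: two odd members -/

/-- The reduction `ℤ/18p → ℤ/p` reads off the second Chinese-remainder coordinate. [folklore] -/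
private theorem castHom_castHom_eq_snd (h : Nat.Coprime 36 p) [NeZero (36 * p)] [NeZero (18 * p)] (hnm : 18 * p ∣ 36 * p)
    (v : ZMod (36 * p)) :
    ZMod.castHom (dvd_mul_left p 18) (ZMod p) (ZMod.castHom hnm (ZMod (18 * p)) v) = (crt h v).2 := by
  rw [crt_snd, ZMod.castHom_apply, ZMod.cast_eq_val, val_castHom, ZMod.natCast_eq_natCast_iff',
    Nat.mod_mod_of_dvd _ (dvd_mul_left p 18)]

/-- **Two odd members, one off the fibre `0`:** the odd members are `x, x + 18p` (`two_odd_core`), `T(s) = 2·{x̄, ẑ, ŵ}` and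
`{x̄, ẑ, ŵ, 9p}` is a Hodge quadruple of level `18p`; it has a pair exactly when `s = α_x`, and otherwise it is the level-`18p`
`α_y` with `y ∈ {x̄, x̄ + 9p}` (the level-`18p` `β_y` cannot contain `9p`; the level-`18p` `γ_y` and the lifted level-`18` quadruples
containing `9p` lie inside `pℤ/18p`, but `x̄` does not), i.e. `s = β_x`.
[cite: Shioda1982PicardFermat, Prop. 4 (Q′) p. 729] [cite: AokiShioda1983, §2 Theorem (𝔅²ₘ) (ii) a), b)] [cite: Aoki1983, Prop. 2.2] -/
private theorem case_two_odd (h : Nat.Coprime 36 p) [NeZero (36 * p)] (hp : p.Prime) (h17 : 17 ≤ p)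
    {s : Multiset (ZMod (36 * p))} (hs : IsHodgeMultiset s) (hpf : ∀ a ∈ s, ∀ b ∈ s.erase a, a + b ≠ 0)
    {x y z w : ZMod (36 * p)} (hsx : s = {x, y, z, w}) (hx1 : x.val % 2 = 1) (hy1 : y.val % 2 = 1)
    (hz0 : z.val % 2 = 0) (hw0 : w.val % 2 = 0) (hxc : (crt h x).2 ≠ 0) :
    s = {x, x + K36, -(2 * x), K36} ∨ s = {x, x + K36, 2 * x + K36, -(4 * x)} := by
  classical
  haveI := Fact.mk hp
  have hp0 := hp.pos
  have hp2 : p % 2 = 1 := Nat.odd_iff.mp (hp.odd_of_ne_two (by omega))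
  have h5 : 5 ≤ p := by omega
  haveI : NeZero (18 * p) := ⟨by omega⟩
  have hnm : 18 * p ∣ 36 * p := ⟨2, by ring⟩
  have hx : x ∈ s := by rw [hsx]; simp
  have hy : y ∈ s.erase x := by rw [hsx, Multiset.insert_eq_cons, Multiset.erase_cons_head]; simp
  have hz : z ∈ s := by rw [hsx]; simp
  have hw : w ∈ s := by rw [hsx]; simp
  have hz_ne : z ≠ 0 := hs.1.1 z hz
  have hw_ne : w ≠ 0 := hs.1.1 w hw
  -- Step 1: `y = x + 18p` by the relations on the odd part `{crt x, crt y}`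
  have hRel := rels_of_isHodgeMultiset h hp h5 hs
  have hsw : s = {z, w, x, y} := by
    rw [hsx]; simp only [Multiset.insert_eq_cons, ← Multiset.singleton_add]; abel
  rw [hsw] at hRel
  simp only [Multiset.insert_eq_cons, Multiset.map_cons, Multiset.map_singleton] at hRel
  have hO := (hRel.of_cons_even (by rw [fst_val_mod_two]; exact hz0)).of_cons_even
    (by rw [fst_val_mod_two]; exact hw0)
  have hex : (crt h x).1.val % 2 = 1 := by rw [fst_val_mod_two]; exact hx1
  have hey : (crt h y).1.val % 2 = 1 := by rw [fst_val_mod_two]; exact hy1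
  have hyx : (((crt h y).1, (crt h y).2) : ZMod 36 × ZMod p) ≠ -((crt h x).1, (crt h x).2) := by
    rw [Prod.mk.eta, Prod.mk.eta, ← _root_.map_neg, (crt h).injective.ne_iff]
    intro e; exact hpf x hx y hy (by rw [e, add_neg_cancel])
  obtain ⟨he', hc'⟩ := two_odd_core hp h17 hO (e := (crt h x).1) (c := (crt h x).2) (e' := (crt h y).1)
    (c' := (crt h y).2) (by simp only [Prod.mk.eta, Multiset.insert_eq_cons]) hex hey hxc hyx
  have hyK : y = x + K36 := by
    have e1 : pt h ((crt h x).1 + 18) (crt h x).2 = pt h (crt h x).1 (crt h x).2 + pt h 18 0 := by rw [pt_add, add_zero]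
    rw [← pt_crt h y, he', hc', e1, pt_crt, eighteenP_eq_pt h hp h5]
  subst hyK
  -- Step 2: the transfer `T(s) = 2·{x̄, ẑ, ŵ}`
  have hxK1 : (x + K36).val % 2 = 1 := by
    rcases val_add_K hp0 x with ⟨e, -⟩ | ⟨e, -⟩ <;> omega
  have hsplit : s = ({x, x + K36} : Multiset (ZMod (36 * p))) + {z, w} := by rw [hsx, pair_add_pair]
  have hT := isHodgeMultiset_transfer_thirtySixPrime hp0 hnm (so := {x, x + K36}) (se := {z, w})
    (by intro v hv; simp only [Multiset.insert_eq_cons, Multiset.mem_cons, Multiset.mem_singleton] at hv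
        rcases hv with rfl | rfl <;> assumption)
    (by intro v hv; simp only [Multiset.insert_eq_cons, Multiset.mem_cons, Multiset.mem_singleton] at hv
        rcases hv with rfl | rfl <;> assumption)
    (hsplit ▸ hs)
  have hRK : ZMod.castHom hnm (ZMod (18 * p)) (x + K36) = ZMod.castHom hnm (ZMod (18 * p)) x := by
    rw [_root_.map_add, map_natCast, ZMod.natCast_self, add_zero]
  simp only [Multiset.insert_eq_cons, Multiset.map_cons, Multiset.map_singleton, hRK] at hT
  set xb := ZMod.castHom hnm (ZMod (18 * p)) x with hxb
  set zt := ZMod.castHom hnm (ZMod (18 * p)) (half z) with hzt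
  set wt := ZMod.castHom hnm (ZMod (18 * p)) (half w) with hwt
  have hxb0 : xb ≠ 0 := castHom_ne_zero_of_odd hnm hx1
  have hzt0 : zt ≠ 0 := castHom_half_ne_zero hnm hz_ne hz0
  have hwt0 : wt ≠ 0 := castHom_half_ne_zero hnm hw_ne hw0
  have hK90 : L18 ≠ 0 := L18_ne_zero hp0
  have hxodd : xb.val % 2 = 1 := by rw [hxb, val_castHom_mod_two hnm, hx1]
  -- `x̄ ∉ pℤ/18p`
  set ρ := ZMod.castHom (dvd_mul_left p 18) (ZMod p) with hρ
  have hρR : ∀ v : ZMod (36 * p), ρ (ZMod.castHom hnm (ZMod (18 * p)) v) = (crt h v).2 := castHom_castHom_eq_snd h hnm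
  have hρK : ρ L18 = 0 := by rw [map_natCast, Nat.cast_mul, ZMod.natCast_self, mul_zero]
  have hρE : ρ E18 = 0 := by rw [map_natCast, Nat.cast_mul, ZMod.natCast_self, mul_zero]
  have hxbρ : ρ xb ≠ 0 := by rw [hxb, hρR]; exact hxc
  have hxbK : xb ≠ L18 := fun e ↦ hxbρ (by rw [e, hρK])
  -- norms and sum of `{x̄, ẑ, ŵ}`
  obtain ⟨⟨-, hTsum⟩, hTnorm⟩ := hT
  have hA : ∀ v : (ZMod (18 * p))ˣ,
      ((v : ZMod (18 * p)) * xb).val + ((v : ZMod (18 * p)) * zt).val + ((v : ZMod (18 * p)) * wt).val = 27 * p := by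
    intro v
    have e := hTnorm v
    simp only [Multiset.map_add, Multiset.map_cons, Multiset.map_singleton, mNormSum_add, mNormSum_cons,
      Multiset.card_add, Multiset.card_cons, Multiset.card_singleton] at e
    simp only [mNormSum, Multiset.map_singleton, Multiset.sum_singleton] at e
    omega
  have hsum3 : xb + zt + wt = L18 := by
    have h2 : (2 : ZMod (18 * p)) * (xb + zt + wt) = 0 := by
      simp only [Multiset.sum_add, Multiset.sum_cons, Multiset.sum_singleton] at hTsum
      linear_combination hTsum
    rcases (two_mul_eq_zero_eighteenP hp0).mp h2 with e | e
    · exfalso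
      have h1 := hA 1
      simp only [Units.val_one, one_mul] at h1
      have hcast : (((xb.val + zt.val + wt.val : ℕ)) : ZMod (18 * p)) = xb + zt + wt := by
        push_cast; simp only [ZMod.natCast_zmod_val]
      rw [h1, e, show ((27 * p : ℕ) : ZMod (18 * p)) = L18 + ((18 * p : ℕ) : ZMod (18 * p)) by push_cast; ring,
        ZMod.natCast_self, add_zero] at hcast
      exact hK90 hcast
    · exact e
  -- `τ = {x̄, ẑ, ŵ, 9p}` is a Hodge quadruple of level `18p`
  have hτ : IsHodgeMultiset ({xb, zt, wt, L18} : Multiset (ZMod (18 * p))) := by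
    refine ⟨⟨?_, ?_⟩, fun v ↦ ?_⟩
    · intro a ha
      simp only [Multiset.insert_eq_cons, Multiset.mem_cons, Multiset.mem_singleton] at ha
      rcases ha with rfl | rfl | rfl | rfl <;> assumption
    · simp only [Multiset.insert_eq_cons, Multiset.sum_cons, Multiset.sum_singleton]
      linear_combination hsum3 - neg_L18 (p := p)
    · have hvK : ((v : ZMod (18 * p)) * L18).val = 9 * p := by
        rw [unit_mul_natCast_half (m := 18 * p) (K := 9 * p) (by ring) v, val_L18 hp0]
      simp only [Multiset.insert_eq_cons, Multiset.map_cons, Multiset.map_singleton, mNormSum_cons, Multiset.card_cons,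
        Multiset.card_singleton]
      simp only [mNormSum, Multiset.map_singleton, Multiset.sum_singleton, hvK]
      have := hA v
      omega
  -- the doubles
  have hdx : dbl xb = 2 * x := dbl_castHom hnm x
  have hdz : dbl zt = z := dbl_castHom_half hnm hz0
  have hdw : dbl wt = w := dbl_castHom_half hnm hw0
  have hdK : dbl L18 = K36 := dbl_L18 hp0
  -- (i) `τ` has a pair: `s = α_x`
  by_cases h1 : xb + zt = 0
  · left
    have ezt : zt = -xb := by linear_combination h1
    have ewt : wt = L18 := by linear_combination hsum3 - h1
    have ez : z = -(2 * x) := by rw [← hdz, ezt, dbl_neg, hdx]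
    have ew : w = K36 := by rw [← hdw, ewt, hdK]
    rw [hsx, ez, ew]
  by_cases h2 : xb + wt = 0
  · left
    have ewt : wt = -xb := by linear_combination h2
    have ezt : zt = L18 := by linear_combination hsum3 - h2
    have ez : z = K36 := by rw [← hdz, ezt, hdK]
    have ew : w = -(2 * x) := by rw [← hdw, ewt, dbl_neg, hdx]
    rw [hsx, ez, ew]
    simp only [Multiset.insert_eq_cons, ← Multiset.singleton_add]; abel
  -- (ii) `τ` is pair-free: the level-`18p` classification
  right
  have h3 : zt + wt ≠ 0 := fun e ↦ hxbK (by linear_combination hsum3 - e)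
  have h4 : zt ≠ L18 := fun e ↦ h2 (by linear_combination hsum3 - e)
  have h5' : wt ≠ L18 := fun e ↦ h1 (by linear_combination hsum3 - e)
  have hτpf : ∀ a ∈ ({xb, zt, wt, L18} : Multiset (ZMod (18 * p))), ∀ b ∈ (({xb, zt, wt, L18} : Multiset (ZMod (18 * p)))).erase a,
      a + b ≠ 0 :=
    pairfree_quad h1 h2 (fun e ↦ hxbK (by linear_combination e + neg_L18 (p := p))) h3
      (fun e ↦ h4 (by linear_combination e + neg_L18 (p := p))) (fun e ↦ h5' (by linear_combination e + neg_L18 (p := p)))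
  have hc4 : Multiset.card ({xb, zt, wt, L18} : Multiset (ZMod (18 * p))) = 4 := rfl
  have hxmemτ : xb ∈ ({xb, zt, wt, L18} : Multiset (ZMod (18 * p))) := by simp
  have hKmemτ : L18 ∈ ({xb, zt, wt, L18} : Multiset (ZMod (18 * p))) := by simp
  obtain ⟨y, hy⟩ := classify_hodgeMultiset_eighteenPrime hp h17 hτ hc4 hτpf
  rcases hy with e | e | e | ⟨⟨t, -, hty⟩, e⟩
  · -- type `α` (level `18p`): cancel `9p`
    have e3 : ({xb, zt, wt} : Multiset (ZMod (18 * p))) = {y, y + L18, -(2 * y)} := by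
      have e' : ({xb, zt, wt} : Multiset (ZMod (18 * p))) + {L18} = {y, y + L18, -(2 * y)} + {L18} := by
        simpa only [Multiset.insert_eq_cons, Multiset.cons_add, Multiset.singleton_add] using e
      exact add_right_cancel e'
    have hxmem3 : xb ∈ ({y, y + L18, -(2 * y)} : Multiset (ZMod (18 * p))) := by rw [← e3]; simp
    simp only [Multiset.insert_eq_cons, Multiset.mem_cons, Multiset.mem_singleton] at hxmem3
    obtain ⟨y', e4, hy'⟩ : ∃ y' : ZMod (18 * p),
        ({xb, zt, wt} : Multiset (ZMod (18 * p))) = {y', y' + L18, -(2 * y')} ∧ xb = y' := by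
      rcases hxmem3 with e4 | e4 | e4
      · exact ⟨y, e3, e4⟩
      · refine ⟨y + L18, ?_, e4⟩
        rw [e3, show y + L18 + L18 = y by linear_combination -(neg_L18 (p := p)),
          show -(2 * (y + L18)) = -(2 * y) by linear_combination neg_L18 (p := p)]
        simp only [Multiset.insert_eq_cons, ← Multiset.singleton_add]; abel
      · exfalso
        rw [e4, val_neg_mod_two_eighteen, val_two_mul_mod_two_eighteen] at hxodd
        omega
    rw [← hy'] at e4
    have e5 : ({zt, wt} : Multiset (ZMod (18 * p))) = {xb + L18, -(2 * xb)} := by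
      simp only [Multiset.insert_eq_cons] at e4
      exact (Multiset.cons_inj_right _).mp e4
    have e6 := congrArg (Multiset.map dbl) e5
    simp only [Multiset.insert_eq_cons, Multiset.map_cons, Multiset.map_singleton, hdz, hdw, dbl_add, dbl_neg,
      dbl_two_mul, hdx, hdK] at e6
    rw [hsx, show -(4 * x) = -(2 * (2 * x)) by ring]
    simp only [Multiset.insert_eq_cons]
    rw [e6]
  · -- type `β` (level `18p`): `9p ∈ β_y` is impossible
    exfalso
    have hmem : L18 ∈ ({y, y + L18, 2 * y + L18, -(4 * y)} : Multiset (ZMod (18 * p))) := by rw [← e]; exact hKmemτ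
    have hne : ∀ a ∈ ({y, y + L18, 2 * y + L18, -(4 * y)} : Multiset (ZMod (18 * p))), a ≠ 0 := by rw [← e]; exact hτ.1.1
    have hy0 : y ≠ 0 := hne y (by simp)
    have hyK0 : y + L18 ≠ 0 := hne (y + L18) (by simp)
    simp only [Multiset.insert_eq_cons, Multiset.mem_cons, Multiset.mem_singleton] at hmem
    rcases hmem with e' | e' | e' | e'
    · exact hyK0 (by rw [← e']; linear_combination -(neg_L18 (p := p)))
    · exact hy0 (by linear_combination -e')
    · have h2y : (2 : ZMod (18 * p)) * y = 0 := by linear_combination -e'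
      rcases (two_mul_eq_zero_eighteenP hp0).mp h2y with e'' | e''
      · exact hy0 e''
      · exact hyK0 (by rw [e'']; linear_combination -(neg_L18 (p := p)))
    · -- `4y = 9p` is impossible modulo `2` (`p` odd)
      have e4 : (4 : ZMod (18 * p)) * y = L18 := by linear_combination e' + neg_L18 (p := p)
      have h4 := congrArg (ZMod.castHom (⟨9 * p, by ring⟩ : 2 ∣ 18 * p) (ZMod 2)) e4
      rw [_root_.map_mul, map_ofNat, map_natCast, show (4 : ZMod 2) = 0 from by decide, zero_mul, eq_comm,
        ZMod.natCast_eq_zero_iff] at h4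
      omega
  · -- type `γ` (level `18p`): `9p ∈ γ_y` forces `γ_y ⊂ pℤ/18p`, but `x̄ ∉ pℤ/18p`
    exfalso
    have hmem : L18 ∈ ({y, y + E18, y + 2 * E18, -(3 * y)} : Multiset (ZMod (18 * p))) := by rw [← e]; exact hKmemτ
    have hρ3 : (3 : ZMod p) ≠ 0 := by exact_mod_cast natCast_ne_zero_of_lt (p := p) (n := 3) (by norm_num) (by omega)
    have hρy : ρ y = 0 := by
      simp only [Multiset.insert_eq_cons, Multiset.mem_cons, Multiset.mem_singleton] at hmem
      rcases hmem with e' | e' | e' | e'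
      · rw [← e', hρK]
      · have := congrArg ρ e'
        rw [hρK, _root_.map_add, hρE, add_zero] at this
        exact this.symm
      · have := congrArg ρ e'
        rw [hρK, _root_.map_add, _root_.map_mul, hρE, map_ofNat, mul_zero, add_zero] at this
        exact this.symm
      · have := congrArg ρ e'
        rw [hρK, _root_.map_neg, _root_.map_mul, map_ofNat] at this
        have h3y : (3 : ZMod p) * ρ y = 0 := by linear_combination this
        rcases mul_eq_zero.mp h3y with h0 | h0
        · exact absurd h0 hρ3
        · exact h0
    have hxmem : xb ∈ ({y, y + E18, y + 2 * E18, -(3 * y)} : Multiset (ZMod (18 * p))) := by rw [← e]; exact hxmemτ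
    simp only [Multiset.insert_eq_cons, Multiset.mem_cons, Multiset.mem_singleton] at hxmem
    apply hxbρ
    rcases hxmem with e' | e' | e' | e' <;> rw [e'] <;>
      simp only [_root_.map_add, _root_.map_neg, _root_.map_mul, map_ofNat, hρy, hρE, mul_zero, add_zero, neg_zero]
  · -- a lifted exceptional quadruple of level `18` lies inside `pℤ/18p`
    exfalso
    have hρy : ρ y = 0 := by rw [hty, map_natCast, Nat.cast_mul, ZMod.natCast_self, mul_zero]
    apply hxbρ
    rcases e with e | e | e
    all_goals
      rw [e] at hxmemτ
      simp only [Multiset.insert_eq_cons, Multiset.mem_cons, Multiset.mem_singleton] at hxmemτ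
      rcases hxmemτ with e' | e' | e' | e' <;> rw [e'] <;> simp only [_root_.map_mul, map_ofNat, hρy, mul_zero]

/-! ### Case III: four odd members -/

/-- Members with prescribed images: from `t.map R = {a, b, c}` to `t = {x₂, x₃, x₄}` with `R x₂ = a`, `R x₃ = b`, `R x₄ = c`.
[folklore] -/
private theorem exists_triple_of_map_eq {X Y : Type*} {R : X → Y} {t : Multiset X} {a b c : Y}
    (ht : t.map R = {a, b, c}) : ∃ x₂ x₃ x₄ : X, t = {x₂, x₃, x₄} ∧ R x₂ = a ∧ R x₃ = b ∧ R x₄ = c := by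
  simp only [Multiset.insert_eq_cons] at ht
  have ha : a ∈ t.map R := by rw [ht]; simp
  obtain ⟨x₂, hx₂, hRx₂⟩ := Multiset.mem_map.mp ha
  obtain ⟨t', rfl⟩ := Multiset.exists_cons_of_mem hx₂
  rw [Multiset.map_cons, hRx₂, Multiset.cons_inj_right] at ht
  have hb : b ∈ t'.map R := by rw [ht]; simp
  obtain ⟨x₃, hx₃, hRx₃⟩ := Multiset.mem_map.mp hb
  obtain ⟨t'', rfl⟩ := Multiset.exists_cons_of_mem hx₃
  rw [Multiset.map_cons, hRx₃, Multiset.cons_inj_right] at ht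
  have hc1 : Multiset.card t'' = 1 := by
    have := congrArg Multiset.card ht
    simpa using this
  obtain ⟨x₄, rfl⟩ := Multiset.card_eq_one.mp hc1
  rw [Multiset.map_singleton, Multiset.singleton_inj] at ht
  exact ⟨x₂, x₃, x₄, rfl, hRx₂, hRx₃, ht⟩

/-- `12p · a = (⟨a⟩ mod 3) · 12p`. [folklore] -/
private theorem D_mul [NeZero (36 * p)] (a : ZMod (36 * p)) : D36 * a = ((a.val % 3 : ℕ) : ZMod (36 * p)) * D36 := by
  have e : a = ((a.val : ℕ) : ZMod (36 * p)) := (ZMod.natCast_zmod_val a).symm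
  have hd := Nat.div_add_mod a.val 3
  have h3 : (3 : ZMod (36 * p)) * D36 = 0 := by
    have : (3 : ZMod (36 * p)) * D36 = ((36 * p : ℕ) : ZMod (36 * p)) := by push_cast; ring
    rw [this, ZMod.natCast_self]
  conv_lhs => rw [e, ← hd]
  push_cast at h3 ⊢
  linear_combination (↑(a.val / 3) : ZMod (36 * p)) * h3

/-- `⟨x + c p⟩` for `c < 36`: add and reduce. [folklore] -/
private theorem val_add_mulP [NeZero (36 * p)] (hp : 0 < p) {c : ℕ} (hc : c < 36) (x : ZMod (36 * p)) :
    ((x + ((c * p : ℕ) : ZMod (36 * p))).val = x.val + c * p ∧ x.val + c * p < 36 * p) ∨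
      ((x + ((c * p : ℕ) : ZMod (36 * p))).val + 36 * p = x.val + c * p ∧ 36 * p ≤ x.val + c * p) := by
  have hcp : c * p < 36 * p := by nlinarith
  have hq : (((c * p : ℕ) : ZMod (36 * p))).val = c * p := by
    rw [ZMod.val_natCast, Nat.mod_eq_of_lt hcp]
  have hx := ZMod.val_lt x
  by_cases h : x.val + c * p < 36 * p
  · left
    refine ⟨?_, h⟩
    rw [ZMod.val_add_of_lt (by rw [hq]; exact h), hq]
  · right
    refine ⟨?_, by omega⟩
    have := ZMod.val_add_val_of_le (a := x) (b := ((c * p : ℕ) : ZMod (36 * p))) (by rw [hq]; omega)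
    rw [hq] at this
    omega

/-- **The lifts of a level-`18p` quadruple of type `γ` other than `γ_x` are not Hodge.** For `x` with `3 ∤ ⟨x⟩`, the multiset
`B_x = {x, x + 6p, x + 12p, 18p − 3x}` violates the norm equation at one of the units `1`, `1 + 12p`, `1 + 24p` (the last two fix
`18p − 3x` and shift the other three members by `12p`, `24p`). [cite: Shioda1979PJA, §1 eq. (2)] -/
private theorem three_thirds [NeZero (36 * p)] (hp : 0 < p) {x : ZMod (36 * p)} (hx3 : x.val % 3 ≠ 0) :
    ¬ IsHodgeMultiset ({x, x + ((6 * p : ℕ) : ZMod (36 * p)), x + D36, K36 - 3 * x} : Multiset (ZMod (36 * p))) := by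
  intro hH
  -- the units `1 + 12p`, `1 + 24p`
  have hDD : (D36 : ZMod (36 * p)) * D36 = 0 := by
    have : (D36 : ZMod (36 * p)) * D36 = ((4 * p : ℕ) : ZMod (36 * p)) * ((36 * p : ℕ) : ZMod (36 * p)) := by push_cast; ring
    rw [this, ZMod.natCast_self, mul_zero]
  have h3D : (3 : ZMod (36 * p)) * D36 = 0 := by
    have : (3 : ZMod (36 * p)) * D36 = ((36 * p : ℕ) : ZMod (36 * p)) := by push_cast; ring
    rw [this, ZMod.natCast_self]
  have hinv : (1 + D36 : ZMod (36 * p)) * (1 + 2 * D36) = 1 := by linear_combination h3D + 2 * hDD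
  have hinv' : (1 + 2 * D36 : ZMod (36 * p)) * (1 + D36) = 1 := by linear_combination h3D + 2 * hDD
  obtain ⟨u₁, hu₁⟩ : IsUnit (1 + D36 : ZMod (36 * p)) := ⟨⟨1 + D36, 1 + 2 * D36, hinv, hinv'⟩, rfl⟩
  obtain ⟨u₂, hu₂⟩ : IsUnit (1 + 2 * D36 : ZMod (36 * p)) := ⟨⟨1 + 2 * D36, 1 + D36, hinv', hinv⟩, rfl⟩
  -- `12p` acts on the members
  have hDx : D36 * x = ((x.val % 3 : ℕ) : ZMod (36 * p)) * D36 := D_mul x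
  have hDE : (D36 : ZMod (36 * p)) * ((6 * p : ℕ) : ZMod (36 * p)) = 0 := by
    have : (D36 : ZMod (36 * p)) * ((6 * p : ℕ) : ZMod (36 * p)) =
        ((2 * p : ℕ) : ZMod (36 * p)) * ((36 * p : ℕ) : ZMod (36 * p)) := by
      push_cast; ring
    rw [this, ZMod.natCast_self, mul_zero]
  have hDK : (D36 : ZMod (36 * p)) * K36 = 0 := by
    have : (D36 : ZMod (36 * p)) * K36 = ((6 * p : ℕ) : ZMod (36 * p)) * ((36 * p : ℕ) : ZMod (36 * p)) := by push_cast; ring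
    rw [this, ZMod.natCast_self, mul_zero]
  -- the residues `x + c p` as sums of natural-number casts
  have c18 : ((6 * p : ℕ) : ZMod (36 * p)) + D36 = ((18 * p : ℕ) : ZMod (36 * p)) := by push_cast; ring
  have c24 : (D36 : ZMod (36 * p)) + D36 = ((24 * p : ℕ) : ZMod (36 * p)) := by push_cast; ring
  have c24' : (2 : ZMod (36 * p)) * D36 = ((24 * p : ℕ) : ZMod (36 * p)) := by push_cast; ring
  have c30 : ((6 * p : ℕ) : ZMod (36 * p)) + 2 * D36 = ((30 * p : ℕ) : ZMod (36 * p)) := by push_cast; ring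
  have c36 : (D36 : ZMod (36 * p)) + 2 * D36 = 0 := by
    have : (D36 : ZMod (36 * p)) + 2 * D36 = ((36 * p : ℕ) : ZMod (36 * p)) := by push_cast; ring
    rw [this, ZMod.natCast_self]
  -- the norm equations at `1`, `u₁`, `u₂`
  have N0 := hH.2 1
  have N1 := hH.2 u₁
  have N2 := hH.2 u₂
  simp only [Units.val_one, one_mul, Multiset.map_id', hu₁, hu₂, Multiset.insert_eq_cons, Multiset.map_cons,
    Multiset.map_singleton, mNormSum_cons, Multiset.card_cons, Multiset.card_singleton] at N0 N1 N2
  simp only [mNormSum, Multiset.map_singleton, Multiset.sum_singleton] at N0 N1 N2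
  -- the representatives
  have hv := ZMod.val_lt x
  have v6 := val_add_mulP hp (c := 6) (by norm_num) x
  have v12 := val_add_mulP hp (c := 12) (by norm_num) x
  have v18 := val_add_mulP hp (c := 18) (by norm_num) x
  have v24 := val_add_mulP hp (c := 24) (by norm_num) x
  have v30 := val_add_mulP hp (c := 30) (by norm_num) x
  have hr : x.val % 3 = 1 ∨ x.val % 3 = 2 := by omega
  rcases hr with hr | hr
  · rw [hr, Nat.cast_one, one_mul] at hDx
    have p1 : (1 + D36) * x = x + ((12 * p : ℕ) : ZMod (36 * p)) := by linear_combination hDx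
    have p2 : (1 + D36) * (x + ((6 * p : ℕ) : ZMod (36 * p))) = x + ((18 * p : ℕ) : ZMod (36 * p)) := by
      rw [← c18]; linear_combination hDx + hDE
    have p3 : (1 + D36) * (x + D36) = x + ((24 * p : ℕ) : ZMod (36 * p)) := by rw [← c24]; linear_combination hDx + hDD
    have p4 : (1 + D36) * (K36 - 3 * x) = K36 - 3 * x := by linear_combination hDK - 3 * hDx - h3D
    have q1 : (1 + 2 * D36) * x = x + ((24 * p : ℕ) : ZMod (36 * p)) := by rw [← c24']; linear_combination 2 * hDx
    have q2 : (1 + 2 * D36) * (x + ((6 * p : ℕ) : ZMod (36 * p))) = x + ((30 * p : ℕ) : ZMod (36 * p)) := by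
      rw [← c30]; linear_combination 2 * hDx + 2 * hDE
    have q3 : (1 + 2 * D36) * (x + D36) = x := by linear_combination 2 * hDx + 2 * hDD + c36
    have q4 : (1 + 2 * D36) * (K36 - 3 * x) = K36 - 3 * x := by linear_combination 2 * hDK - 6 * hDx - 2 * h3D
    rw [p1, p2, p3, p4] at N1
    rw [q1, q2, q3, q4] at N2
    omega
  · rw [hr, Nat.cast_ofNat] at hDx
    have p1 : (1 + D36) * x = x + ((24 * p : ℕ) : ZMod (36 * p)) := by rw [← c24']; linear_combination hDx
    have p2 : (1 + D36) * (x + ((6 * p : ℕ) : ZMod (36 * p))) = x + ((30 * p : ℕ) : ZMod (36 * p)) := by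
      rw [← c30]; linear_combination hDx + hDE
    have p3 : (1 + D36) * (x + D36) = x := by linear_combination hDx + hDD + c36
    have p4 : (1 + D36) * (K36 - 3 * x) = K36 - 3 * x := by linear_combination hDK - 3 * hDx - 2 * h3D
    have q1 : (1 + 2 * D36) * x = x + ((12 * p : ℕ) : ZMod (36 * p)) := by linear_combination 2 * hDx + h3D
    have q2 : (1 + 2 * D36) * (x + ((6 * p : ℕ) : ZMod (36 * p))) = x + ((18 * p : ℕ) : ZMod (36 * p)) := by
      rw [← c18]; linear_combination 2 * hDx + 2 * hDE + h3D
    have q3 : (1 + 2 * D36) * (x + D36) = x + ((24 * p : ℕ) : ZMod (36 * p)) := by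
      rw [← c24]; linear_combination 2 * hDx + 2 * hDD + h3D
    have q4 : (1 + 2 * D36) * (K36 - 3 * x) = K36 - 3 * x := by linear_combination 2 * hDK - 6 * hDx - 4 * h3D
    rw [p1, p2, p3, p4] at N1
    rw [q1, q2, q3, q4] at N2
    omega

/-- Residues mod `3` along the reduction `ℤ/36p → ℤ/18p`. [folklore] -/
private theorem val_castHom_mod_three [NeZero (36 * p)] (hnm : 18 * p ∣ 36 * p) (y : ZMod (36 * p)) :
    (ZMod.castHom hnm (ZMod (18 * p)) y).val % 3 = y.val % 3 := by
  rw [val_castHom, Nat.mod_mod_of_dvd _ (⟨6 * p, by ring⟩ : 3 ∣ 18 * p)]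

/-- Residues mod `3` at level `18p`: sums. [folklore] -/
private theorem add_val_mod_three [NeZero (18 * p)] (a b : ZMod (18 * p)) : (a + b).val % 3 = (a.val + b.val) % 3 := by
  rw [ZMod.val_add, Nat.mod_mod_of_dvd _ (⟨6 * p, by ring⟩ : 3 ∣ 18 * p)]

/-- Residues mod `3` at level `18p`: negation. [folklore] -/
private theorem neg_val_mod_three [NeZero (18 * p)] (a : ZMod (18 * p)) : (-a).val % 3 = (3 - a.val % 3) % 3 := by
  rw [ZMod.neg_val]
  split_ifs with h
  · simp [h]
  · have := ZMod.val_lt a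
    omega

/-- Residues mod `3` at level `18p`: triples. [folklore] -/
private theorem three_mul_val_mod_three [NeZero (18 * p)] (hp : 0 < p) (a : ZMod (18 * p)) :
    ((3 : ZMod (18 * p)) * a).val % 3 = 0 := by
  have h3 : (3 : ZMod (18 * p)).val = 3 := by
    rw [show (3 : ZMod (18 * p)) = ((3 : ℕ) : ZMod (18 * p)) by norm_cast, ZMod.val_natCast, Nat.mod_eq_of_lt (by omega)]
  rw [ZMod.val_mul, Nat.mod_mod_of_dvd _ (⟨6 * p, by ring⟩ : 3 ∣ 18 * p), h3]
  omega

/-- **All members odd, one off the fibre `0`, one prime to `3`:** `s = γ_x`. `s̄ = s mod 18p` is a Hodge quadruple of level `18p`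
with odd members; if it has a pair then `s = {v₁, 18p − v₁, v₃, 18p − v₃}`, which violates the relations (`halfpair_odd`); otherwise
the level-`18p` theorem applies: the types `α`, `β` have an even member and the lifted level-`18` quadruples lie inside `pℤ/18p`, so
`s̄ = γ_y`; lifting, `s = {x, x₂, x₃, x₄}` with `3 ∤ ⟨x⟩`, `x₂ ∈ x + 6p + {0, 18p}`, `x₃ ∈ x + 12p + {0, 18p}`, `x₄ ∈ −3x + {0, 18p}`,
and the sum condition leaves `γ_x` and three multisets of the shape `B_{x′}` excluded by `three_thirds`.
[cite: AokiShioda1983, §2 Theorem (𝔅²ₘ) (ii) c)] [cite: Aoki1983, Prop. 2.2] -/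
private theorem case_all_odd (h : Nat.Coprime 36 p) [NeZero (36 * p)] (hp : p.Prime) (h17 : 17 ≤ p)
    {s : Multiset (ZMod (36 * p))} (hs : IsHodgeMultiset s) (hcard : Multiset.card s = 4)
    (hpf : ∀ a ∈ s, ∀ b ∈ s.erase a, a + b ≠ 0) (hodd : ∀ w ∈ s, w.val % 2 = 1) (hex : ∃ w ∈ s, (crt h w).2 ≠ 0)
    (h3 : ∃ w ∈ s, w.val % 3 ≠ 0) : Concl s := by
  classical
  haveI := Fact.mk hp
  have hp0 := hp.pos
  have h5 : 5 ≤ p := by omega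
  haveI : NeZero (18 * p) := ⟨by omega⟩
  have hnm : 18 * p ∣ 36 * p := ⟨2, by ring⟩
  have hT := isHodgeMultiset_transfer_thirtySixPrime hp0 hnm (so := s) (se := 0) hodd (by simp) (by simpa using hs)
  simp only [Multiset.map_zero, add_zero] at hT
  have hc4 : Multiset.card (s.map (ZMod.castHom hnm (ZMod (18 * p)))) = 4 := by rw [Multiset.card_map, hcard]
  have hRel := rels_of_isHodgeMultiset h hp h5 hs
  have hRodd : ∀ a ∈ s.map (ZMod.castHom hnm (ZMod (18 * p))), a.val % 2 = 1 := by
    intro a ha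
    obtain ⟨w, hw, rfl⟩ := Multiset.mem_map.mp ha
    rw [val_castHom_mod_two hnm, hodd w hw]
  -- the reduction to `ℤ/p`
  set ρ := ZMod.castHom (dvd_mul_left p 18) (ZMod p) with hρ
  have hρR : ∀ v : ZMod (36 * p), ρ (ZMod.castHom hnm (ZMod (18 * p)) v) = (crt h v).2 := castHom_castHom_eq_snd h hnm
  have hρE : ρ E18 = 0 := by rw [map_natCast, Nat.cast_mul, ZMod.natCast_self, mul_zero]
  -- `s̄` is not contained in `ℤ y + pℤ/18p` for `y ∈ pℤ/18p`
  have hexT : ∀ y : ZMod (18 * p), ρ y = 0 →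
      (∀ a ∈ s.map (ZMod.castHom hnm (ZMod (18 * p))), ∃ j : ZMod (18 * p), a = j * y ∨ a = y + j * E18) → False := by
    intro y hy hall
    obtain ⟨w, hw, hwc⟩ := hex
    obtain ⟨j, hj⟩ := hall _ (Multiset.mem_map.mpr ⟨w, hw, rfl⟩)
    apply hwc
    rw [← hρR]
    rcases hj with hj | hj <;> rw [hj]
    · rw [_root_.map_mul, hy, mul_zero]
    · rw [_root_.map_add, _root_.map_mul, hy, hρE, mul_zero, add_zero]
  by_cases hpair : ∀ a ∈ s.map (ZMod.castHom hnm (ZMod (18 * p))),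
      ∀ b ∈ (s.map (ZMod.castHom hnm (ZMod (18 * p)))).erase a, a + b ≠ 0
  · obtain ⟨y, hy⟩ := classify_hodgeMultiset_eighteenPrime hp h17 hT hc4 hpair
    rcases hy with e | e | e | ⟨⟨t, -, hty⟩, e⟩
    · exfalso
      have := hRodd (-(2 * y)) (by rw [e]; simp)
      rw [val_neg_mod_two_eighteen, val_two_mul_mod_two_eighteen] at this
      omega
    · exfalso
      have := hRodd (-(4 * y)) (by rw [e]; simp)
      rw [val_neg_mod_two_eighteen, show (4 : ZMod (18 * p)) * y = 2 * (2 * y) by ring, val_two_mul_mod_two_eighteen] at this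
      omega
    · -- type `γ` at level `18p`: choose `x ∈ s` over `y` and the other members over `y + 6p`, `y + 12p`, `−3y`
      have hyT : y ∈ s.map (ZMod.castHom hnm (ZMod (18 * p))) := by rw [e]; simp
      obtain ⟨x, hx, hxy⟩ := Multiset.mem_map.mp hyT
      obtain ⟨t, hst⟩ := Multiset.exists_cons_of_mem hx
      have htR : t.map (ZMod.castHom hnm (ZMod (18 * p))) = {y + E18, y + 2 * E18, -(3 * y)} := by
        have := e
        rw [hst, Multiset.map_cons, hxy, Multiset.insert_eq_cons, Multiset.cons_inj_right] at this
        exact this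
      obtain ⟨x₂, x₃, x₄, rfl, h₂, h₃, h₄⟩ := exists_triple_of_map_eq htR
      -- `3 ∤ ⟨x⟩`
      have hx3 : x.val % 3 ≠ 0 := by
        intro hx0
        have hy3 : y.val % 3 = 0 := by rw [← hxy, val_castHom_mod_three hnm]; exact hx0
        have hE3 : (E18).val % 3 = 0 := by rw [val_E18 hp0]; omega
        have h3y := three_mul_val_mod_three hp0 y
        obtain ⟨w, hw, hw3⟩ := h3
        apply hw3
        rw [← val_castHom_mod_three hnm]
        have hwT : ZMod.castHom hnm (ZMod (18 * p)) w ∈ s.map (ZMod.castHom hnm (ZMod (18 * p))) :=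
          Multiset.mem_map.mpr ⟨w, hw, rfl⟩
        rw [e] at hwT
        simp only [Multiset.insert_eq_cons, Multiset.mem_cons, Multiset.mem_singleton] at hwT
        rcases hwT with ew | ew | ew | ew <;> rw [ew]
        · exact hy3
        · rw [add_val_mod_three]; omega
        · rw [two_mul, add_val_mod_three, Nat.add_mod, add_val_mod_three E18 E18]; omega
        · rw [neg_val_mod_three]; omega
      -- the lifts of the other three members
      have hE : ZMod.castHom hnm (ZMod (18 * p)) (((6 * p : ℕ)) : ZMod (36 * p)) = E18 := by rw [map_natCast]
      have hD : ZMod.castHom hnm (ZMod (18 * p)) D36 = 2 * E18 := by rw [map_natCast]; push_cast; ring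
      have l₂ := lift_eq hp0 hnm (a := x₂) (b := x + ((6 * p : ℕ) : ZMod (36 * p))) (by rw [h₂, _root_.map_add, hxy, hE])
      have l₃ := lift_eq hp0 hnm (a := x₃) (b := x + D36) (by rw [h₃, _root_.map_add, hxy, hD])
      have l₄ := lift_eq hp0 hnm (a := x₄) (b := -(3 * x)) (by rw [h₄, _root_.map_neg, _root_.map_mul, hxy, map_ofNat])
      -- the sum condition
      have hsum := hs.1.2
      rw [hst] at hsum
      simp only [Multiset.insert_eq_cons, Multiset.sum_cons, Multiset.sum_singleton] at hsum
      have hEDK : ((6 * p : ℕ) : ZMod (36 * p)) + D36 = K36 := by push_cast; ring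
      have hKne : (K36 : ZMod (36 * p)) ≠ 0 := K_ne_zero hp0
      have hKK := K_add_K (p := p)
      -- `3 ∤ ⟨x + 30p⟩`, `3 ∤ ⟨x + 24p⟩`
      have hx30 : (x + ((30 * p : ℕ) : ZMod (36 * p))).val % 3 ≠ 0 := by
        rcases val_add_mulP hp0 (c := 30) (by norm_num) x with ⟨ev, -⟩ | ⟨ev, -⟩ <;> omega
      have hx24 : (x + ((24 * p : ℕ) : ZMod (36 * p))).val % 3 ≠ 0 := by
        rcases val_add_mulP hp0 (c := 24) (by norm_num) x with ⟨ev, -⟩ | ⟨ev, -⟩ <;> omega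
      rcases l₂ with rfl | rfl <;> rcases l₃ with rfl | rfl <;> rcases l₄ with rfl | rfl
      · -- (0,0,0): the sum is `18p ≠ 0`
        exfalso; apply hKne; linear_combination hsum - hEDK
      · -- (0,0,1): `B_x`
        exfalso
        refine three_thirds hp0 hx3 ?_
        have e' : s = {x, x + ((6 * p : ℕ) : ZMod (36 * p)), x + D36, K36 - 3 * x} := by
          rw [hst]; simp only [Multiset.insert_eq_cons, show K36 - 3 * x = -(3 * x) + K36 by ring]
        rw [← e']; exact hs
      · -- (0,1,0): `B_{x + 30p}`
        exfalso
        refine three_thirds hp0 hx30 ?_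
        have e1 : x + ((30 * p : ℕ) : ZMod (36 * p)) + ((6 * p : ℕ) : ZMod (36 * p)) = x := by
          have : x + ((30 * p : ℕ) : ZMod (36 * p)) + ((6 * p : ℕ) : ZMod (36 * p)) = x + ((36 * p : ℕ) : ZMod (36 * p)) := by
            push_cast; ring
          rw [this, ZMod.natCast_self, add_zero]
        have e2 : x + ((30 * p : ℕ) : ZMod (36 * p)) + D36 = x + ((6 * p : ℕ) : ZMod (36 * p)) := by
          have : x + ((30 * p : ℕ) : ZMod (36 * p)) + D36 =
              x + ((6 * p : ℕ) : ZMod (36 * p)) + ((36 * p : ℕ) : ZMod (36 * p)) := by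
            push_cast; ring
          rw [this, ZMod.natCast_self, add_zero]
        have e3 : K36 - 3 * (x + ((30 * p : ℕ) : ZMod (36 * p))) = -(3 * x) := by
          have : K36 - 3 * (x + ((30 * p : ℕ) : ZMod (36 * p))) = -(3 * x) - 2 * ((36 * p : ℕ) : ZMod (36 * p)) := by
            push_cast; ring
          rw [this, ZMod.natCast_self, mul_zero, sub_zero]
        have e4 : x + ((30 * p : ℕ) : ZMod (36 * p)) = x + D36 + K36 := by push_cast; ring
        rw [e1, e2, e3, e4]
        have e' : s = {x + D36 + K36, x, x + ((6 * p : ℕ) : ZMod (36 * p)), -(3 * x)} := by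
          rw [hst]; simp only [Multiset.insert_eq_cons, ← Multiset.singleton_add]; abel
        rw [← e']; exact hs
      · exfalso; apply hKne; linear_combination hsum - hEDK - hKK
      · -- (1,0,0): `γ_x`
        refine ⟨x, Or.inr (Or.inr (Or.inl ?_))⟩
        rw [hst, show x + ((6 * p : ℕ) : ZMod (36 * p)) + K36 = x + 2 * D36 by push_cast; ring]
        simp only [Multiset.insert_eq_cons, ← Multiset.singleton_add]; abel
      · exfalso; apply hKne; linear_combination hsum - hEDK - hKK
      · exfalso; apply hKne; linear_combination hsum - hEDK - hKK
      · -- (1,1,1): `B_{x + 24p}`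
        exfalso
        refine three_thirds hp0 hx24 ?_
        have e1 : x + ((24 * p : ℕ) : ZMod (36 * p)) + ((6 * p : ℕ) : ZMod (36 * p)) = x + D36 + K36 := by
          push_cast; ring
        have e2 : x + ((24 * p : ℕ) : ZMod (36 * p)) + D36 = x := by
          have : x + ((24 * p : ℕ) : ZMod (36 * p)) + D36 = x + ((36 * p : ℕ) : ZMod (36 * p)) := by push_cast; ring
          rw [this, ZMod.natCast_self, add_zero]
        have e3 : K36 - 3 * (x + ((24 * p : ℕ) : ZMod (36 * p))) = -(3 * x) + K36 := by
          have : K36 - 3 * (x + ((24 * p : ℕ) : ZMod (36 * p))) = -(3 * x) + K36 - 2 * ((36 * p : ℕ) : ZMod (36 * p)) := by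
            push_cast; ring
          rw [this, ZMod.natCast_self, mul_zero, sub_zero]
        have e4 : x + ((24 * p : ℕ) : ZMod (36 * p)) = x + ((6 * p : ℕ) : ZMod (36 * p)) + K36 := by push_cast; ring
        rw [e1, e2, e3, e4]
        have e' : s = {x + ((6 * p : ℕ) : ZMod (36 * p)) + K36, x + D36 + K36, x, -(3 * x) + K36} := by
          rw [hst]; simp only [Multiset.insert_eq_cons, ← Multiset.singleton_add]; abel
        rw [← e']; exact hs
    · -- a lifted exceptional quadruple of level `18` lies inside `pℤ/18p`
      exfalso
      have hρy : ρ y = 0 := by rw [hty, map_natCast, Nat.cast_mul, ZMod.natCast_self, mul_zero]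
      refine hexT y hρy fun a ha ↦ ?_
      rcases e with e | e | e
      all_goals
        rw [e] at ha
        simp only [Multiset.insert_eq_cons, Multiset.mem_cons, Multiset.mem_singleton] at ha
        rcases ha with rfl | rfl | rfl | rfl
      · exact ⟨1, Or.inl (by ring)⟩
      · exact ⟨6, Or.inl rfl⟩
      · exact ⟨14, Or.inl rfl⟩
      · exact ⟨15, Or.inl rfl⟩
      · exact ⟨1, Or.inl (by ring)⟩
      · exact ⟨7, Or.inl rfl⟩
      · exact ⟨12, Or.inl rfl⟩
      · exact ⟨16, Or.inl rfl⟩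
      · exact ⟨1, Or.inl (by ring)⟩
      · exact ⟨9, Or.inl rfl⟩
      · exact ⟨12, Or.inl rfl⟩
      · exact ⟨14, Or.inl rfl⟩
  · -- `s̄` has a pair: `s = {v₁, 18p − v₁, v₃, 18p − v₃}`
    exfalso
    push Not at hpair
    obtain ⟨a, ha, b, hb, hab⟩ := hpair
    obtain ⟨u₁, hu₁, rfl⟩ := Multiset.mem_map.mp ha
    rw [← Multiset.map_erase_of_mem _ _ hu₁] at hb
    obtain ⟨u₂, hu₂, rfl⟩ := Multiset.mem_map.mp hb
    have hK0 : ZMod.castHom hnm (ZMod (18 * p)) K36 = 0 := by rw [map_natCast, ZMod.natCast_self]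
    rcases lift_eq hp0 hnm (a := u₂) (b := -u₁) (by rw [_root_.map_neg]; linear_combination hab) with e2 | e2
    · exact hpf u₁ hu₁ u₂ hu₂ (by rw [e2, add_neg_cancel])
    obtain ⟨t, ht⟩ : ∃ t, s = u₁ ::ₘ u₂ ::ₘ t := by
      obtain ⟨t, ht⟩ := Multiset.exists_cons_of_mem hu₂
      exact ⟨t, by rw [← Multiset.cons_erase hu₁, ht]⟩
    have hct : Multiset.card t = 2 := by
      rw [ht, Multiset.card_cons, Multiset.card_cons] at hcard; omega
    obtain ⟨u₃, u₄, rfl⟩ := Multiset.card_eq_two.mp hct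
    have hu₃ : u₃ ∈ s := by rw [ht]; simp
    have hu₄ : u₄ ∈ s.erase u₃ := by
      rw [ht, show u₁ ::ₘ u₂ ::ₘ ({u₃, u₄} : Multiset (ZMod (36 * p))) = u₃ ::ₘ u₁ ::ₘ u₂ ::ₘ {u₄} by
        simp only [Multiset.insert_eq_cons, ← Multiset.singleton_add]; abel, Multiset.erase_cons_head]
      simp
    have hτ : IsHodgeMultiset ({ZMod.castHom hnm (ZMod (18 * p)) u₃, ZMod.castHom hnm (ZMod (18 * p)) u₄} :
        Multiset (ZMod (18 * p))) := by
      have e3 : s.map (ZMod.castHom hnm (ZMod (18 * p))) = ZMod.castHom hnm (ZMod (18 * p)) u₁ ::ₘ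
          (-ZMod.castHom hnm (ZMod (18 * p)) u₁) ::ₘ
            {ZMod.castHom hnm (ZMod (18 * p)) u₃, ZMod.castHom hnm (ZMod (18 * p)) u₄} := by
        rw [ht]
        simp only [Multiset.map_cons, Multiset.insert_eq_cons, Multiset.map_singleton, e2, _root_.map_add, _root_.map_neg, hK0,
          add_zero]
      rw [e3] at hT
      exact isHodgeMultiset_of_cons_cons_neg hT
    have e4 := eq_neg_of_isHodgeMultiset_pair hτ
    rcases lift_eq hp0 hnm (a := u₄) (b := -u₃) (by rw [_root_.map_neg]; exact e4) with e5 | e5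
    · exact hpf u₃ hu₃ u₄ hu₄ (by rw [e5, add_neg_cancel])
    -- order the two half-pairs so that the first is off the fibre `0`
    have hsw : s = {u₁, -u₁ + K36, u₃, -u₃ + K36} := by rw [ht, e2, e5]; rfl
    have hord : ∃ v₁ v₃ : ZMod (36 * p), (crt h v₁).2 ≠ 0 ∧ s = {v₁, -v₁ + K36, v₃, -v₃ + K36} := by
      by_cases h₁ : (crt h u₁).2 ≠ 0
      · exact ⟨u₁, u₃, h₁, hsw⟩
      · push Not at h₁
        refine ⟨u₃, u₁, ?_, by rw [hsw]; simp only [Multiset.insert_eq_cons, ← Multiset.singleton_add]; abel⟩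
        obtain ⟨w, hw, hw0⟩ := hex
        rw [hsw] at hw
        have hK2 : (crt h K36).2 = 0 := by rw [eighteenP_eq_pt h hp h5, crt_pt]
        simp only [Multiset.insert_eq_cons, Multiset.mem_cons, Multiset.mem_singleton] at hw
        rcases hw with rfl | rfl | rfl | rfl
        · exact absurd h₁ hw0
        · exfalso; apply hw0; rw [_root_.map_add, Prod.snd_add, _root_.map_neg, Prod.snd_neg, h₁, hK2, neg_zero, add_zero]
        · exact hw0
        · intro h₃; apply hw0; rw [_root_.map_add, Prod.snd_add, _root_.map_neg, Prod.snd_neg, h₃, hK2, neg_zero, add_zero]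
    obtain ⟨v₁, v₃, hc, hsv⟩ := hord
    have hv₁ : v₁ ∈ s := by rw [hsv]; simp
    have hv₃ : v₃ ∈ s.erase v₁ := by rw [hsv, Multiset.insert_eq_cons, Multiset.erase_cons_head]; simp
    have hv₃' : -v₃ + K36 ∈ s.erase v₁ := by rw [hsv, Multiset.insert_eq_cons, Multiset.erase_cons_head]; simp
    have hv₃s : v₃ ∈ s := Multiset.mem_of_mem_erase hv₃
    obtain ⟨e₀, c, rfl⟩ : ∃ e₀ c, v₁ = pt h e₀ c := ⟨_, _, (pt_crt h v₁).symm⟩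
    obtain ⟨f, c', rfl⟩ : ∃ f c', v₃ = pt h f c' := ⟨_, _, (pt_crt h v₃).symm⟩
    simp only [crt_pt] at hc
    have he₀ : e₀.val % 2 = 1 := by rw [← val_pt_mod_two h e₀ c]; exact hodd _ hv₁
    have hf : f.val % 2 = 1 := by rw [← val_pt_mod_two h f c']; exact hodd _ hv₃s
    have hK' : ∀ (e : ZMod 36) (b : ZMod p), -(pt h e b) + K36 = pt h (18 - e) (-b) := by
      intro e b
      rw [eighteenP_eq_pt h hp h5, neg_pt, pt_add, add_zero, show -e + 18 = 18 - e by ring]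
    have hz1 : ((f, c') : ZMod 36 × ZMod p) ≠ -(e₀, c) := by
      intro hq
      apply hpf _ hv₁ _ hv₃
      have : crt h (pt h f c') = crt h (-(pt h e₀ c)) := by rw [crt_pt, _root_.map_neg, crt_pt]; exact hq
      have := (crt h).injective this
      rw [this, add_neg_cancel]
    have hz2 : ((18 - f, -c') : ZMod 36 × ZMod p) ≠ -(e₀, c) := by
      intro hq
      apply hpf _ hv₁ _ hv₃'
      have : crt h (-(pt h f c') + K36) = crt h (-(pt h e₀ c)) := by rw [hK', crt_pt, _root_.map_neg, crt_pt]; exact hq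
      have := (crt h).injective this
      rw [this, add_neg_cancel]
    refine halfpair_odd hp h17 he₀ hf hc ?_ hz1 hz2
    rw [hsv, hK', hK'] at hRel
    simp only [Multiset.insert_eq_cons, Multiset.map_cons, Multiset.map_singleton, crt_pt] at hRel
    exact hRel

/-! ### Assembly -/

/-- **Classification of the pair-free Hodge `4`-multisets of level `36p`, `p ≥ 19` prime** (multiset form of Shioda's Prop. 4 (Q′) /
Aoki–Shioda's Theorem (𝔅²ₘ) (ii) a), b), c) at `m = 36p`, together with the non-standard quadruples of level `36`). A pair-free Hodge
`4`-multiset over `ℤ/36p` is `{x, x + 18p, −2x, 18p}` (type `α`, `m′ = 18p`), `{x, x + 18p, 2x + 18p, −4x}` (type `β`) or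
`{x, x + 12p, x + 24p, −3x}` (type `γ`, `m″ = 12p`) for some residue `x`, or `x·r` with `x = t p`, `t` a unit of `ℤ/36`, and `r` one of
the seven non-standard shapes of level `36`: the Tabelle-1 rows `(1, 19, 24, 28)`, `(2, 9, 28, 33)` of `N = 36`, twice the rows
`(1, 6, 14, 15)`, `(1, 7, 12, 16)`, `(1, 9, 12, 14)` of `N = 18`, three times the rows `(1, 4, 9, 10)`, `(1, 6, 8, 9)` of `N = 12`
(`44` multisets). PROOF: the character relations of `KoblitzOgusRelationsThirtySixPrime` (from `KoblitzOgus.hodge_eq_combination`),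
the transfer to level `18p`, the lifts `𝔍ₘ(d) ≅ 𝔍_{m/d}(1)` for `d = 2, 3, p` with the classifications at `18p`, `12p`, `36`, and the
norm equations at the units `pt(1, λ)`, `1 + 12p`, `1 + 24p`: `fibre_zero`, `case_all_triple`, `case_all_even`, `case_two_odd`,
`case_two_odd_fibre`, `case_all_odd`.
[cite: Shioda1982PicardFermat, §4 Lemma 1 p. 728, Prop. 4 (Q′) p. 729 and table p. 727 (m = 36)]
[cite: AokiShioda1983, §2 Theorem (𝔅²ₘ) (ii) a), b), c)] [cite: MeyerNeutsch1981Fermatquadrupel, Tabelle 1 p. 54 (N = 12, 18, 36)]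
[cite: Aoki1983, Prop. 2.2] [cite: Deligne1982HodgeCycles, Rem. 7.16 (a)] -/
theorem classify_hodgeMultiset_thirtySixPrime [NeZero (36 * p)] (hp : p.Prime) (h19 : 19 ≤ p)
    {s : Multiset (ZMod (36 * p))} (hs : IsHodgeMultiset s) (hcard : Multiset.card s = 4)
    (hind : ∀ a ∈ s, ∀ b ∈ s.erase a, a + b ≠ 0) :
    ∃ x : ZMod (36 * p), s = {x, x + K36, -(2 * x), K36} ∨ s = {x, x + K36, 2 * x + K36, -(4 * x)} ∨
      s = {x, x + D36, x + 2 * D36, -(3 * x)} ∨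
      ((∃ t : ℕ, (t = 1 ∨ t = 5 ∨ t = 7 ∨ t = 11 ∨ t = 13 ∨ t = 17 ∨ t = 19 ∨ t = 23 ∨ t = 25 ∨ t = 29 ∨ t = 31 ∨ t = 35) ∧
          x = ((t * p : ℕ) : ZMod (36 * p))) ∧
        (s = {x, 19 * x, 24 * x, 28 * x} ∨ s = {2 * x, 9 * x, 28 * x, 33 * x} ∨ s = {2 * x, 12 * x, 28 * x, 30 * x} ∨
          s = {2 * x, 14 * x, 24 * x, 32 * x} ∨ s = {2 * x, 18 * x, 24 * x, 28 * x} ∨ s = {3 * x, 12 * x, 27 * x, 30 * x} ∨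
          s = {3 * x, 18 * x, 24 * x, 27 * x})) := by
  classical
  have h5 : 5 ≤ p := by omega
  have h17 : 17 ≤ p := by omega
  have h := coprime_thirtysix hp h5
  show Concl s
  -- the fibre `0`
  by_cases hex : ∃ w ∈ s, (crt h w).2 ≠ 0
  swap
  · push Not at hex
    exact fibre_zero h hp hs hcard hind hex
  -- all members divisible by `3`
  by_cases h3 : ∃ w ∈ s, w.val % 3 ≠ 0
  swap
  · push Not at h3
    exact case_all_triple hp h17 hs hcard hind h3
  -- split by parity
  set so := s.filter fun w ↦ w.val % 2 = 1 with hso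
  set se := s.filter fun w ↦ ¬ w.val % 2 = 1 with hse
  have hsplit : s = so + se := (Multiset.filter_add_not _ s).symm
  have hcs : Multiset.card so + Multiset.card se = 4 := by rw [← Multiset.card_add, ← hsplit, hcard]
  have heven : Even (Multiset.card so) := even_card_filter_odd hs.1.2
  have hso1 : ∀ v ∈ so, v.val % 2 = 1 := fun v hv ↦ (Multiset.mem_filter.mp hv).2
  have hse0 : ∀ v ∈ se, v.val % 2 = 0 := fun v hv ↦ by have := (Multiset.mem_filter.mp hv).2; omega
  obtain ⟨k, hk⟩ := heven
  have hk2 : k ≤ 2 := by omega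
  interval_cases k
  · -- no odd member
    have h0 : so = 0 := Multiset.card_eq_zero.mp (by omega)
    rw [h0, zero_add] at hsplit
    exact case_all_even hp h17 hs hcard hind fun v hv ↦ hse0 v (hsplit ▸ hv)
  · -- two odd members
    have h2 : Multiset.card so = 2 := by omega
    have h2' : Multiset.card se = 2 := by omega
    obtain ⟨x, y, hxy⟩ := Multiset.card_eq_two.mp h2
    obtain ⟨z, w, hzw⟩ := Multiset.card_eq_two.mp h2'
    have hx1 : x.val % 2 = 1 := hso1 x (by rw [hxy]; simp)
    have hy1 : y.val % 2 = 1 := hso1 y (by rw [hxy]; simp)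
    have hz0 : z.val % 2 = 0 := hse0 z (by rw [hzw]; simp)
    have hw0 : w.val % 2 = 0 := hse0 w (by rw [hzw]; simp)
    have hsx : s = {x, y, z, w} := by rw [hsplit, hxy, hzw, pair_add_pair]
    by_cases hxc : (crt h x).2 ≠ 0
    · rcases case_two_odd h hp h17 hs hind hsx hx1 hy1 hz0 hw0 hxc with e | e
      · exact ⟨x, Or.inl e⟩
      · exact ⟨x, Or.inr (Or.inl e)⟩
    by_cases hyc : (crt h y).2 ≠ 0
    · have hsy : s = {y, x, z, w} := by
        rw [hsx]; simp only [Multiset.insert_eq_cons]; exact Multiset.cons_swap x y _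
      rcases case_two_odd h hp h17 hs hind hsy hy1 hx1 hz0 hw0 hyc with e | e
      · exact ⟨y, Or.inl e⟩
      · exact ⟨y, Or.inr (Or.inl e)⟩
    push Not at hxc hyc
    exfalso
    by_cases hzc : (crt h z).2 ≠ 0
    · exact case_two_odd_fibre h hp h19 hs hind hsx hz0 hw0 hxc hyc hzc
    push Not at hzc
    have hwc : (crt h w).2 ≠ 0 := by
      obtain ⟨v, hv, hvc⟩ := hex
      rw [hsx] at hv
      simp only [Multiset.insert_eq_cons, Multiset.mem_cons, Multiset.mem_singleton] at hv
      rcases hv with rfl | rfl | rfl | rfl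
      · exact absurd hxc hvc
      · exact absurd hyc hvc
      · exact absurd hzc hvc
      · exact hvc
    have hsw : s = {x, y, w, z} := by rw [hsx, Multiset.pair_comm z w]
    exact case_two_odd_fibre h hp h19 hs hind hsw hw0 hz0 hxc hyc hwc
  · -- four odd members
    have h0 : se = 0 := Multiset.card_eq_zero.mp (by omega)
    rw [h0, add_zero] at hsplit
    exact case_all_odd h hp h17 hs hcard hind (fun v hv ↦ hso1 v (hsplit ▸ hv)) hex h3

end ThirtySixPrimeClassification

end Literature.AlgebraicGeometry.Shioda1982
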